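import Mathlib.Analysis.Normed.Operator.Compact.FredholmAlternative
import Mathlib.Analysis.Calculus.InverseFunctionTheorem.FDeriv
import Mathlib.Analysis.Calculus.FDeriv.Bilinear
import Mathlib.Analysis.Calculus.FDeriv.Prod
import Mathlib.Analysis.Calculus.FDeriv.Add
import Mathlib.Analysis.Normed.Lp.lpSpace
import Mathlib.Topology.Algebra.Module.FiniteDimension
import Mathlib.Analysis.Real.Pi.Bounds
import Literature.Analysis.FluidPDE.LinearizedNSTorus
import Literature.Analysis.FluidPDE.SteadyNavierStokesRegularity
import Literature.Analysis.FluidPDE.TorusLpOperatorFacts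
import Literature.Analysis.FluidPDE.PassiveScalarWellPosednessProofs
import Literature.Analysis.FluidPDE.LerayProjectorTorusProofs
import Literature.Analysis.FluidPDE.CorrectorFourierSymmetry
import Literature.Analysis.FunctionSpaces.TorusFourierSynthesis
import Literature.Analysis.FunctionSpaces.TorusVectorParseval
import Literature.Analysis.FunctionSpaces.TorusFourierCalculus
import Literature.Analysis.FunctionSpaces.LatticeSobolevRellich
import HarnessLib

/-!
# The steady Navier–Stokes equations on the Fourier lattice `ℤ³`: the implicit-function machinery
# at fixed viscosity (Temam 1979, Ch. II §1; Foias–Temam 1977; Saut–Temam 1980, §2)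

Analysis/FluidPDE proof file (theorems only; no definitions, no named facts). The classical fact
that a steady state `u₀` of `NS_ν(f)` on `T³`, `ν > 0`, whose linearisation
`L(ν,u₀) w = νΔw − (u₀·∇)w − (w·∇)u₀ − ∇q` has trivial kernel is a regular point of the steady map,
so that steady states persist continuously under small changes of the force (Temam 1979, Ch. II
§1, Thm. 1.3 and its proof; Foias–Temam 1977, §1; Saut–Temam 1980, §2: the steady map is a
nonlinear Fredholm map of index `0` between `H² ∩ V` and `H`), is carried out here on the Fourier
lattice, where the Stokes operator is diagonal and products are lattice convolutions:

* §A–§B: square-summable families `ℤ³ → ℂ³` (Mathlib's `lp`), Young's inequality `ℓ¹ ⋆ ℓ² ⊂ ℓ²`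
  and Cauchy–Schwarz in `ℝ≥0∞` form (from the tree's `SteadyNS.young_lattice`,
  `SteadyNS.tsum_mul_le_Lp_mul_Lq`), the lattice sum `∑_{m≠0} |m|⁻⁴ < ∞`;
* §C: the convective symbol `N(a,b)(k) = ∑ₘ (2πi a(m)·(k−m)) b(k−m)` (the tree's
  `ScalarFourier.transportSym`, componentwise): pointwise bounds, the transversal (divergence) form,
  conjugate symmetry, bilinearity;
* §D–§E: the real Hilbert space `W ⊂ ℓ²(ℤ³; ℂ³)` of zero-mean, transversal, conjugate-symmetric
  families (an element `x` represents `û(k) = x(k)/|k|²`, an `H²`-type norm) and the bounded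
  bilinear map `B(x,y)(k) = Π_k N(x̌, y̌)(k)` (`Π = Torus.lerayCoeff`), both introduced by
  existence theorems;
* §F–§G: the linearised convective operator `K w = B(x₀,w) + B(w,x₀)` gains one weight, hence is
  compact (Rellich on the lattice, `Lattice.rellich`); the strict derivative of
  `G(x) = c x + B(x,x)`; the Fredholm alternative (`IsCompactOperator.hasEigenvalue_or_mem_resolventSet`)
  packaged as "compact perturbation of `c·1` with trivial kernel is a linear homeomorphism"; local
  solvability from the inverse function theorem (`HasStrictFDerivAt.localInverse`);
* §H: Fourier coefficients of `(u·∇)v`, `(w·∇)u`, `∇p`, `Δu` (the dictionary with the classical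
  torus calculus `Literature.Analysis.FunctionSpaces.Torus.*`);
* §I: elliptic regularity on the lattice — `H²` solutions of the steady and of the linearised
  lattice equations are rapidly decaying (the tree's bootstrap `SteadyNS.tsum_weight_mul_ne_top`);
* §K: classical steady states solve the projected lattice equations
  (`fourier_eq_of_isSteadyNSState`); conversely rapidly decaying solutions synthesise classical
  mean-zero steady states with a smooth pressure (`steadyState_of_fourier`), and rapidly decaying
  kernel vectors of the linearised lattice operator synthesise classical eigenvectors
  (`isLinNSEigenvalue_of_fourier`, for `Torus.IsLinNSEigenvalue` of `LinearizedNSTorus`).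

Design: no definitions — the recurring term patterns (`cf`, `nl`, `kdot`, `IsV`, `ℓ2`) are local
notations over existing vocabulary, and the constructed objects (`W`, `B`) are delivered by
existence theorems with their characterising equations, consumed as hypotheses downstream.
Not here: the application to a concrete force family (summit side), time-dependent problems,
uniqueness of the persisted branch.

## References

* R. Temam, *Navier–Stokes Equations: Theory and Numerical Analysis*, North-Holland (1979),
  Ch. II §1 (steady states: Thm. 1.2 existence, Thm. 1.3 uniqueness/regular points, Prop. 1.1
  regularity). [Temam1979]
* C. Foias, R. Temam, *Structure of the set of stationary solutions of the Navier–Stokes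
  equations*, Comm. Pure Appl. Math. 30 (1977) 149–164, §1.
* J.-C. Saut, R. Temam, *Generic properties of Navier–Stokes equations: genericity with respect
  to the boundary values*, Indiana Univ. Math. J. 29 (1980) 427–446, §2.
* P. Constantin, C. Foias, *Navier–Stokes Equations*, Univ. Chicago Press (1988), Ch. 6–7, 10.
-/

noncomputable section

open scoped BigOperators Topology ENNReal NNReal InnerProductSpace ComplexConjugate
open Filter Set Function TopologicalSpace MeasureTheory UnitAddTorus

namespace Literature.Analysis.FluidPDE

namespace SteadyLattice

open Literature.Analysis.FunctionSpaces Literature.Analysis.FunctionSpaces.Torus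
open Literature.Analysis.FunctionSpaces.EuclideanSpace
open Literature.Analysis.FluidPDE.ScalarFourier

/-! ## §A Square-summable families `ℤ³ → ℂ³` -/

section L2

/-- Evaluation is bounded by the norm in `ℓ²`. [folklore] -/
theorem l2_norm_apply_le (x : (lp (fun _ : Fin 3 → ℤ => EuclideanSpace ℂ (Fin 3)) 2)) (k : (Fin 3 → ℤ)) : ‖(x : (Fin 3
    → ℤ) → (EuclideanSpace ℂ (Fin 3))) k‖ ≤ ‖x‖ :=
  lp.norm_apply_le_norm two_ne_zero x k

/-- `‖x‖² = ∑ₖ ‖x k‖²` as a convergent series. [folklore] -/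
theorem l2_hasSum_norm_sq (x : (lp (fun _ : Fin 3 → ℤ => EuclideanSpace ℂ (Fin 3)) 2)) : HasSum (fun k => ‖(x : (Fin 3
    → ℤ) → (EuclideanSpace ℂ (Fin 3))) k‖ ^ 2) (‖x‖ ^ 2) := by
  have h := lp.hasSum_norm (by norm_num : 0 < (2 : ℝ≥0∞).toReal) x
  simpa only [ENNReal.toReal_ofNat, Real.rpow_two] using h

/-- `‖x‖² = ∑ₖ ‖x k‖²`. [folklore] -/
theorem l2_norm_sq_eq_tsum (x : (lp (fun _ : Fin 3 → ℤ => EuclideanSpace ℂ (Fin 3)) 2)) : ‖x‖ ^ 2 = ∑' k, ‖(x : (Fin 3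
    → ℤ) → (EuclideanSpace ℂ (Fin 3))) k‖ ^ 2 :=
  (l2_hasSum_norm_sq x).tsum_eq.symm

/-- `‖x‖ₑ² = ∑ₖ ‖x k‖ₑ²` in `ℝ≥0∞`. [folklore] -/
theorem l2_enorm_sq_eq_tsum (x : (lp (fun _ : Fin 3 → ℤ => EuclideanSpace ℂ (Fin 3)) 2)) : ‖x‖ₑ ^ 2 = ∑' k, ‖(x : (Fin
    3 → ℤ) → (EuclideanSpace ℂ (Fin 3))) k‖ₑ ^ 2 := by
  rw [← ofReal_norm, ← ENNReal.ofReal_pow (norm_nonneg _), l2_norm_sq_eq_tsum,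
    ENNReal.ofReal_tsum_of_nonneg (fun k => sq_nonneg _) (l2_hasSum_norm_sq x).summable]
  refine tsum_congr fun k => ?_
  rw [← ofReal_norm, ENNReal.ofReal_pow (norm_nonneg _)]

/-- Each coordinate is bounded by the norm, in `ℝ≥0∞`. [folklore] -/
theorem l2_enorm_apply_le (x : (lp (fun _ : Fin 3 → ℤ => EuclideanSpace ℂ (Fin 3)) 2)) (k : (Fin 3 → ℤ)) : ‖(x : (Fin
    3 → ℤ) → (EuclideanSpace ℂ (Fin 3))) k‖ₑ ≤ ‖x‖ₑ := by
  rw [← ofReal_norm, ← ofReal_norm]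
  exact ENNReal.ofReal_le_ofReal (l2_norm_apply_le x k)

/-- The norm of an `ℓ²` element is finite. [folklore] -/
theorem l2_tsum_enorm_sq_ne_top (x : (lp (fun _ : Fin 3 → ℤ => EuclideanSpace ℂ (Fin 3)) 2)) : ∑' k, ‖(x : (Fin 3 → ℤ)
    → (EuclideanSpace ℂ (Fin 3))) k‖ₑ ^ 2 ≠ ∞ := by
  rw [← l2_enorm_sq_eq_tsum]
  exact ENNReal.pow_ne_top enorm_ne_top

/-- A family with `∑ₖ ‖f k‖² < ∞` (in `ℝ≥0∞`) is square summable. [folklore] -/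
theorem memℓp_two_of_tsum_ne_top {f : (Fin 3 → ℤ) → (EuclideanSpace ℂ (Fin 3))} (h : ∑' k, ‖f k‖ₑ ^ 2 ≠ ∞) : Memℓp f
    2 := by
  rw [memℓp_gen_iff (by norm_num : 0 < (2 : ℝ≥0∞).toReal)]
  simp only [ENNReal.toReal_ofNat, Real.rpow_two]
  have h' : ∑' k, (((‖f k‖₊ ^ 2 : ℝ≥0)) : ℝ≥0∞) ≠ ∞ := by
    refine fun htop => h ?_
    rw [← htop]
    exact tsum_congr fun k => by simp [enorm_eq_nnnorm]
  have hs := ENNReal.tsum_coe_ne_top_iff_summable.1 h'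
  simpa using NNReal.summable_coe.2 hs

/-- The `ℓ²` norm of an element is controlled by any bound on `∑ₖ ‖x k‖²`. [folklore] -/
theorem l2_enorm_le_of_tsum_le (x : (lp (fun _ : Fin 3 → ℤ => EuclideanSpace ℂ (Fin 3)) 2)) {C : ℝ≥0∞} (h : ∑' k,
    ‖(x : (Fin 3 → ℤ) → (EuclideanSpace ℂ (Fin 3))) k‖ₑ ^ 2 ≤ C ^ 2) :
    ‖x‖ₑ ≤ C := by
  rw [← l2_enorm_sq_eq_tsum] at h
  exact (ENNReal.pow_le_pow_left_iff two_ne_zero).1 h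

/-- Real form: `‖x‖ ≤ C` from `∑ₖ ‖x k‖ₑ² ≤ (ofReal C)²`. [folklore] -/
theorem l2_norm_le_of_tsum_le (x : (lp (fun _ : Fin 3 → ℤ => EuclideanSpace ℂ (Fin 3)) 2)) {C : ℝ} (hC : 0 ≤ C)
    (h : ∑' k, ‖(x : (Fin 3 → ℤ) → (EuclideanSpace ℂ (Fin 3))) k‖ₑ ^ 2 ≤ ENNReal.ofReal C ^ 2) : ‖x‖ ≤ C := by
  have h1 := l2_enorm_le_of_tsum_le x h
  rwa [← ofReal_norm, ENNReal.ofReal_le_ofReal_iff hC] at h1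

/-- Evaluation at a frequency is continuous on `ℓ²`. [folklore] -/
theorem l2_continuous_apply (k : (Fin 3 → ℤ)) : Continuous fun x : (lp (fun _ : Fin 3 → ℤ => EuclideanSpace ℂ (Fin 3))
    2) => (x : (Fin 3 → ℤ) → (EuclideanSpace ℂ (Fin 3))) k :=
  (continuous_apply k).comp (lp.uniformContinuous_coe (p := (2 : ℝ≥0∞))).continuous

/-- Coordinates of sums. [folklore] -/
theorem l2_coe_add (x y : (lp (fun _ : Fin 3 → ℤ => EuclideanSpace ℂ (Fin 3)) 2)) : ((x + y : (lp (fun _ : Fin 3 →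
    ℤ => EuclideanSpace ℂ (Fin 3)) 2)) : (Fin 3 → ℤ) → (EuclideanSpace ℂ (Fin 3))) = (x : (Fin 3 → ℤ) →
    (EuclideanSpace ℂ (Fin 3))) + (y : (Fin 3 → ℤ) → (EuclideanSpace ℂ (Fin 3))) := rfl

/-- Coordinates of real multiples. [folklore] -/
theorem l2_coe_smul (a : ℝ) (x : (lp (fun _ : Fin 3 → ℤ => EuclideanSpace ℂ (Fin 3)) 2)) : ((a • x : (lp (fun _ : Fin
    3 → ℤ => EuclideanSpace ℂ (Fin 3)) 2)) : (Fin 3 → ℤ) → (EuclideanSpace ℂ (Fin 3))) = a • (x : (Fin 3 → ℤ) →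
    (EuclideanSpace ℂ (Fin 3))) := rfl

/-- Coordinates of differences. [folklore] -/
theorem l2_coe_sub (x y : (lp (fun _ : Fin 3 → ℤ => EuclideanSpace ℂ (Fin 3)) 2)) : ((x - y : (lp (fun _ : Fin 3 →
    ℤ => EuclideanSpace ℂ (Fin 3)) 2)) : (Fin 3 → ℤ) → (EuclideanSpace ℂ (Fin 3))) = (x : (Fin 3 → ℤ) →
    (EuclideanSpace ℂ (Fin 3))) - (y : (Fin 3 → ℤ) → (EuclideanSpace ℂ (Fin 3))) := rfl

end L2

/-! ## §B Lattice inequalities in `ℝ≥0∞` -/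

section Lattice

/-- **Young's inequality `ℓ¹ ⋆ ℓ² ⊂ ℓ²` on `ℤ³`** (from the tree's `SteadyNS.young_lattice`):
`∑ₖ (∑ₘ f(m) g(k-m))² ≤ (∑ f)² ∑ g²`. [folklore] -/
theorem young_one_two (f g : (Fin 3 → ℤ) → ℝ≥0∞) :
    ∑' k, (∑' m, f m * g (k - m)) ^ 2 ≤ (∑' m, f m) ^ 2 * ∑' m, g m ^ 2 := by
  have h := SteadyNS.young_lattice (d := Fin 3) g f (b := 2) (m := 1) (r := 2) (by norm_num) le_rfl
    two_pos (by norm_num)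
  have hcomm : ∀ k, ∑' l, g (k - l) * f l = ∑' m, f m * g (k - m) := fun k =>
    tsum_congr fun l => mul_comm _ _
  simp only [hcomm, ENNReal.rpow_two, ENNReal.rpow_one, show (2 : ℝ) / 2 = 1 by norm_num,
    show (2 : ℝ) / 1 = 2 by norm_num] at h
  rw [mul_comm]
  exact h

/-- **Cauchy–Schwarz** for `ℝ≥0∞` families (the tree's `SteadyNS.tsum_mul_le_Lp_mul_Lq`). [folklore] -/
theorem cauchy_schwarz_ennreal {α : Type*} (f g : α → ℝ≥0∞) :
    ∑' m, f m * g m ≤ (∑' m, f m ^ 2) ^ (1 / 2 : ℝ) * (∑' m, g m ^ 2) ^ (1 / 2 : ℝ) := by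
  have h := SteadyNS.tsum_mul_le_Lp_mul_Lq f g Real.HolderConjugate.two_two
  simpa only [ENNReal.rpow_two] using h

/-- `|k|² = 0 ↔ k = 0`. [folklore] -/
theorem freqNormSq_eq_zero {k : (Fin 3 → ℤ)} : freqNormSq k = 0 ↔ k = 0 := Torus.freqNormSq_eq_zero_iff k

/-- `1 ≤ |k|²` for `k ≠ 0`. [folklore] -/
theorem one_le_freqNormSq' {k : (Fin 3 → ℤ)} (hk : k ≠ 0) : 1 ≤ freqNormSq k := Torus.one_le_freqNormSq hk

/-- `⟨k⟩² = 1 + |k|² ≤ 2|k|²` for `k ≠ 0`. [folklore] -/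
theorem sobolevWeight_one_sq_le {k : (Fin 3 → ℤ)} (hk : k ≠ 0) : sobolevWeight 1 k ^ 2 ≤ 2 * freqNormSq k := by
  rw [SteadyNS.sobolevWeight_one_sq]
  linarith [one_le_freqNormSq' hk]

/-- `⟨k⟩ ≤ 2 |k|²` for `k ≠ 0` (crude). [folklore] -/
theorem sobolevWeight_one_le {k : (Fin 3 → ℤ)} (hk : k ≠ 0) : sobolevWeight 1 k ≤ 2 * freqNormSq k := by
  have h1 := sobolevWeight_one_sq_le hk
  have hw : 1 ≤ sobolevWeight 1 k := Torus.one_le_sobolevWeight zero_le_one k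
  have hf := one_le_freqNormSq' hk
  nlinarith

/-- `|kⱼ| ≤ ⟨k⟩`. [folklore] -/
theorem abs_apply_le_weight (k : (Fin 3 → ℤ)) (j : Fin 3) : |((k j : ℤ) : ℝ)| ≤ sobolevWeight 1 k :=
  Torus.abs_apply_le_sobolevWeight_one k j

/-- `‖dsym j k‖ = 2π |kⱼ| ≤ 2π ⟨k⟩`. [folklore] -/
theorem norm_dsym_le (j : Fin 3) (k : (Fin 3 → ℤ)) : ‖dsym j k‖ ≤ 2 * Real.pi * sobolevWeight 1 k := by
  rw [dsym_apply]
  simp only [norm_mul, Complex.norm_ofNat, Complex.norm_real, Real.norm_eq_abs, Complex.norm_I,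
    mul_one, Complex.norm_intCast, abs_of_pos Real.pi_pos]
  exact mul_le_mul_of_nonneg_left (abs_apply_le_weight k j) (by positivity)

/-- `‖v p‖ ≤ ‖v‖` for `v ∈ ℂ³`. [folklore] -/
theorem norm_apply_le_norm' (v : (EuclideanSpace ℂ (Fin 3))) (p : Fin 3) : ‖v p‖ ≤ ‖v‖ := by
  simpa using PiLp.norm_apply_le v p

/-- `|k · v| ≤ 3 ⟨k⟩ ‖v‖`. [folklore] -/
theorem norm_kdot_le (k : (Fin 3 → ℤ)) (v : (EuclideanSpace ℂ (Fin 3))) : ‖(∑ jj : Fin 3, ((k jj : ℤ) : ℂ) * v jj)‖ ≤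
    3 * sobolevWeight 1 k * ‖v‖ := by
  calc ‖(∑ jj : Fin 3, ((k jj : ℤ) : ℂ) * v jj)‖ ≤ ∑ j : Fin 3, ‖(((k j : ℤ) : ℂ)) * v j‖ := norm_sum_le _ _
    _ ≤ ∑ _j : Fin 3, sobolevWeight 1 k * ‖v‖ := Finset.sum_le_sum fun j _ => by
        rw [norm_mul, Complex.norm_intCast]
        exact mul_le_mul (abs_apply_le_weight k j) (norm_apply_le_norm' v j) (norm_nonneg _)
          (sobolevWeight_pos 1 k).le
    _ = 3 * sobolevWeight 1 k * ‖v‖ := by simp [Finset.sum_const, Finset.card_univ]; ring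

/-- The lattice sum `∑_{m ≠ 0} |m|⁻⁴ < ∞` on `ℤ³`, in the form `∑ₘ ((|m|²)⁻¹)² < ∞`. [folklore] -/
theorem tsum_inv_freqNormSq_sq_ne_top :
    ∑' m : (Fin 3 → ℤ), ENNReal.ofReal ((freqNormSq m)⁻¹) ^ 2 ≠ ∞ := by
  have hs : Summable fun m : (Fin 3 → ℤ) => sobolevWeight (-4) m :=
    SteadyNS.summable_sobolevWeight_neg (by simp; norm_num)
  have hle : ∀ m : (Fin 3 → ℤ), ENNReal.ofReal ((freqNormSq m)⁻¹) ^ 2 ≤ ENNReal.ofReal (4 * sobolevWeight (-4)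
      m) := by
    intro m
    rw [← ENNReal.ofReal_pow (inv_nonneg.2 (freqNormSq_nonneg m))]
    refine ENNReal.ofReal_le_ofReal ?_
    by_cases hm : m = 0
    · subst hm
      rw [freqNormSq_zero, inv_zero, zero_pow two_ne_zero]
      exact mul_nonneg (by norm_num) (sobolevWeight_pos _ _).le
    · have h1 := one_le_freqNormSq' hm
      have hw : sobolevWeight (-4) m = ((1 + freqNormSq m) ^ 2)⁻¹ := by
        rw [sobolevWeight, show (-4 : ℝ) / 2 = -2 by norm_num, Real.rpow_neg (by linarith),
          Real.rpow_two]
      rw [hw, inv_pow]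
      rw [show (4 : ℝ) * ((1 + freqNormSq m) ^ 2)⁻¹ = ((1 + freqNormSq m) ^ 2 / 4)⁻¹ by
        rw [inv_div]; ring]
      refine inv_anti₀ (by positivity) ?_
      nlinarith
  refine ne_top_of_le_ne_top ?_ (ENNReal.tsum_le_tsum hle)
  rw [← ENNReal.ofReal_tsum_of_nonneg (fun m => mul_nonneg (by norm_num) (sobolevWeight_pos _ _).le)
    (hs.mul_left 4)]
  exact ENNReal.ofReal_ne_top

/-- **`ℓ²` with weight `|k|²` embeds in `ℓ¹`**: `∑ₘ ‖x m‖/|m|² ≤ Z^{1/2} ‖x‖` with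
`Z = ∑_{m≠0} |m|⁻⁴` (Cauchy–Schwarz). [folklore] -/
theorem tsum_enorm_cf_le (x : (Fin 3 → ℤ) → (EuclideanSpace ℂ (Fin 3))) :
    ∑' m, ‖(((fun mm : Fin 3 → ℤ => (((freqNormSq mm)⁻¹ : ℝ) : ℂ)) • (x : (Fin 3 → ℤ) → EuclideanSpace ℂ (Fin 3))))
        m‖ₑ ≤ (∑' m : (Fin 3 → ℤ), ENNReal.ofReal ((freqNormSq m)⁻¹) ^ 2) ^ (1 / 2 : ℝ) *
      (∑' m, ‖x m‖ₑ ^ 2) ^ (1 / 2 : ℝ) := by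
  have h := cauchy_schwarz_ennreal (fun m : (Fin 3 → ℤ) => ENNReal.ofReal ((freqNormSq m)⁻¹)) fun m => ‖x m‖ₑ
  refine le_trans (le_of_eq (tsum_congr fun m => ?_)) h
  rw [Pi.smul_apply', enorm_smul, ← ofReal_norm (((freqNormSq m)⁻¹ : ℝ) : ℂ), Complex.norm_real,
    Real.norm_of_nonneg (inv_nonneg.2 (freqNormSq_nonneg m))]

end Lattice


/-! ## §C The convective symbol `N(a,b)(k)`: bounds, transversal form, symmetry, bilinearity -/

section Symbol

/-- `‖v‖ₑ ≤ ∑ₚ ‖v p‖ₑ` in `ℂ³`. [folklore] -/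
theorem enorm_le_sum_enorm_apply (v : (EuclideanSpace ℂ (Fin 3))) : ‖v‖ₑ ≤ ∑ p, ‖v p‖ₑ := by
  calc ‖v‖ₑ = ENNReal.ofReal ‖v‖ := (ofReal_norm v).symm
    _ ≤ ENNReal.ofReal (∑ p, ‖v p‖) := ENNReal.ofReal_le_ofReal (SteadyNS.norm_le_sum_norm_apply' v)
    _ = ∑ p, ‖v p‖ₑ := by
        rw [ENNReal.ofReal_sum_of_nonneg (fun p _ => norm_nonneg _)]
        exact Finset.sum_congr rfl fun p _ => ofReal_norm _

/-- `‖v p‖ₑ ≤ ‖v‖ₑ` in `ℂ³`. [folklore] -/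
theorem enorm_apply_le_enorm (v : (EuclideanSpace ℂ (Fin 3))) (p : Fin 3) : ‖v p‖ₑ ≤ ‖v‖ₑ := by
  rw [← ofReal_norm, ← ofReal_norm]
  exact ENNReal.ofReal_le_ofReal (norm_apply_le_norm' v p)

/-- Components of the symbol: `N(a,b)(k)ₚ = ∑ⱼ ∑ₘ a(m)ⱼ (2πi (k-m)ⱼ) b(k-m)ₚ`. [folklore] -/
theorem nl_apply (a b : (Fin 3 → ℤ) → (EuclideanSpace ℂ (Fin 3))) (k : (Fin 3 → ℤ)) (p : Fin 3) :
    ((WithLp.toLp 2 (fun pp : Fin 3 => transportSym (fun jj mm => a mm jj) (fun mm => b mm pp) k) : EuclideanSpace ℂ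
        (Fin 3))) p = ∑ j, ∑' m, a m j * (dsym j (k - m) * b (k - m) p) := by
  simp only [transportSym_apply, lconv_apply]

/-- **Pointwise bound of the symbol**: `‖N(a,b)(k)‖ ≤ 18π ∑ₘ ‖a m‖ ⟨k-m⟩ ‖b(k-m)‖`. [folklore] -/
theorem enorm_nl_le (a b : (Fin 3 → ℤ) → (EuclideanSpace ℂ (Fin 3))) (k : (Fin 3 → ℤ)) :
    ‖(WithLp.toLp 2 (fun pp : Fin 3 => transportSym (fun jj mm => a mm jj) (fun mm => b mm pp) k) : EuclideanSpace ℂ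
        (Fin 3))‖ₑ ≤ ENNReal.ofReal (18 * Real.pi) *
      ∑' m, ‖a m‖ₑ * (ENNReal.ofReal (sobolevWeight 1 (k - m)) * ‖b (k - m)‖ₑ) := by
  set S : ℝ≥0∞ := ∑' m, ‖a m‖ₑ * (ENNReal.ofReal (sobolevWeight 1 (k - m)) * ‖b (k - m)‖ₑ) with hS
  have hcomp : ∀ p, ‖((WithLp.toLp 2 (fun pp : Fin 3 => transportSym (fun jj mm => a mm jj) (fun mm => b mm pp) k) :
      EuclideanSpace ℂ (Fin 3))) p‖ₑ ≤ 3 * (ENNReal.ofReal (2 * Real.pi) * S) := by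
    intro p
    rw [nl_apply]
    calc ‖∑ j, ∑' m, a m j * (dsym j (k - m) * b (k - m) p)‖ₑ
        ≤ ∑ j, ‖∑' m, a m j * (dsym j (k - m) * b (k - m) p)‖ₑ := enorm_sum_le _ _
      _ ≤ ∑ _j : Fin 3, ENNReal.ofReal (2 * Real.pi) * S := Finset.sum_le_sum fun j _ => by
          refine enorm_tsum_le_tsum_enorm.trans ?_
          rw [hS, ← ENNReal.tsum_mul_left]
          refine ENNReal.tsum_le_tsum fun m => ?_
          rw [enorm_mul, enorm_mul]
          have h1 : ‖a m j‖ₑ ≤ ‖a m‖ₑ := enorm_apply_le_enorm (a m) j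
          have h2 : ‖b (k - m) p‖ₑ ≤ ‖b (k - m)‖ₑ := enorm_apply_le_enorm (b (k - m)) p
          have h3 : ‖dsym j (k - m)‖ₑ ≤ ENNReal.ofReal (2 * Real.pi) *
              ENNReal.ofReal (sobolevWeight 1 (k - m)) := by
            rw [← ofReal_norm, ← ENNReal.ofReal_mul (by positivity)]
            exact ENNReal.ofReal_le_ofReal (norm_dsym_le j (k - m))
          calc ‖a m j‖ₑ * (‖dsym j (k - m)‖ₑ * ‖b (k - m) p‖ₑ)
              ≤ ‖a m‖ₑ * ((ENNReal.ofReal (2 * Real.pi) * ENNReal.ofReal (sobolevWeight 1 (k - m))) *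
                  ‖b (k - m)‖ₑ) := mul_le_mul' h1 (mul_le_mul' h3 h2)
            _ = ENNReal.ofReal (2 * Real.pi) *
                  (‖a m‖ₑ * (ENNReal.ofReal (sobolevWeight 1 (k - m)) * ‖b (k - m)‖ₑ)) := by ring
      _ = 3 * (ENNReal.ofReal (2 * Real.pi) * S) := by
          simp [Finset.sum_const, Finset.card_univ]
  calc ‖(WithLp.toLp 2 (fun pp : Fin 3 => transportSym (fun jj mm => a mm jj) (fun mm => b mm pp) k) : EuclideanSpace
      ℂ (Fin 3))‖ₑ ≤ ∑ p, ‖((WithLp.toLp 2 (fun pp : Fin 3 => transportSym (fun jj mm => a mm jj) (fun mm => b mm pp)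
      k) : EuclideanSpace ℂ (Fin 3))) p‖ₑ := enorm_le_sum_enorm_apply _
    _ ≤ ∑ _p : Fin 3, 3 * (ENNReal.ofReal (2 * Real.pi) * S) := Finset.sum_le_sum fun p _ => hcomp p
    _ = ENNReal.ofReal (18 * Real.pi) * S := by
        simp only [Finset.sum_const, Finset.card_univ, Fintype.card_fin, nsmul_eq_mul, Nat.cast_ofNat]
        rw [show (18 : ℝ) * Real.pi = 9 * (2 * Real.pi) by ring,
          ENNReal.ofReal_mul (by norm_num : (0:ℝ) ≤ 9)]
        simp only [ENNReal.ofReal_ofNat]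
        ring

/-- The pairing `k · v` is additive in `k`. [folklore] -/
theorem kdot_sub (k m : (Fin 3 → ℤ)) (v : (EuclideanSpace ℂ (Fin 3))) : (∑ jj : Fin 3, (((k - m) jj : ℤ) : ℂ) * v jj)
    = (∑ jj : Fin 3, ((k jj : ℤ) : ℂ) * v jj) - (∑ jj : Fin 3, ((m jj : ℤ) : ℂ) * v jj) := by
  simp only [Pi.sub_apply, Int.cast_sub, sub_mul, Finset.sum_sub_distrib]

/-- **Transversal form of the symbol**: if `m · a(m) = 0` for all `m`, then
`N(a,b)(k)ₚ = ∑ₘ 2πi (k · a(m)) b(k-m)ₚ` (the Fourier side of `(u·∇)v = div (u ⊗ v)`). [folklore] -/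
theorem nl_apply_of_transversal (a b : (Fin 3 → ℤ) → (EuclideanSpace ℂ (Fin 3))) (k : (Fin 3 → ℤ)) (p : Fin 3) (ha :
    ∀ m, (∑ jj : Fin 3, ((m jj : ℤ) : ℂ) * (a m) jj) = 0)
    (hs : ∀ j, Summable fun m => a m j * (dsym j (k - m) * b (k - m) p)) :
    ((WithLp.toLp 2 (fun pp : Fin 3 => transportSym (fun jj mm => a mm jj) (fun mm => b mm pp) k) : EuclideanSpace ℂ
        (Fin 3))) p = ∑' m, (2 * Real.pi * Complex.I * (∑ jj : Fin 3, ((k jj : ℤ) : ℂ) * (a m) jj)) * b (k - m)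
        p := by
  rw [nl_apply, ← Summable.tsum_finsetSum (fun j _ => hs j)]
  refine tsum_congr fun m => ?_
  have h1 : ∑ j, a m j * (dsym j (k - m) * b (k - m) p) =
      (2 * Real.pi * Complex.I * (∑ jj : Fin 3, (((k - m) jj : ℤ) : ℂ) * (a m) jj)) * b (k - m) p := by
    simp only [dsym_apply, Finset.mul_sum, Finset.sum_mul]
    refine Finset.sum_congr rfl fun j _ => ?_
    ring
  rw [h1, kdot_sub, ha m, sub_zero]

/-- **Bound of the symbol in transversal form**: `‖N(a,b)(k)‖ ≤ 18π ⟨k⟩ ∑ₘ ‖a m‖ ‖b(k-m)‖` when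
`a` is transversal (the derivative falls outside the convolution). [folklore] -/
theorem enorm_nl_le_of_transversal (a b : (Fin 3 → ℤ) → (EuclideanSpace ℂ (Fin 3))) (k : (Fin 3 → ℤ)) (ha : ∀ m, (∑
    jj : Fin 3, ((m jj : ℤ) : ℂ) * (a m) jj) = 0)
    (hs : ∀ j p, Summable fun m => a m j * (dsym j (k - m) * b (k - m) p)) :
    ‖(WithLp.toLp 2 (fun pp : Fin 3 => transportSym (fun jj mm => a mm jj) (fun mm => b mm pp) k) : EuclideanSpace ℂ
        (Fin 3))‖ₑ ≤ ENNReal.ofReal (18 * Real.pi) * ENNReal.ofReal (sobolevWeight 1 k) *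
      ∑' m, ‖a m‖ₑ * ‖b (k - m)‖ₑ := by
  set S : ℝ≥0∞ := ∑' m, ‖a m‖ₑ * ‖b (k - m)‖ₑ with hS
  have hcomp : ∀ p, ‖((WithLp.toLp 2 (fun pp : Fin 3 => transportSym (fun jj mm => a mm jj) (fun mm => b mm pp) k) :
      EuclideanSpace ℂ (Fin 3))) p‖ₑ ≤
      ENNReal.ofReal (2 * Real.pi) * (3 * ENNReal.ofReal (sobolevWeight 1 k)) * S := by
    intro p
    rw [nl_apply_of_transversal a b k p ha (fun j => hs j p)]
    refine enorm_tsum_le_tsum_enorm.trans ?_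
    rw [hS, ← ENNReal.tsum_mul_left]
    refine ENNReal.tsum_le_tsum fun m => ?_
    rw [enorm_mul]
    have h1 : ‖2 * Real.pi * Complex.I * (∑ jj : Fin 3, ((k jj : ℤ) : ℂ) * (a m) jj)‖ₑ ≤
        ENNReal.ofReal (2 * Real.pi) * (3 * ENNReal.ofReal (sobolevWeight 1 k)) * ‖a m‖ₑ := by
      have hw0 : 0 ≤ sobolevWeight 1 k := (sobolevWeight_pos 1 k).le
      rw [← ofReal_norm, ← ofReal_norm (a m), ← ENNReal.ofReal_ofNat 3,
        ← ENNReal.ofReal_mul (by norm_num), ← ENNReal.ofReal_mul (by positivity),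
        ← ENNReal.ofReal_mul (by positivity)]
      refine ENNReal.ofReal_le_ofReal ?_
      rw [norm_mul]
      have hn : ‖(2 * Real.pi * Complex.I : ℂ)‖ = 2 * Real.pi := by
        simp [abs_of_pos Real.pi_pos]
      rw [hn]
      have := norm_kdot_le k (a m)
      calc 2 * Real.pi * ‖(∑ jj : Fin 3, ((k jj : ℤ) : ℂ) * (a m) jj)‖ ≤ 2 * Real.pi * (3 * sobolevWeight 1 k * ‖a
          m‖) :=
            mul_le_mul_of_nonneg_left this (by positivity)
        _ = 2 * Real.pi * (3 * sobolevWeight 1 k) * ‖a m‖ := by ring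
    have h2 : ‖b (k - m) p‖ₑ ≤ ‖b (k - m)‖ₑ := enorm_apply_le_enorm _ p
    calc ‖2 * Real.pi * Complex.I * (∑ jj : Fin 3, ((k jj : ℤ) : ℂ) * (a m) jj)‖ₑ * ‖b (k - m) p‖ₑ
        ≤ (ENNReal.ofReal (2 * Real.pi) * (3 * ENNReal.ofReal (sobolevWeight 1 k)) * ‖a m‖ₑ) *
            ‖b (k - m)‖ₑ := mul_le_mul' h1 h2
      _ = ENNReal.ofReal (2 * Real.pi) * (3 * ENNReal.ofReal (sobolevWeight 1 k)) *
            (‖a m‖ₑ * ‖b (k - m)‖ₑ) := by ring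
  calc ‖(WithLp.toLp 2 (fun pp : Fin 3 => transportSym (fun jj mm => a mm jj) (fun mm => b mm pp) k) : EuclideanSpace
      ℂ (Fin 3))‖ₑ ≤ ∑ p, ‖((WithLp.toLp 2 (fun pp : Fin 3 => transportSym (fun jj mm => a mm jj) (fun mm => b mm pp)
      k) : EuclideanSpace ℂ (Fin 3))) p‖ₑ := enorm_le_sum_enorm_apply _
    _ ≤ ∑ _p : Fin 3, ENNReal.ofReal (2 * Real.pi) * (3 * ENNReal.ofReal (sobolevWeight 1 k)) * S :=
        Finset.sum_le_sum fun p _ => hcomp p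
    _ = ENNReal.ofReal (18 * Real.pi) * ENNReal.ofReal (sobolevWeight 1 k) * S := by
        simp only [Finset.sum_const, Finset.card_univ, Fintype.card_fin, nsmul_eq_mul, Nat.cast_ofNat]
        rw [show (18 : ℝ) * Real.pi = 9 * (2 * Real.pi) by ring,
          ENNReal.ofReal_mul (by norm_num : (0:ℝ) ≤ 9)]
        simp only [ENNReal.ofReal_ofNat]
        ring

/-- **The symbol vanishes at the zero mode** for transversal `a` (the Fourier form of
`∫ (u·∇)v = 0` for `div u = 0`). [folklore] -/
theorem nl_zero_of_transversal (a b : (Fin 3 → ℤ) → (EuclideanSpace ℂ (Fin 3))) (ha : ∀ m, (∑ jj : Fin 3, ((m jj :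
    ℤ) : ℂ) * (a m) jj) = 0)
    (hs : ∀ j p, Summable fun m => a m j * (dsym j (0 - m) * b (0 - m) p)) : (WithLp.toLp 2 (fun pp : Fin
        3 => transportSym (fun jj mm => a mm jj) (fun mm => b mm pp) 0) : EuclideanSpace ℂ (Fin 3)) = 0 := by
  ext p
  rw [nl_apply_of_transversal a b 0 p ha (fun j => hs j p), PiLp.zero_apply]
  simp

/-- **Conjugate symmetry of the symbol**: `N(a,b)(-k) = conj N(a,b)(k)` for conjugate-symmetric
`a`, `b` (tree: `CorrectorFourier.transportSym_neg_eq_conj`). [folklore] -/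
theorem nl_neg (a b : (Fin 3 → ℤ) → (EuclideanSpace ℂ (Fin 3))) (ha : IsConjSymm a) (hb : IsConjSymm b) (k : (Fin 3 →
    ℤ)) :
    (WithLp.toLp 2 (fun pp : Fin 3 => transportSym (fun jj mm => a mm jj) (fun mm => b mm pp) (-k)) : EuclideanSpace ℂ
        (Fin 3)) = conjVec ((WithLp.toLp 2 (fun pp : Fin 3 => transportSym (fun jj mm => a mm jj) (fun mm => b mm pp)
        k) : EuclideanSpace ℂ (Fin 3))) := by
  ext p
  rw [PiLp.toLp_apply, conjVec_apply, PiLp.toLp_apply]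
  refine CorrectorFourier.transportSym_neg_eq_conj (fun j m => ?_) (fun m => ?_) k
  · rw [ha m, conjVec_apply]
  · rw [hb m, conjVec_apply]

/-- Summability of the symbol's terms from `∑ ‖a m‖ < ∞` and a uniform bound on `⟨l⟩ ‖b l‖`. [folklore] -/
theorem summable_nl_term {a b : (Fin 3 → ℤ) → (EuclideanSpace ℂ (Fin 3))} (ha : Summable fun m => ‖a m‖) {M : ℝ}
    (hb : ∀ l, sobolevWeight 1 l * ‖b l‖ ≤ M) (k : (Fin 3 → ℤ)) (j p : Fin 3) :
    Summable fun m => a m j * (dsym j (k - m) * b (k - m) p) := by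
  have hM : 0 ≤ M := le_trans (mul_nonneg (sobolevWeight_pos 1 0).le (norm_nonneg _)) (hb 0)
  refine Summable.of_norm_bounded (ha.mul_right (2 * Real.pi * M)) fun m => ?_
  rw [norm_mul, norm_mul]
  have h1 : ‖a m j‖ ≤ ‖a m‖ := norm_apply_le_norm' (a m) j
  have h2 : ‖dsym j (k - m)‖ * ‖b (k - m) p‖ ≤ 2 * Real.pi * M := by
    calc ‖dsym j (k - m)‖ * ‖b (k - m) p‖
        ≤ (2 * Real.pi * sobolevWeight 1 (k - m)) * ‖b (k - m)‖ :=
          mul_le_mul (norm_dsym_le j _) (norm_apply_le_norm' _ p) (norm_nonneg _)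
            (mul_nonneg (by positivity) (sobolevWeight_pos 1 _).le)
      _ = 2 * Real.pi * (sobolevWeight 1 (k - m) * ‖b (k - m)‖) := by ring
      _ ≤ 2 * Real.pi * M := mul_le_mul_of_nonneg_left (hb _) (by positivity)
  exact mul_le_mul h1 h2 (by positivity) (norm_nonneg _)

/-- Additivity of the symbol in the first slot (summable terms). [folklore] -/
theorem nl_add_left (a₁ a₂ b : (Fin 3 → ℤ) → (EuclideanSpace ℂ (Fin 3))) (k : (Fin 3 → ℤ))
    (h₁ : ∀ j p, Summable fun m => a₁ m j * (dsym j (k - m) * b (k - m) p))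
    (h₂ : ∀ j p, Summable fun m => a₂ m j * (dsym j (k - m) * b (k - m) p)) :
    (WithLp.toLp 2 (fun pp : Fin 3 => transportSym (fun jj mm => (a₁ + a₂) mm jj) (fun mm => b mm pp) k) :
        EuclideanSpace ℂ (Fin 3)) = (WithLp.toLp 2 (fun pp : Fin 3 => transportSym (fun jj mm => a₁ mm jj) (fun
        mm => b mm pp) k) : EuclideanSpace ℂ (Fin 3)) + (WithLp.toLp 2 (fun pp : Fin 3 => transportSym (fun jj
        mm => a₂ mm jj) (fun mm => b mm pp) k) : EuclideanSpace ℂ (Fin 3)) := by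
  ext p
  simp only [PiLp.add_apply, transportSym_apply, Pi.add_apply]
  rw [← Finset.sum_add_distrib]
  refine Finset.sum_congr rfl fun j _ => ?_
  exact lconv_add_left k (h₁ j p) (h₂ j p)

/-- Additivity of the symbol in the second slot (summable terms). [folklore] -/
theorem nl_add_right (a b₁ b₂ : (Fin 3 → ℤ) → (EuclideanSpace ℂ (Fin 3))) (k : (Fin 3 → ℤ))
    (h₁ : ∀ j p, Summable fun m => a m j * (dsym j (k - m) * b₁ (k - m) p))
    (h₂ : ∀ j p, Summable fun m => a m j * (dsym j (k - m) * b₂ (k - m) p)) :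
    (WithLp.toLp 2 (fun pp : Fin 3 => transportSym (fun jj mm => a mm jj) (fun mm => (b₁ + b₂) mm pp) k) :
        EuclideanSpace ℂ (Fin 3)) = (WithLp.toLp 2 (fun pp : Fin 3 => transportSym (fun jj mm => a mm jj) (fun
        mm => b₁ mm pp) k) : EuclideanSpace ℂ (Fin 3)) + (WithLp.toLp 2 (fun pp : Fin 3 => transportSym (fun jj
        mm => a mm jj) (fun mm => b₂ mm pp) k) : EuclideanSpace ℂ (Fin 3)) := by
  ext p
  simp only [PiLp.add_apply, transportSym_apply, Pi.add_apply]
  rw [← Finset.sum_add_distrib]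
  refine Finset.sum_congr rfl fun j _ => ?_
  have e : (fun m => dsym j m * (b₁ m p + b₂ m p)) =
      fun m => dsym j m * b₁ m p + dsym j m * b₂ m p := funext fun m => mul_add _ _ _
  rw [e]
  exact lconv_add_right k (h₁ j p) (h₂ j p)

/-- Complex homogeneity of the symbol in the first slot. [folklore] -/
theorem nl_smul_left (c : ℂ) (a b : (Fin 3 → ℤ) → (EuclideanSpace ℂ (Fin 3))) (k : (Fin 3 → ℤ)) : (WithLp.toLp 2 (fun
    pp : Fin 3 => transportSym (fun jj mm => (c • a) mm jj) (fun mm => b mm pp) k) : EuclideanSpace ℂ (Fin 3)) = c •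
    (WithLp.toLp 2 (fun pp : Fin 3 => transportSym (fun jj mm => a mm jj) (fun mm => b mm pp) k) : EuclideanSpace ℂ
    (Fin 3)) := by
  ext p
  simp only [PiLp.smul_apply, transportSym_apply, Pi.smul_apply, smul_eq_mul, Finset.mul_sum]
  refine Finset.sum_congr rfl fun j _ => ?_
  exact lconv_const_mul_left c _ _ k

/-- Complex homogeneity of the symbol in the second slot. [folklore] -/
theorem nl_smul_right (c : ℂ) (a b : (Fin 3 → ℤ) → (EuclideanSpace ℂ (Fin 3))) (k : (Fin 3 → ℤ)) : (WithLp.toLp 2 (fun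
    pp : Fin 3 => transportSym (fun jj mm => a mm jj) (fun mm => (c • b) mm pp) k) : EuclideanSpace ℂ (Fin 3)) = c •
    (WithLp.toLp 2 (fun pp : Fin 3 => transportSym (fun jj mm => a mm jj) (fun mm => b mm pp) k) : EuclideanSpace ℂ
    (Fin 3)) := by
  ext p
  simp only [PiLp.smul_apply, transportSym_apply, Pi.smul_apply, smul_eq_mul, Finset.mul_sum]
  refine Finset.sum_congr rfl fun j _ => ?_
  have e : (fun m => dsym j m * (c * b m p)) = fun m => c * (dsym j m * b m p) :=
    funext fun m => by ring
  rw [e]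
  exact lconv_const_mul_right c _ _ k

end Symbol


/-! ## §D The state space `W ⊂ ℓ²(ℤ³; ℂ³)` -/

section Space

/-- `kdot` is additive in the vector. [folklore] -/
theorem kdot_add (k : (Fin 3 → ℤ)) (v w : (EuclideanSpace ℂ (Fin 3))) : (∑ jj : Fin 3, ((k jj : ℤ) : ℂ) * (v + w) jj)
    = (∑ jj : Fin 3, ((k jj : ℤ) : ℂ) * v jj) + (∑ jj : Fin 3, ((k jj : ℤ) : ℂ) * w jj) := by
  simp only [PiLp.add_apply, mul_add, Finset.sum_add_distrib]

/-- `kdot` is `ℂ`-homogeneous in the vector. [folklore] -/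
theorem kdot_smul (k : (Fin 3 → ℤ)) (c : ℂ) (v : (EuclideanSpace ℂ (Fin 3))) : (∑ jj : Fin 3, ((k jj : ℤ) : ℂ) * (c •
    v) jj) = c * (∑ jj : Fin 3, ((k jj : ℤ) : ℂ) * v jj) := by
  simp only [PiLp.smul_apply, smul_eq_mul, Finset.mul_sum]
  exact Finset.sum_congr rfl fun j _ => by ring

/-- `kdot k 0 = 0`. [folklore] -/
theorem kdot_zero (k : (Fin 3 → ℤ)) : (∑ jj : Fin 3, ((k jj : ℤ) : ℂ) * (0 : (EuclideanSpace ℂ (Fin 3))) jj) =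
    0 := by simp

/-- `kdot` is continuous in the vector. [folklore] -/
theorem continuous_kdot (k : (Fin 3 → ℤ)) : Continuous fun v : (EuclideanSpace ℂ (Fin 3)) => (∑ jj : Fin 3, ((k jj :
    ℤ) : ℂ) * v jj) :=
  continuous_finsetSum _ fun j _ => continuous_const.mul (PiLp.continuous_apply 2 _ j)

/-- **The state space exists**: the zero-mean, transversal, conjugate-symmetric square-summable
families form a closed real subspace `W` of `ℓ²(ℤ³; ℂ³)`. [folklore] -/
theorem exists_space : ∃ W : Submodule ℝ (lp (fun _ : Fin 3 → ℤ => EuclideanSpace ℂ (Fin 3)) 2),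
    (∀ x : (lp (fun _ : Fin 3 → ℤ => EuclideanSpace ℂ (Fin 3)) 2), x ∈ W ↔ (((x : (Fin 3 → ℤ) → (EuclideanSpace ℂ (Fin
        3))) : (Fin 3 → ℤ) → EuclideanSpace ℂ (Fin 3)) 0 = 0 ∧ (∀ kk : Fin 3 → ℤ, (∑ jj : Fin 3, ((kk jj : ℤ) : ℂ) *
        (((x : (Fin 3 → ℤ) → (EuclideanSpace ℂ (Fin 3))) : (Fin 3 → ℤ) → EuclideanSpace ℂ (Fin 3)) kk) jj) = 0) ∧
        IsConjSymm ((x : (Fin 3 → ℤ) → (EuclideanSpace ℂ (Fin 3))) : (Fin 3 → ℤ) → EuclideanSpace ℂ (Fin 3)))) ∧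
        IsClosed (W : Set (lp (fun _ : Fin 3 → ℤ => EuclideanSpace ℂ (Fin 3)) 2)) := by
  refine ⟨{ carrier := {x : (lp (fun _ : Fin 3 → ℤ => EuclideanSpace ℂ (Fin 3)) 2) | (((x : (Fin 3 → ℤ) →
      (EuclideanSpace ℂ (Fin 3))) : (Fin 3 → ℤ) → EuclideanSpace ℂ (Fin 3)) 0 = 0 ∧ (∀ kk : Fin 3 → ℤ, (∑ jj : Fin 3,
      ((kk jj : ℤ) : ℂ) * (((x : (Fin 3 → ℤ) → (EuclideanSpace ℂ (Fin 3))) : (Fin 3 → ℤ) → EuclideanSpace ℂ (Fin 3))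
      kk) jj) = 0) ∧ IsConjSymm ((x : (Fin 3 → ℤ) → (EuclideanSpace ℂ (Fin 3))) : (Fin 3 → ℤ) → EuclideanSpace ℂ (Fin
      3)))}
            add_mem' := ?_, zero_mem' := ?_, smul_mem' := ?_ }, fun x => Iff.rfl, ?_⟩
  · rintro x y ⟨hx0, hxt, hxc⟩ ⟨hy0, hyt, hyc⟩
    refine ⟨?_, fun k => ?_, ?_⟩
    · change (x : (Fin 3 → ℤ) → (EuclideanSpace ℂ (Fin 3))) 0 + (y : (Fin 3 → ℤ) → (EuclideanSpace ℂ (Fin 3))) 0 = 0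
      rw [hx0, hy0, add_zero]
    · change (∑ jj : Fin 3, ((k jj : ℤ) : ℂ) * ((x : (Fin 3 → ℤ) → (EuclideanSpace ℂ (Fin 3))) k + (y : (Fin 3 → ℤ) →
        (EuclideanSpace ℂ (Fin 3))) k) jj) = 0
      rw [kdot_add, hxt k, hyt k, add_zero]
    · exact hxc.add hyc
  · refine ⟨rfl, fun k => by simp, isConjSymm_zero⟩
  · rintro a x ⟨hx0, hxt, hxc⟩
    refine ⟨?_, fun k => ?_, ?_⟩
    · change a • (x : (Fin 3 → ℤ) → (EuclideanSpace ℂ (Fin 3))) 0 = 0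
      rw [hx0, smul_zero]
    · change (∑ jj : Fin 3, ((k jj : ℤ) : ℂ) * (a • (x : (Fin 3 → ℤ) → (EuclideanSpace ℂ (Fin 3))) k) jj) = 0
      rw [← Complex.coe_smul, kdot_smul, hxt k, mul_zero]
    · exact hxc.real_smul a
  · -- closedness: each condition is an equaliser of continuous maps
    have h1 : IsClosed {x : (lp (fun _ : Fin 3 → ℤ => EuclideanSpace ℂ (Fin 3)) 2) | (x : (Fin 3 → ℤ) →
        (EuclideanSpace ℂ (Fin 3))) 0 = 0} :=
      isClosed_eq (l2_continuous_apply 0) continuous_const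
    have h2 : IsClosed {x : (lp (fun _ : Fin 3 → ℤ => EuclideanSpace ℂ (Fin 3)) 2) | ∀ k : (Fin 3 → ℤ), (∑ jj : Fin 3,
        ((k jj : ℤ) : ℂ) * ((x : (Fin 3 → ℤ) → (EuclideanSpace ℂ (Fin 3))) k) jj) = 0} := by
      rw [Set.setOf_forall]
      exact isClosed_iInter fun k =>
        isClosed_eq ((continuous_kdot k).comp (l2_continuous_apply k)) continuous_const
    have h3 : IsClosed {x : (lp (fun _ : Fin 3 → ℤ => EuclideanSpace ℂ (Fin 3)) 2) | IsConjSymm (x : (Fin 3 → ℤ) →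
        (EuclideanSpace ℂ (Fin 3)))} := by
      have e : {x : (lp (fun _ : Fin 3 → ℤ => EuclideanSpace ℂ (Fin 3)) 2) | IsConjSymm (x : (Fin 3 → ℤ) →
          (EuclideanSpace ℂ (Fin 3)))} =
          ⋂ k : (Fin 3 → ℤ), {x : (lp (fun _ : Fin 3 → ℤ => EuclideanSpace ℂ (Fin 3)) 2) | (x : (Fin 3 → ℤ) →
              (EuclideanSpace ℂ (Fin 3))) (-k) = conjVec ((x : (Fin 3 → ℤ) → (EuclideanSpace ℂ (Fin 3))) k)} := by
        ext x; simp [IsConjSymm]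
      rw [e]
      exact isClosed_iInter fun k => isClosed_eq (l2_continuous_apply (-k))
        (conjVecL.continuous.comp (l2_continuous_apply k))
    have e : ({x : (lp (fun _ : Fin 3 → ℤ => EuclideanSpace ℂ (Fin 3)) 2) | (((x : (Fin 3 → ℤ) → (EuclideanSpace ℂ
        (Fin 3))) : (Fin 3 → ℤ) → EuclideanSpace ℂ (Fin 3)) 0 = 0 ∧ (∀ kk : Fin 3 → ℤ, (∑ jj : Fin 3, ((kk jj : ℤ) :
        ℂ) * (((x : (Fin 3 → ℤ) → (EuclideanSpace ℂ (Fin 3))) : (Fin 3 → ℤ) → EuclideanSpace ℂ (Fin 3)) kk) jj) = 0) ∧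
        IsConjSymm ((x : (Fin 3 → ℤ) → (EuclideanSpace ℂ (Fin 3))) : (Fin 3 → ℤ) → EuclideanSpace ℂ (Fin 3)))} : Set
        (lp (fun _ : Fin 3 → ℤ => EuclideanSpace ℂ (Fin 3)) 2)) = {x : (lp (fun _ : Fin 3 → ℤ => EuclideanSpace ℂ (Fin
        3)) 2) | (x : (Fin 3 → ℤ) → (EuclideanSpace ℂ (Fin 3))) 0 = 0} ∩
        ({x : (lp (fun _ : Fin 3 → ℤ => EuclideanSpace ℂ (Fin 3)) 2) | ∀ k : (Fin 3 → ℤ), (∑ jj : Fin 3, ((k jj : ℤ) :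
            ℂ) * ((x : (Fin 3 → ℤ) → (EuclideanSpace ℂ (Fin 3))) k) jj) = 0} ∩ {x : (lp (fun _ : Fin 3 →
            ℤ => EuclideanSpace ℂ (Fin 3)) 2) | IsConjSymm (x : (Fin 3 → ℤ) → (EuclideanSpace ℂ (Fin 3)))}) := by
      ext x; simp only [Set.mem_setOf_eq, Set.mem_inter_iff]
    change IsClosed ({x : (lp (fun _ : Fin 3 → ℤ => EuclideanSpace ℂ (Fin 3)) 2) | (((x : (Fin 3 → ℤ) →
        (EuclideanSpace ℂ (Fin 3))) : (Fin 3 → ℤ) → EuclideanSpace ℂ (Fin 3)) 0 = 0 ∧ (∀ kk : Fin 3 → ℤ, (∑ jj : Fin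
        3, ((kk jj : ℤ) : ℂ) * (((x : (Fin 3 → ℤ) → (EuclideanSpace ℂ (Fin 3))) : (Fin 3 → ℤ) → EuclideanSpace ℂ (Fin
        3)) kk) jj) = 0) ∧ IsConjSymm ((x : (Fin 3 → ℤ) → (EuclideanSpace ℂ (Fin 3))) : (Fin 3 → ℤ) → EuclideanSpace ℂ
        (Fin 3)))} : Set (lp (fun _ : Fin 3 → ℤ => EuclideanSpace ℂ (Fin 3)) 2))
    rw [e]
    exact h1.inter (h2.inter h3)

variable {W : Submodule ℝ (lp (fun _ : Fin 3 → ℤ => EuclideanSpace ℂ (Fin 3)) 2)}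

/-- Coordinates of an element of `W` (notation-free accessor). [folklore] -/
theorem coeW_apply (x : W) (k : (Fin 3 → ℤ)) : ((x : (lp (fun _ : Fin 3 → ℤ => EuclideanSpace ℂ (Fin 3)) 2)) : (Fin 3
    → ℤ) → (EuclideanSpace ℂ (Fin 3))) k = ((x : (lp (fun _ : Fin 3 → ℤ => EuclideanSpace ℂ (Fin 3)) 2)) : (Fin 3 → ℤ)
    → (EuclideanSpace ℂ (Fin 3))) k := rfl

/-- Coordinates of a sum in `W`. [folklore] -/
theorem coeW_add (x y : W) : (((x + y : W) : (lp (fun _ : Fin 3 → ℤ => EuclideanSpace ℂ (Fin 3)) 2)) : (Fin 3 → ℤ) →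
    (EuclideanSpace ℂ (Fin 3))) = ((x : (lp (fun _ : Fin 3 → ℤ => EuclideanSpace ℂ (Fin 3)) 2)) : (Fin 3 → ℤ) →
    (EuclideanSpace ℂ (Fin 3))) + ((y : (lp (fun _ : Fin 3 → ℤ => EuclideanSpace ℂ (Fin 3)) 2)) : (Fin 3 → ℤ) →
    (EuclideanSpace ℂ (Fin 3))) := rfl

/-- Coordinates of a difference in `W`. [folklore] -/
theorem coeW_sub (x y : W) : (((x - y : W) : (lp (fun _ : Fin 3 → ℤ => EuclideanSpace ℂ (Fin 3)) 2)) : (Fin 3 → ℤ) →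
    (EuclideanSpace ℂ (Fin 3))) = ((x : (lp (fun _ : Fin 3 → ℤ => EuclideanSpace ℂ (Fin 3)) 2)) : (Fin 3 → ℤ) →
    (EuclideanSpace ℂ (Fin 3))) - ((y : (lp (fun _ : Fin 3 → ℤ => EuclideanSpace ℂ (Fin 3)) 2)) : (Fin 3 → ℤ) →
    (EuclideanSpace ℂ (Fin 3))) := rfl

/-- Coordinates of a real multiple in `W`. [folklore] -/
theorem coeW_smul (a : ℝ) (x : W) : (((a • x : W) : (lp (fun _ : Fin 3 → ℤ => EuclideanSpace ℂ (Fin 3)) 2)) : (Fin 3 →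
    ℤ) → (EuclideanSpace ℂ (Fin 3))) = a • ((x : (lp (fun _ : Fin 3 → ℤ => EuclideanSpace ℂ (Fin 3)) 2)) : (Fin 3 → ℤ)
    → (EuclideanSpace ℂ (Fin 3))) := rfl

/-- The norm of `x ∈ W` is its `ℓ²` norm. [folklore] -/
theorem norm_coeW (x : W) : ‖(x : (lp (fun _ : Fin 3 → ℤ => EuclideanSpace ℂ (Fin 3)) 2))‖ = ‖x‖ := rfl

/-- The extended norm of a difference in `W` is that of the `ℓ²` difference. [folklore] -/
theorem enorm_coeW_sub (x y : W) : ‖((x - y : W) : (lp (fun _ : Fin 3 → ℤ => EuclideanSpace ℂ (Fin 3)) 2))‖ₑ = ‖x -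
    y‖ₑ := rfl

variable (hW : ∀ x : (lp (fun _ : Fin 3 → ℤ => EuclideanSpace ℂ (Fin 3)) 2), x ∈ W ↔ (((x : (Fin 3 → ℤ) →
    (EuclideanSpace ℂ (Fin 3))) : (Fin 3 → ℤ) → EuclideanSpace ℂ (Fin 3)) 0 = 0 ∧ (∀ kk : Fin 3 → ℤ, (∑ jj : Fin 3,
    ((kk jj : ℤ) : ℂ) * (((x : (Fin 3 → ℤ) → (EuclideanSpace ℂ (Fin 3))) : (Fin 3 → ℤ) → EuclideanSpace ℂ (Fin 3)) kk)
    jj) = 0) ∧ IsConjSymm ((x : (Fin 3 → ℤ) → (EuclideanSpace ℂ (Fin 3))) : (Fin 3 → ℤ) → EuclideanSpace ℂ (Fin 3))))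
include hW

/-- Zero mode of an element of `W`. [folklore] -/
theorem W_zero (x : W) : ((x : (lp (fun _ : Fin 3 → ℤ => EuclideanSpace ℂ (Fin 3)) 2)) : (Fin 3 → ℤ) → (EuclideanSpace
    ℂ (Fin 3))) 0 = 0 := ((hW x).1 x.2).1

/-- Transversality of an element of `W`. [folklore] -/
theorem W_trans (x : W) (k : (Fin 3 → ℤ)) : (∑ jj : Fin 3, ((k jj : ℤ) : ℂ) * (((x : (lp (fun _ : Fin 3 →
    ℤ => EuclideanSpace ℂ (Fin 3)) 2)) : (Fin 3 → ℤ) → (EuclideanSpace ℂ (Fin 3))) k) jj) = 0 := ((hW x).1 x.2).2.1 k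

/-- Conjugate symmetry of an element of `W`. [folklore] -/
theorem W_conj (x : W) : IsConjSymm ((x : (lp (fun _ : Fin 3 → ℤ => EuclideanSpace ℂ (Fin 3)) 2)) : (Fin 3 → ℤ) →
    (EuclideanSpace ℂ (Fin 3))) := ((hW x).1 x.2).2.2

omit hW in
/-- `W` is complete when closed. [folklore] -/
theorem completeSpace_W (hWc : IsClosed (W : Set (lp (fun _ : Fin 3 → ℤ => EuclideanSpace ℂ (Fin 3)) 2))) :
    CompleteSpace W := hWc.completeSpace_coe

end Space

/-! ## §E The bounded bilinear map `B(x,y) = Π N(x̌, y̌)` on `W` -/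

section Bilinear

/-- Unfolding `cf`. [folklore] -/
theorem cf_apply (x : (Fin 3 → ℤ) → (EuclideanSpace ℂ (Fin 3))) (m : (Fin 3 → ℤ)) : (((fun mm : Fin 3 →
    ℤ => (((freqNormSq mm)⁻¹ : ℝ) : ℂ)) • (x : (Fin 3 → ℤ) → EuclideanSpace ℂ (Fin 3)))) m = (((freqNormSq m)⁻¹ : ℝ) :
    ℂ) • x m := rfl

/-- `cf` kills the zero mode. [folklore] -/
theorem cf_zero (x : (Fin 3 → ℤ) → (EuclideanSpace ℂ (Fin 3))) : (((fun mm : Fin 3 → ℤ => (((freqNormSq mm)⁻¹ : ℝ) :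
    ℂ)) • (x : (Fin 3 → ℤ) → EuclideanSpace ℂ (Fin 3)))) (0 : (Fin 3 → ℤ)) = 0 := by
  rw [cf_apply, freqNormSq_zero, inv_zero, Complex.ofReal_zero, zero_smul]

/-- `‖(cf x) m‖ = ‖x m‖ / |m|²`. [folklore] -/
theorem norm_cf (x : (Fin 3 → ℤ) → (EuclideanSpace ℂ (Fin 3))) (m : (Fin 3 → ℤ)) : ‖(((fun mm : Fin 3 →
    ℤ => (((freqNormSq mm)⁻¹ : ℝ) : ℂ)) • (x : (Fin 3 → ℤ) → EuclideanSpace ℂ (Fin 3)))) m‖ = (freqNormSq m)⁻¹ * ‖x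
    m‖ := by
  rw [cf_apply, norm_smul, Complex.norm_real, Real.norm_of_nonneg (inv_nonneg.2 (freqNormSq_nonneg m))]

/-- `⟨l⟩ ‖(cf y) l‖ ≤ 2 ‖y l‖`. [folklore] -/
theorem weight_mul_norm_cf_le (y : (Fin 3 → ℤ) → (EuclideanSpace ℂ (Fin 3))) (l : (Fin 3 → ℤ)) : sobolevWeight 1 l *
    ‖(((fun mm : Fin 3 → ℤ => (((freqNormSq mm)⁻¹ : ℝ) : ℂ)) • (y : (Fin 3 → ℤ) → EuclideanSpace ℂ (Fin 3)))) l‖ ≤ 2 *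
    ‖y l‖ := by
  by_cases hl : l = 0
  · subst hl
    rw [cf_zero, norm_zero, mul_zero]
    positivity
  · rw [norm_cf, ← mul_assoc]
    refine mul_le_mul_of_nonneg_right ?_ (norm_nonneg _)
    have hf : 0 < freqNormSq l := lt_of_lt_of_le one_pos (one_le_freqNormSq' hl)
    rw [mul_inv_le_iff₀ hf]
    exact sobolevWeight_one_le hl

/-- `⟨l⟩ ‖(cf y) l‖ ≤ 2 ‖y l‖` in `ℝ≥0∞`. [folklore] -/
theorem weight_mul_enorm_cf_le (y : (Fin 3 → ℤ) → (EuclideanSpace ℂ (Fin 3))) (l : (Fin 3 → ℤ)) :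
    ENNReal.ofReal (sobolevWeight 1 l) * ‖(((fun mm : Fin 3 → ℤ => (((freqNormSq mm)⁻¹ : ℝ) : ℂ)) • (y : (Fin 3 → ℤ) →
        EuclideanSpace ℂ (Fin 3)))) l‖ₑ ≤ 2 * ‖y l‖ₑ := by
  have h := ENNReal.ofReal_le_ofReal (weight_mul_norm_cf_le y l)
  rw [ENNReal.ofReal_mul (sobolevWeight_pos 1 l).le, ofReal_norm, ENNReal.ofReal_mul (by norm_num),
    ofReal_norm, ENNReal.ofReal_ofNat] at h
  exact h

/-- `‖(cf y) l‖ ≤ ‖y l‖`. [folklore] -/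
theorem norm_cf_le (y : (Fin 3 → ℤ) → (EuclideanSpace ℂ (Fin 3))) (l : (Fin 3 → ℤ)) : ‖(((fun mm : Fin 3 →
    ℤ => (((freqNormSq mm)⁻¹ : ℝ) : ℂ)) • (y : (Fin 3 → ℤ) → EuclideanSpace ℂ (Fin 3)))) l‖ ≤ ‖y l‖ := by
  by_cases hl : l = 0
  · subst hl; rw [cf_zero, norm_zero]; exact norm_nonneg _
  · rw [norm_cf]
    have hf : 1 ≤ freqNormSq l := one_le_freqNormSq' hl
    exact mul_le_of_le_one_left (norm_nonneg _) (inv_le_one_of_one_le₀ hf)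

/-- `‖Π_k v‖ ≤ ‖v‖`. [folklore] -/
theorem norm_lerayCoeff_le (k : (Fin 3 → ℤ)) (v : (EuclideanSpace ℂ (Fin 3))) : ‖Torus.lerayCoeff k v‖ ≤ ‖v‖ := by
  by_cases hk : k = 0
  · subst hk; rw [Torus.lerayCoeff_zero, norm_zero]; exact norm_nonneg _
  · rw [Torus.lerayCoeff_of_ne_zero hk]; exact Torus.norm_leraySym_le k v

/-- `‖Π_k v‖ₑ ≤ ‖v‖ₑ`. [folklore] -/
theorem enorm_lerayCoeff_le (k : (Fin 3 → ℤ)) (v : (EuclideanSpace ℂ (Fin 3))) : ‖Torus.lerayCoeff k v‖ₑ ≤ ‖v‖ₑ := by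
  rw [← ofReal_norm, ← ofReal_norm]
  exact ENNReal.ofReal_le_ofReal (norm_lerayCoeff_le k v)

/-- **Pointwise bound of the projected symbol on weighted families**:
`‖Π_k N(x̌, y̌)(k)‖ ≤ 36π ∑ₘ ‖x̌ m‖ ‖y(k-m)‖`. [folklore] -/
theorem enorm_leray_nl_cf_le (x y : (Fin 3 → ℤ) → (EuclideanSpace ℂ (Fin 3))) (k : (Fin 3 → ℤ)) :
    ‖Torus.lerayCoeff k ((WithLp.toLp 2 (fun pp : Fin 3 => transportSym (fun jj mm => (((fun mm : Fin 3 →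
        ℤ => (((freqNormSq mm)⁻¹ : ℝ) : ℂ)) • (x : (Fin 3 → ℤ) → EuclideanSpace ℂ (Fin 3)))) mm jj) (fun mm => (((fun
        mm : Fin 3 → ℤ => (((freqNormSq mm)⁻¹ : ℝ) : ℂ)) • (y : (Fin 3 → ℤ) → EuclideanSpace ℂ (Fin 3)))) mm pp) k) :
        EuclideanSpace ℂ (Fin 3)))‖ₑ ≤
      ENNReal.ofReal (36 * Real.pi) * ∑' m, ‖(((fun mm : Fin 3 → ℤ => (((freqNormSq mm)⁻¹ : ℝ) : ℂ)) • (x : (Fin 3 →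
          ℤ) → EuclideanSpace ℂ (Fin 3)))) m‖ₑ * ‖y (k - m)‖ₑ := by
  refine (enorm_lerayCoeff_le k _).trans ((enorm_nl_le _ _ k).trans ?_)
  have h2 : ∑' m, ‖(((fun mm : Fin 3 → ℤ => (((freqNormSq mm)⁻¹ : ℝ) : ℂ)) • (x : (Fin 3 → ℤ) → EuclideanSpace ℂ (Fin
      3)))) m‖ₑ * (ENNReal.ofReal (sobolevWeight 1 (k - m)) * ‖(((fun mm : Fin 3 → ℤ => (((freqNormSq mm)⁻¹ : ℝ) : ℂ))
      • (y : (Fin 3 → ℤ) → EuclideanSpace ℂ (Fin 3)))) (k - m)‖ₑ) ≤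
      ∑' m, ‖(((fun mm : Fin 3 → ℤ => (((freqNormSq mm)⁻¹ : ℝ) : ℂ)) • (x : (Fin 3 → ℤ) → EuclideanSpace ℂ (Fin 3))))
          m‖ₑ * (2 * ‖y (k - m)‖ₑ) :=
    ENNReal.tsum_le_tsum fun m => mul_le_mul_right (weight_mul_enorm_cf_le y (k - m)) _
  refine (mul_le_mul_right h2 _).trans (le_of_eq ?_)
  rw [show (36 : ℝ) * Real.pi = 2 * (18 * Real.pi) by ring,
    ENNReal.ofReal_mul (by norm_num : (0:ℝ) ≤ 2), ENNReal.ofReal_ofNat, ← ENNReal.tsum_mul_left,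
    ← ENNReal.tsum_mul_left]
  exact tsum_congr fun m => by ring

/-- **`ℓ²` bound of the projected symbol**:
`∑ₖ ‖Π_k N(x̌,y̌)(k)‖² ≤ (36π)² Z (∑ ‖x m‖²)(∑ ‖y m‖²)`, `Z = ∑_{m≠0} |m|⁻⁴`. [folklore] -/
theorem tsum_enorm_sq_leray_nl_cf_le (x y : (Fin 3 → ℤ) → (EuclideanSpace ℂ (Fin 3))) :
    ∑' k, ‖Torus.lerayCoeff k ((WithLp.toLp 2 (fun pp : Fin 3 => transportSym (fun jj mm => (((fun mm : Fin 3 →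
        ℤ => (((freqNormSq mm)⁻¹ : ℝ) : ℂ)) • (x : (Fin 3 → ℤ) → EuclideanSpace ℂ (Fin 3)))) mm jj) (fun mm => (((fun
        mm : Fin 3 → ℤ => (((freqNormSq mm)⁻¹ : ℝ) : ℂ)) • (y : (Fin 3 → ℤ) → EuclideanSpace ℂ (Fin 3)))) mm pp) k) :
        EuclideanSpace ℂ (Fin 3)))‖ₑ ^ 2 ≤
      ENNReal.ofReal (36 * Real.pi) ^ 2 *
        ((∑' m : (Fin 3 → ℤ), ENNReal.ofReal ((freqNormSq m)⁻¹) ^ 2) * (∑' m, ‖x m‖ₑ ^ 2) * ∑' m, ‖y m‖ₑ ^ 2) := by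
  set Z : ℝ≥0∞ := ∑' m : (Fin 3 → ℤ), ENNReal.ofReal ((freqNormSq m)⁻¹) ^ 2 with hZ
  calc ∑' k, ‖Torus.lerayCoeff k ((WithLp.toLp 2 (fun pp : Fin 3 => transportSym (fun jj mm => (((fun mm : Fin 3 →
      ℤ => (((freqNormSq mm)⁻¹ : ℝ) : ℂ)) • (x : (Fin 3 → ℤ) → EuclideanSpace ℂ (Fin 3)))) mm jj) (fun mm => (((fun
      mm : Fin 3 → ℤ => (((freqNormSq mm)⁻¹ : ℝ) : ℂ)) • (y : (Fin 3 → ℤ) → EuclideanSpace ℂ (Fin 3)))) mm pp) k) :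
      EuclideanSpace ℂ (Fin 3)))‖ₑ ^ 2
      ≤ ∑' k, (ENNReal.ofReal (36 * Real.pi) * ∑' m, ‖(((fun mm : Fin 3 → ℤ => (((freqNormSq mm)⁻¹ : ℝ) : ℂ)) • (x :
          (Fin 3 → ℤ) → EuclideanSpace ℂ (Fin 3)))) m‖ₑ * ‖y (k - m)‖ₑ) ^ 2 :=
        ENNReal.tsum_le_tsum fun k => pow_le_pow_left' (enorm_leray_nl_cf_le x y k) 2
    _ = ENNReal.ofReal (36 * Real.pi) ^ 2 * ∑' k, (∑' m, ‖(((fun mm : Fin 3 → ℤ => (((freqNormSq mm)⁻¹ : ℝ) : ℂ)) •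
        (x : (Fin 3 → ℤ) → EuclideanSpace ℂ (Fin 3)))) m‖ₑ * ‖y (k - m)‖ₑ) ^ 2 := by
        rw [← ENNReal.tsum_mul_left]
        exact tsum_congr fun k => by ring
    _ ≤ ENNReal.ofReal (36 * Real.pi) ^ 2 * ((∑' m, ‖(((fun mm : Fin 3 → ℤ => (((freqNormSq mm)⁻¹ : ℝ) : ℂ)) • (x :
        (Fin 3 → ℤ) → EuclideanSpace ℂ (Fin 3)))) m‖ₑ) ^ 2 * ∑' m, ‖y m‖ₑ ^ 2) :=
        mul_le_mul_right (young_one_two _ _) _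
    _ ≤ ENNReal.ofReal (36 * Real.pi) ^ 2 * ((Z * ∑' m, ‖x m‖ₑ ^ 2) * ∑' m, ‖y m‖ₑ ^ 2) := by
        refine mul_le_mul_right (mul_le_mul_left ?_ _) _
        calc (∑' m, ‖(((fun mm : Fin 3 → ℤ => (((freqNormSq mm)⁻¹ : ℝ) : ℂ)) • (x : (Fin 3 → ℤ) → EuclideanSpace ℂ
            (Fin 3)))) m‖ₑ) ^ 2
            ≤ (Z ^ (1 / 2 : ℝ) * (∑' m, ‖x m‖ₑ ^ 2) ^ (1 / 2 : ℝ)) ^ 2 :=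
              pow_le_pow_left' (tsum_enorm_cf_le x) 2
          _ = Z * ∑' m, ‖x m‖ₑ ^ 2 := by
              rw [mul_pow, ENNReal.rpow_half_sq, ENNReal.rpow_half_sq]
    _ = ENNReal.ofReal (36 * Real.pi) ^ 2 * (Z * (∑' m, ‖x m‖ₑ ^ 2) * ∑' m, ‖y m‖ₑ ^ 2) := by ring

/-- Summability of `m ↦ ‖(cf x) m‖` for `x ∈ ℓ²`. [folklore] -/
theorem summable_norm_cf (x : (lp (fun _ : Fin 3 → ℤ => EuclideanSpace ℂ (Fin 3)) 2)) : Summable fun m => ‖(((fun mm :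
    Fin 3 → ℤ => (((freqNormSq mm)⁻¹ : ℝ) : ℂ)) • ((x : (Fin 3 → ℤ) → (EuclideanSpace ℂ (Fin 3))) : (Fin 3 → ℤ) →
    EuclideanSpace ℂ (Fin 3)))) m‖ := by
  have h := tsum_enorm_cf_le (x : (Fin 3 → ℤ) → (EuclideanSpace ℂ (Fin 3)))
  have hfin : ∑' m, ‖(((fun mm : Fin 3 → ℤ => (((freqNormSq mm)⁻¹ : ℝ) : ℂ)) • ((x : (Fin 3 → ℤ) → (EuclideanSpace ℂ
      (Fin 3))) : (Fin 3 → ℤ) → EuclideanSpace ℂ (Fin 3)))) m‖ₑ ≠ ∞ := by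
    refine ne_top_of_le_ne_top (ENNReal.mul_ne_top ?_ ?_) h
    · exact ENNReal.rpow_ne_top_of_nonneg (by norm_num) tsum_inv_freqNormSq_sq_ne_top
    · exact ENNReal.rpow_ne_top_of_nonneg (by norm_num) (l2_tsum_enorm_sq_ne_top x)
  have h' : ∑' m, ((‖(((fun mm : Fin 3 → ℤ => (((freqNormSq mm)⁻¹ : ℝ) : ℂ)) • ((x : (Fin 3 → ℤ) → (EuclideanSpace ℂ
      (Fin 3))) : (Fin 3 → ℤ) → EuclideanSpace ℂ (Fin 3)))) m‖₊ : ℝ≥0) : ℝ≥0∞) ≠ ∞ := by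
    refine fun htop => hfin ?_
    rw [← htop]
    exact tsum_congr fun m => by simp [enorm_eq_nnnorm]
  have hs := ENNReal.tsum_coe_ne_top_iff_summable.1 h'
  simpa using NNReal.summable_coe.2 hs

/-- The weighted bound `⟨l⟩ ‖(cf y) l‖ ≤ 2 ‖y‖` for `y ∈ ℓ²`. [folklore] -/
theorem weight_mul_norm_cf_le_norm (y : (lp (fun _ : Fin 3 → ℤ => EuclideanSpace ℂ (Fin 3)) 2)) (l : (Fin 3 → ℤ)) :
    sobolevWeight 1 l * ‖(((fun mm : Fin 3 → ℤ => (((freqNormSq mm)⁻¹ : ℝ) : ℂ)) • ((y : (Fin 3 → ℤ) → (EuclideanSpace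
        ℂ (Fin 3))) : (Fin 3 → ℤ) → EuclideanSpace ℂ (Fin 3)))) l‖ ≤ 2 * ‖y‖ :=
  (weight_mul_norm_cf_le _ l).trans (mul_le_mul_of_nonneg_left (l2_norm_apply_le y l) (by norm_num))

/-- Summability of the symbol's terms for weighted `ℓ²` families. [folklore] -/
theorem summable_nl_cf (x y : (lp (fun _ : Fin 3 → ℤ => EuclideanSpace ℂ (Fin 3)) 2)) (k : (Fin 3 → ℤ)) (j p : Fin
    3) :
    Summable fun m => ((((fun mm : Fin 3 → ℤ => (((freqNormSq mm)⁻¹ : ℝ) : ℂ)) • ((x : (Fin 3 → ℤ) → (EuclideanSpace ℂ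
        (Fin 3))) : (Fin 3 → ℤ) → EuclideanSpace ℂ (Fin 3)))) m) j *
      (dsym j (k - m) * ((((fun mm : Fin 3 → ℤ => (((freqNormSq mm)⁻¹ : ℝ) : ℂ)) • ((y : (Fin 3 → ℤ) → (EuclideanSpace
          ℂ (Fin 3))) : (Fin 3 → ℤ) → EuclideanSpace ℂ (Fin 3)))) (k - m)) p) :=
  summable_nl_term (a := ((fun mm : Fin 3 → ℤ => (((freqNormSq mm)⁻¹ : ℝ) : ℂ)) • ((x : (Fin 3 → ℤ) → (EuclideanSpace
      ℂ (Fin 3))) : (Fin 3 → ℤ) → EuclideanSpace ℂ (Fin 3)))) (b := ((fun mm : Fin 3 → ℤ => (((freqNormSq mm)⁻¹ : ℝ) :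
      ℂ)) • ((y : (Fin 3 → ℤ) → (EuclideanSpace ℂ (Fin 3))) : (Fin 3 → ℤ) → EuclideanSpace ℂ (Fin 3))))
    (summable_norm_cf x) (weight_mul_norm_cf_le_norm y) k j p

/-- `cf` of a sum. [folklore] -/
theorem cf_add (x y : (Fin 3 → ℤ) → (EuclideanSpace ℂ (Fin 3))) : ((fun mm : Fin 3 → ℤ => (((freqNormSq mm)⁻¹ : ℝ) :
    ℂ)) • ((x + y) : (Fin 3 → ℤ) → EuclideanSpace ℂ (Fin 3))) = ((fun mm : Fin 3 → ℤ => (((freqNormSq mm)⁻¹ : ℝ) : ℂ))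
    • (x : (Fin 3 → ℤ) → EuclideanSpace ℂ (Fin 3))) + ((fun mm : Fin 3 → ℤ => (((freqNormSq mm)⁻¹ : ℝ) : ℂ)) • (y :
    (Fin 3 → ℤ) → EuclideanSpace ℂ (Fin 3))) := smul_add _ _ _

/-- `cf` of a real multiple. [folklore] -/
theorem cf_real_smul (a : ℝ) (x : (Fin 3 → ℤ) → (EuclideanSpace ℂ (Fin 3))) : ((fun mm : Fin 3 → ℤ => (((freqNormSq
    mm)⁻¹ : ℝ) : ℂ)) • ((a • x) : (Fin 3 → ℤ) → EuclideanSpace ℂ (Fin 3))) = (a : ℂ) • ((fun mm : Fin 3 →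
    ℤ => (((freqNormSq mm)⁻¹ : ℝ) : ℂ)) • (x : (Fin 3 → ℤ) → EuclideanSpace ℂ (Fin 3))) := by
  funext m
  simp only [Pi.smul_apply', Pi.smul_apply, ← Complex.coe_smul, smul_smul, mul_comm]

/-- `cf` preserves conjugate symmetry (the weight is real and even). [folklore] -/
theorem isConjSymm_cf {x : (Fin 3 → ℤ) → (EuclideanSpace ℂ (Fin 3))} (hx : IsConjSymm x) : IsConjSymm (((fun mm : Fin
    3 → ℤ => (((freqNormSq mm)⁻¹ : ℝ) : ℂ)) • (x : (Fin 3 → ℤ) → EuclideanSpace ℂ (Fin 3)))) := by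
  intro m
  rw [cf_apply, cf_apply, freqNormSq_neg, hx m, conjVec_smul, Complex.conj_ofReal]

/-- `Π_{-k} (conj v) = conj (Π_k v)`. [folklore] -/
theorem lerayCoeff_neg_conjVec (k : (Fin 3 → ℤ)) (v : (EuclideanSpace ℂ (Fin 3))) :
    Torus.lerayCoeff (-k) (conjVec v) = conjVec (Torus.lerayCoeff k v) := by
  by_cases hk : k = 0
  · subst hk; simp [conjVec_zero]
  · rw [Torus.lerayCoeff_of_ne_zero hk, Torus.lerayCoeff_of_ne_zero (neg_ne_zero.2 hk),
      Torus.leraySym_neg_freq, Torus.conjVec_leraySym]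

/-- `Π_k` is transversal: `k · Π_k v = 0`. [folklore] -/
theorem kdot_lerayCoeff (k : (Fin 3 → ℤ)) (v : (EuclideanSpace ℂ (Fin 3))) : (∑ jj : Fin 3, ((k jj : ℤ) : ℂ) *
    (Torus.lerayCoeff k v) jj) = 0 := by
  by_cases hk : k = 0
  · subst hk; simp
  · rw [Torus.lerayCoeff_of_ne_zero hk]; exact Torus.sum_mul_leraySym_apply k v

/-- `Π_k` is `ℂ`-linear: additivity. [folklore] -/
theorem lerayCoeff_add' (k : (Fin 3 → ℤ)) (v w : (EuclideanSpace ℂ (Fin 3))) :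
    Torus.lerayCoeff k (v + w) = Torus.lerayCoeff k v + Torus.lerayCoeff k w := Torus.lerayCoeff_add k v w

/-- `Π_k` is `ℂ`-linear: homogeneity. [folklore] -/
theorem lerayCoeff_smul' (k : (Fin 3 → ℤ)) (c : ℂ) (v : (EuclideanSpace ℂ (Fin 3))) : Torus.lerayCoeff k (c • v) = c •
    Torus.lerayCoeff k v := by
  by_cases hk : k = 0
  · subst hk; simp
  · rw [Torus.lerayCoeff_of_ne_zero hk, Torus.lerayCoeff_of_ne_zero hk, Torus.leraySym_smul]

variable {W : Submodule ℝ (lp (fun _ : Fin 3 → ℤ => EuclideanSpace ℂ (Fin 3)) 2)} (hW : ∀ x : (lp (fun _ : Fin 3 →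
    ℤ => EuclideanSpace ℂ (Fin 3)) 2), x ∈ W ↔ (((x : (Fin 3 → ℤ) → (EuclideanSpace ℂ (Fin 3))) : (Fin 3 → ℤ) →
    EuclideanSpace ℂ (Fin 3)) 0 = 0 ∧ (∀ kk : Fin 3 → ℤ, (∑ jj : Fin 3, ((kk jj : ℤ) : ℂ) * (((x : (Fin 3 → ℤ) →
    (EuclideanSpace ℂ (Fin 3))) : (Fin 3 → ℤ) → EuclideanSpace ℂ (Fin 3)) kk) jj) = 0) ∧ IsConjSymm ((x : (Fin 3 → ℤ)
    → (EuclideanSpace ℂ (Fin 3))) : (Fin 3 → ℤ) → EuclideanSpace ℂ (Fin 3))))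
include hW

/-- **The bounded bilinear map of the steady problem exists on `W`**:
`B(x, y)(k) = Π_k N(x̌, y̌)(k)` with `x̌ = cf x`, bounded by Young's inequality, preserving zero
mean (Π₀ = 0), transversality (Π projects on `k^⊥`) and conjugate symmetry. [folklore] -/
theorem exists_bilinear : ∃ B : W → W → W,
    (∀ x y : W, (((B x y : W) : (lp (fun _ : Fin 3 → ℤ => EuclideanSpace ℂ (Fin 3)) 2)) : (Fin 3 → ℤ) →
        (EuclideanSpace ℂ (Fin 3))) = fun k =>
      Torus.lerayCoeff k ((WithLp.toLp 2 (fun pp : Fin 3 => transportSym (fun jj mm => (((fun mm : Fin 3 →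
          ℤ => (((freqNormSq mm)⁻¹ : ℝ) : ℂ)) • (((x : (lp (fun _ : Fin 3 → ℤ => EuclideanSpace ℂ (Fin 3)) 2)) : (Fin
          3 → ℤ) → (EuclideanSpace ℂ (Fin 3))) : (Fin 3 → ℤ) → EuclideanSpace ℂ (Fin 3)))) mm jj) (fun mm => (((fun
          mm : Fin 3 → ℤ => (((freqNormSq mm)⁻¹ : ℝ) : ℂ)) • (((y : (lp (fun _ : Fin 3 → ℤ => EuclideanSpace ℂ (Fin
          3)) 2)) : (Fin 3 → ℤ) → (EuclideanSpace ℂ (Fin 3))) : (Fin 3 → ℤ) → EuclideanSpace ℂ (Fin 3)))) mm pp) k) :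
          EuclideanSpace ℂ (Fin 3)))) ∧
    IsBoundedBilinearMap ℝ (fun p : W × W => B p.1 p.2) := by
  -- the finite lattice constant
  set Z : ℝ≥0∞ := ∑' m : (Fin 3 → ℤ), ENNReal.ofReal ((freqNormSq m)⁻¹) ^ 2 with hZ
  have hZtop : Z ≠ ∞ := tsum_inv_freqNormSq_sq_ne_top
  -- the raw map on functions
  set g : (lp (fun _ : Fin 3 → ℤ => EuclideanSpace ℂ (Fin 3)) 2) → (lp (fun _ : Fin 3 → ℤ => EuclideanSpace ℂ (Fin 3))
      2) → (Fin 3 → ℤ) → (EuclideanSpace ℂ (Fin 3)) := fun x y k =>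
    Torus.lerayCoeff k ((WithLp.toLp 2 (fun pp : Fin 3 => transportSym (fun jj mm => (((fun mm : Fin 3 →
        ℤ => (((freqNormSq mm)⁻¹ : ℝ) : ℂ)) • ((x : (Fin 3 → ℤ) → (EuclideanSpace ℂ (Fin 3))) : (Fin 3 → ℤ) →
        EuclideanSpace ℂ (Fin 3)))) mm jj) (fun mm => (((fun mm : Fin 3 → ℤ => (((freqNormSq mm)⁻¹ : ℝ) : ℂ)) • ((y :
        (Fin 3 → ℤ) → (EuclideanSpace ℂ (Fin 3))) : (Fin 3 → ℤ) → EuclideanSpace ℂ (Fin 3)))) mm pp) k) :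
        EuclideanSpace ℂ (Fin 3))) with hg
  have hbound : ∀ x y : (lp (fun _ : Fin 3 → ℤ => EuclideanSpace ℂ (Fin 3)) 2), ∑' k, ‖g x y k‖ₑ ^ 2 ≤
      (ENNReal.ofReal (36 * Real.pi) * Z ^ (1 / 2 : ℝ) * ‖x‖ₑ * ‖y‖ₑ) ^ 2 := by
    intro x y
    refine (tsum_enorm_sq_leray_nl_cf_le (x : (Fin 3 → ℤ) → (EuclideanSpace ℂ (Fin 3))) (y : (Fin 3 → ℤ) →
        (EuclideanSpace ℂ (Fin 3)))).trans (le_of_eq ?_)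
    rw [← l2_enorm_sq_eq_tsum, ← l2_enorm_sq_eq_tsum, mul_pow, mul_pow, mul_pow, ENNReal.rpow_half_sq]
    ring
  have hmem : ∀ x y : (lp (fun _ : Fin 3 → ℤ => EuclideanSpace ℂ (Fin 3)) 2), Memℓp (g x y) 2 := fun x y =>
    memℓp_two_of_tsum_ne_top (ne_top_of_le_ne_top (ENNReal.pow_ne_top (ENNReal.mul_ne_top
      (ENNReal.mul_ne_top (ENNReal.mul_ne_top ENNReal.ofReal_ne_top
        (ENNReal.rpow_ne_top_of_nonneg (by norm_num) hZtop)) enorm_ne_top) enorm_ne_top)) (hbound x y))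
  have hV : ∀ x y : W, (((g (x : (lp (fun _ : Fin 3 → ℤ => EuclideanSpace ℂ (Fin 3)) 2)) (y : (lp (fun _ : Fin 3 →
      ℤ => EuclideanSpace ℂ (Fin 3)) 2))) : (Fin 3 → ℤ) → EuclideanSpace ℂ (Fin 3)) 0 = 0 ∧ (∀ kk : Fin 3 → ℤ, (∑ jj :
      Fin 3, ((kk jj : ℤ) : ℂ) * (((g (x : (lp (fun _ : Fin 3 → ℤ => EuclideanSpace ℂ (Fin 3)) 2)) (y : (lp (fun _ :
      Fin 3 → ℤ => EuclideanSpace ℂ (Fin 3)) 2))) : (Fin 3 → ℤ) → EuclideanSpace ℂ (Fin 3)) kk) jj) = 0) ∧ IsConjSymm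
      ((g (x : (lp (fun _ : Fin 3 → ℤ => EuclideanSpace ℂ (Fin 3)) 2)) (y : (lp (fun _ : Fin 3 → ℤ => EuclideanSpace ℂ
      (Fin 3)) 2))) : (Fin 3 → ℤ) → EuclideanSpace ℂ (Fin 3))) := by
    intro x y
    refine ⟨by simp [hg], fun k => kdot_lerayCoeff k _, fun k => ?_⟩
    simp only [hg]
    rw [nl_neg _ _ (isConjSymm_cf (W_conj hW x)) (isConjSymm_cf (W_conj hW y)), lerayCoeff_neg_conjVec]
  set B : W → W → W := fun x y => ⟨⟨g (x : (lp (fun _ : Fin 3 → ℤ => EuclideanSpace ℂ (Fin 3)) 2)) (y : (lp (fun _ :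
      Fin 3 → ℤ => EuclideanSpace ℂ (Fin 3)) 2)), hmem _ _⟩, (hW _).2 (hV x y)⟩ with hB
  have hBcoe : ∀ x y : W, (((B x y : W) : (lp (fun _ : Fin 3 → ℤ => EuclideanSpace ℂ (Fin 3)) 2)) : (Fin 3 → ℤ) →
      (EuclideanSpace ℂ (Fin 3))) = g (x : (lp (fun _ : Fin 3 → ℤ => EuclideanSpace ℂ (Fin 3)) 2)) (y : (lp (fun _ :
      Fin 3 → ℤ => EuclideanSpace ℂ (Fin 3)) 2)) := fun x y => rfl
  refine ⟨B, fun x y => rfl, ?_⟩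
  -- the real constant
  set C : ℝ := 36 * Real.pi * (Z ^ (1 / 2 : ℝ)).toReal with hC
  have hC0 : 0 ≤ C := by positivity
  have hCe : ENNReal.ofReal C = ENNReal.ofReal (36 * Real.pi) * Z ^ (1 / 2 : ℝ) := by
    rw [hC, ENNReal.ofReal_mul (by positivity), ENNReal.ofReal_toReal
      (ENNReal.rpow_ne_top_of_nonneg (by norm_num) hZtop)]
  have hnorm : ∀ x y : W, ‖B x y‖ ≤ C * ‖x‖ * ‖y‖ := by
    intro x y
    rw [← norm_coeW]
    refine l2_norm_le_of_tsum_le _ (by positivity) ?_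
    rw [hBcoe, ENNReal.ofReal_mul (by positivity), ENNReal.ofReal_mul hC0, hCe, ofReal_norm, ofReal_norm]
    exact hbound _ _
  -- summabilities for the algebra
  have hsum : ∀ (x y : W) (k : (Fin 3 → ℤ)) (j p : Fin 3), Summable fun m => ((((fun mm : Fin 3 → ℤ => (((freqNormSq
      mm)⁻¹ : ℝ) : ℂ)) • (((x : (lp (fun _ : Fin 3 → ℤ => EuclideanSpace ℂ (Fin 3)) 2)) : (Fin 3 → ℤ) →
      (EuclideanSpace ℂ (Fin 3))) : (Fin 3 → ℤ) → EuclideanSpace ℂ (Fin 3)))) m) j *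
      (dsym j (k - m) * ((((fun mm : Fin 3 → ℤ => (((freqNormSq mm)⁻¹ : ℝ) : ℂ)) • (((y : (lp (fun _ : Fin 3 →
          ℤ => EuclideanSpace ℂ (Fin 3)) 2)) : (Fin 3 → ℤ) → (EuclideanSpace ℂ (Fin 3))) : (Fin 3 → ℤ) →
          EuclideanSpace ℂ (Fin 3)))) (k - m)) p) := fun x y k j p => summable_nl_cf _ _ k j p
  refine { add_left := ?_, smul_left := ?_, add_right := ?_, smul_right := ?_, bound := ?_ }
  · intro x₁ x₂ y
    refine Subtype.ext (lp.ext (funext fun k => ?_))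
    change g ((x₁ + x₂ : W) : (lp (fun _ : Fin 3 → ℤ => EuclideanSpace ℂ (Fin 3)) 2)) (y : (lp (fun _ : Fin 3 →
        ℤ => EuclideanSpace ℂ (Fin 3)) 2)) k = g (x₁ : (lp (fun _ : Fin 3 → ℤ => EuclideanSpace ℂ (Fin 3)) 2)) (y :
        (lp (fun _ : Fin 3 → ℤ => EuclideanSpace ℂ (Fin 3)) 2)) k + g (x₂ : (lp (fun _ : Fin 3 → ℤ => EuclideanSpace ℂ
        (Fin 3)) 2)) (y : (lp (fun _ : Fin 3 → ℤ => EuclideanSpace ℂ (Fin 3)) 2)) k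
    simp only [hg]
    rw [show (((x₁ + x₂ : W) : (lp (fun _ : Fin 3 → ℤ => EuclideanSpace ℂ (Fin 3)) 2)) : (Fin 3 → ℤ) → (EuclideanSpace
        ℂ (Fin 3))) = ((x₁ : (lp (fun _ : Fin 3 → ℤ => EuclideanSpace ℂ (Fin 3)) 2)) : (Fin 3 → ℤ) → (EuclideanSpace ℂ
        (Fin 3))) + ((x₂ : (lp (fun _ : Fin 3 → ℤ => EuclideanSpace ℂ (Fin 3)) 2)) : (Fin 3 → ℤ) → (EuclideanSpace ℂ
        (Fin 3))) from rfl,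
      cf_add, nl_add_left _ _ _ k (hsum x₁ y k) (hsum x₂ y k), lerayCoeff_add']
  · intro a x y
    refine Subtype.ext (lp.ext (funext fun k => ?_))
    change g ((a • x : W) : (lp (fun _ : Fin 3 → ℤ => EuclideanSpace ℂ (Fin 3)) 2)) (y : (lp (fun _ : Fin 3 →
        ℤ => EuclideanSpace ℂ (Fin 3)) 2)) k = (a • g (x : (lp (fun _ : Fin 3 → ℤ => EuclideanSpace ℂ (Fin 3)) 2))
        (y : (lp (fun _ : Fin 3 → ℤ => EuclideanSpace ℂ (Fin 3)) 2))) k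
    simp only [hg, Pi.smul_apply]
    rw [show (((a • x : W) : (lp (fun _ : Fin 3 → ℤ => EuclideanSpace ℂ (Fin 3)) 2)) : (Fin 3 → ℤ) → (EuclideanSpace ℂ
        (Fin 3))) = a • ((x : (lp (fun _ : Fin 3 → ℤ => EuclideanSpace ℂ (Fin 3)) 2)) : (Fin 3 → ℤ) → (EuclideanSpace
        ℂ (Fin 3))) from rfl, cf_real_smul,
      nl_smul_left, lerayCoeff_smul', Complex.coe_smul]
  · intro x y₁ y₂
    refine Subtype.ext (lp.ext (funext fun k => ?_))
    change g (x : (lp (fun _ : Fin 3 → ℤ => EuclideanSpace ℂ (Fin 3)) 2)) ((y₁ + y₂ : W) : (lp (fun _ : Fin 3 →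
        ℤ => EuclideanSpace ℂ (Fin 3)) 2)) k = g (x : (lp (fun _ : Fin 3 → ℤ => EuclideanSpace ℂ (Fin 3)) 2)) (y₁ :
        (lp (fun _ : Fin 3 → ℤ => EuclideanSpace ℂ (Fin 3)) 2)) k + g (x : (lp (fun _ : Fin 3 → ℤ => EuclideanSpace ℂ
        (Fin 3)) 2)) (y₂ : (lp (fun _ : Fin 3 → ℤ => EuclideanSpace ℂ (Fin 3)) 2)) k
    simp only [hg]
    rw [show (((y₁ + y₂ : W) : (lp (fun _ : Fin 3 → ℤ => EuclideanSpace ℂ (Fin 3)) 2)) : (Fin 3 → ℤ) → (EuclideanSpace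
        ℂ (Fin 3))) = ((y₁ : (lp (fun _ : Fin 3 → ℤ => EuclideanSpace ℂ (Fin 3)) 2)) : (Fin 3 → ℤ) → (EuclideanSpace ℂ
        (Fin 3))) + ((y₂ : (lp (fun _ : Fin 3 → ℤ => EuclideanSpace ℂ (Fin 3)) 2)) : (Fin 3 → ℤ) → (EuclideanSpace ℂ
        (Fin 3))) from rfl,
      cf_add, nl_add_right _ _ _ k (hsum x y₁ k) (hsum x y₂ k), lerayCoeff_add']
  · intro a x y
    refine Subtype.ext (lp.ext (funext fun k => ?_))
    change g (x : (lp (fun _ : Fin 3 → ℤ => EuclideanSpace ℂ (Fin 3)) 2)) ((a • y : W) : (lp (fun _ : Fin 3 →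
        ℤ => EuclideanSpace ℂ (Fin 3)) 2)) k = (a • g (x : (lp (fun _ : Fin 3 → ℤ => EuclideanSpace ℂ (Fin 3)) 2))
        (y : (lp (fun _ : Fin 3 → ℤ => EuclideanSpace ℂ (Fin 3)) 2))) k
    simp only [hg, Pi.smul_apply]
    rw [show (((a • y : W) : (lp (fun _ : Fin 3 → ℤ => EuclideanSpace ℂ (Fin 3)) 2)) : (Fin 3 → ℤ) → (EuclideanSpace ℂ
        (Fin 3))) = a • ((y : (lp (fun _ : Fin 3 → ℤ => EuclideanSpace ℂ (Fin 3)) 2)) : (Fin 3 → ℤ) → (EuclideanSpace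
        ℂ (Fin 3))) from rfl, cf_real_smul,
      nl_smul_right, lerayCoeff_smul', Complex.coe_smul]
  · refine ⟨C + 1, by positivity, fun x y => (hnorm x y).trans ?_⟩
    have := mul_nonneg (mul_nonneg zero_le_one (norm_nonneg x)) (norm_nonneg y)
    nlinarith [mul_nonneg (norm_nonneg x) (norm_nonneg y)]

end Bilinear


/-! ## §F Compactness of the linearised convective operator `K w = B(x₀, w) + B(w, x₀)` -/

section Compact

/-- Crude Peetre: `⟨k⟩ ≤ 2 ⟨k - m⟩ ⟨m⟩`. [folklore] -/
theorem weight_le_two_mul (k m : (Fin 3 → ℤ)) : sobolevWeight 1 k ≤ 2 * sobolevWeight 1 (k - m) * sobolevWeight 1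
    m := by
  have h := Torus.sobolevWeight_le_peetre_of_nonneg zero_le_one k m
  have h2 : (2 : ℝ) ^ ((1 : ℝ) / 2) ≤ 2 := by
    calc (2 : ℝ) ^ ((1 : ℝ) / 2) ≤ (2 : ℝ) ^ (1 : ℝ) :=
          Real.rpow_le_rpow_of_exponent_le one_le_two (by norm_num)
      _ = 2 := Real.rpow_one 2
  refine h.trans ?_
  have := mul_nonneg (sobolevWeight_pos 1 (k - m)).le (sobolevWeight_pos 1 m).le
  nlinarith

/-- `⟨l⟩² ‖(cf y) l‖ ≤ 2 ‖y l‖`. [folklore] -/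
theorem weight_sq_mul_norm_cf_le (y : (Fin 3 → ℤ) → (EuclideanSpace ℂ (Fin 3))) (l : (Fin 3 → ℤ)) : sobolevWeight 1 l
    ^ 2 * ‖(((fun mm : Fin 3 → ℤ => (((freqNormSq mm)⁻¹ : ℝ) : ℂ)) • (y : (Fin 3 → ℤ) → EuclideanSpace ℂ (Fin 3)))) l‖
    ≤ 2 * ‖y l‖ := by
  by_cases hl : l = 0
  · subst hl
    rw [cf_zero, norm_zero, mul_zero]
    positivity
  · rw [norm_cf, ← mul_assoc]
    refine mul_le_mul_of_nonneg_right ?_ (norm_nonneg _)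
    have hf : 0 < freqNormSq l := lt_of_lt_of_le one_pos (one_le_freqNormSq' hl)
    rw [mul_inv_le_iff₀ hf]
    exact sobolevWeight_one_sq_le hl

/-- `⟨l⟩² ‖(cf y) l‖ ≤ 2 ‖y l‖` in `ℝ≥0∞`. [folklore] -/
theorem weight_sq_mul_enorm_cf_le (y : (Fin 3 → ℤ) → (EuclideanSpace ℂ (Fin 3))) (l : (Fin 3 → ℤ)) :
    ENNReal.ofReal (sobolevWeight 1 l) * ENNReal.ofReal (sobolevWeight 1 l) * ‖(((fun mm : Fin 3 → ℤ => (((freqNormSq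
        mm)⁻¹ : ℝ) : ℂ)) • (y : (Fin 3 → ℤ) → EuclideanSpace ℂ (Fin 3)))) l‖ₑ ≤ 2 * ‖y l‖ₑ := by
  have h := ENNReal.ofReal_le_ofReal (weight_sq_mul_norm_cf_le y l)
  rw [ENNReal.ofReal_mul (sq_nonneg _), ENNReal.ofReal_pow (sobolevWeight_pos 1 l).le, ofReal_norm,
    ENNReal.ofReal_mul (by norm_num), ofReal_norm, ENNReal.ofReal_ofNat, sq] at h
  exact h

/-- **Weighted bound, smooth factor first**:
`⟨k⟩ ‖Π_k N(a, y̌)(k)‖ ≤ 72π ∑ₘ (⟨m⟩ ‖a m‖) ‖y(k-m)‖`. [folklore] -/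
theorem weighted_enorm_leray_nl_left (a y : (Fin 3 → ℤ) → (EuclideanSpace ℂ (Fin 3))) (k : (Fin 3 → ℤ)) :
    ENNReal.ofReal (sobolevWeight 1 k) * ‖Torus.lerayCoeff k ((WithLp.toLp 2 (fun pp : Fin 3 => transportSym (fun jj
        mm => a mm jj) (fun mm => (((fun mm : Fin 3 → ℤ => (((freqNormSq mm)⁻¹ : ℝ) : ℂ)) • (y : (Fin 3 → ℤ) →
        EuclideanSpace ℂ (Fin 3)))) mm pp) k) : EuclideanSpace ℂ (Fin 3)))‖ₑ ≤
      ENNReal.ofReal (72 * Real.pi) * ∑' m, (ENNReal.ofReal (sobolevWeight 1 m) * ‖a m‖ₑ) * ‖y (k - m)‖ₑ := by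
  have h1 := (enorm_lerayCoeff_le k _).trans (enorm_nl_le a (((fun mm : Fin 3 → ℤ => (((freqNormSq mm)⁻¹ : ℝ) : ℂ)) •
      (y : (Fin 3 → ℤ) → EuclideanSpace ℂ (Fin 3)))) k)
  calc ENNReal.ofReal (sobolevWeight 1 k) * ‖Torus.lerayCoeff k ((WithLp.toLp 2 (fun pp : Fin 3 => transportSym (fun
      jj mm => a mm jj) (fun mm => (((fun mm : Fin 3 → ℤ => (((freqNormSq mm)⁻¹ : ℝ) : ℂ)) • (y : (Fin 3 → ℤ) →
      EuclideanSpace ℂ (Fin 3)))) mm pp) k) : EuclideanSpace ℂ (Fin 3)))‖ₑ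
      ≤ ENNReal.ofReal (sobolevWeight 1 k) * (ENNReal.ofReal (18 * Real.pi) *
          ∑' m, ‖a m‖ₑ * (ENNReal.ofReal (sobolevWeight 1 (k - m)) * ‖(((fun mm : Fin 3 → ℤ => (((freqNormSq mm)⁻¹ :
              ℝ) : ℂ)) • (y : (Fin 3 → ℤ) → EuclideanSpace ℂ (Fin 3)))) (k - m)‖ₑ)) :=
        mul_le_mul_right h1 _
    _ = ENNReal.ofReal (18 * Real.pi) * ∑' m, ENNReal.ofReal (sobolevWeight 1 k) *
          (‖a m‖ₑ * (ENNReal.ofReal (sobolevWeight 1 (k - m)) * ‖(((fun mm : Fin 3 → ℤ => (((freqNormSq mm)⁻¹ : ℝ) :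
              ℂ)) • (y : (Fin 3 → ℤ) → EuclideanSpace ℂ (Fin 3)))) (k - m)‖ₑ)) := by
        rw [mul_left_comm]
        congr 1
        exact ENNReal.tsum_mul_left.symm
    _ ≤ ENNReal.ofReal (18 * Real.pi) * ∑' m, 4 * ((ENNReal.ofReal (sobolevWeight 1 m) * ‖a m‖ₑ) *
          ‖y (k - m)‖ₑ) := by
        refine mul_le_mul_right (ENNReal.tsum_le_tsum fun m => ?_) _
        have hP : ENNReal.ofReal (sobolevWeight 1 k) ≤
            2 * ENNReal.ofReal (sobolevWeight 1 (k - m)) * ENNReal.ofReal (sobolevWeight 1 m) := by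
          rw [← ENNReal.ofReal_ofNat, ← ENNReal.ofReal_mul (by norm_num),
            ← ENNReal.ofReal_mul (mul_nonneg (by norm_num) (sobolevWeight_pos _ _).le)]
          exact ENNReal.ofReal_le_ofReal (weight_le_two_mul k m)
        calc ENNReal.ofReal (sobolevWeight 1 k) *
              (‖a m‖ₑ * (ENNReal.ofReal (sobolevWeight 1 (k - m)) * ‖(((fun mm : Fin 3 → ℤ => (((freqNormSq mm)⁻¹ :
                  ℝ) : ℂ)) • (y : (Fin 3 → ℤ) → EuclideanSpace ℂ (Fin 3)))) (k - m)‖ₑ))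
            ≤ (2 * ENNReal.ofReal (sobolevWeight 1 (k - m)) * ENNReal.ofReal (sobolevWeight 1 m)) *
              (‖a m‖ₑ * (ENNReal.ofReal (sobolevWeight 1 (k - m)) * ‖(((fun mm : Fin 3 → ℤ => (((freqNormSq mm)⁻¹ :
                  ℝ) : ℂ)) • (y : (Fin 3 → ℤ) → EuclideanSpace ℂ (Fin 3)))) (k - m)‖ₑ)) :=
              mul_le_mul_left hP _
          _ = 2 * (ENNReal.ofReal (sobolevWeight 1 m) * ‖a m‖ₑ) *
              (ENNReal.ofReal (sobolevWeight 1 (k - m)) * ENNReal.ofReal (sobolevWeight 1 (k - m)) *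
                ‖(((fun mm : Fin 3 → ℤ => (((freqNormSq mm)⁻¹ : ℝ) : ℂ)) • (y : (Fin 3 → ℤ) → EuclideanSpace ℂ (Fin
                    3)))) (k - m)‖ₑ) := by ring
          _ ≤ 2 * (ENNReal.ofReal (sobolevWeight 1 m) * ‖a m‖ₑ) * (2 * ‖y (k - m)‖ₑ) :=
              mul_le_mul_right (weight_sq_mul_enorm_cf_le y (k - m)) _
          _ = 4 * ((ENNReal.ofReal (sobolevWeight 1 m) * ‖a m‖ₑ) * ‖y (k - m)‖ₑ) := by ring
    _ = ENNReal.ofReal (72 * Real.pi) *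
          ∑' m, (ENNReal.ofReal (sobolevWeight 1 m) * ‖a m‖ₑ) * ‖y (k - m)‖ₑ := by
        rw [ENNReal.tsum_mul_left, ← mul_assoc, show (72 : ℝ) * Real.pi = (18 * Real.pi) * 4 by ring,
          ENNReal.ofReal_mul (p := 18 * Real.pi) (q := 4) (by positivity), ENNReal.ofReal_ofNat]

/-- **Weighted bound, smooth factor second**:
`⟨k⟩ ‖Π_k N(x̌, a)(k)‖ ≤ 72π ∑ₘ ‖x m‖ (⟨k-m⟩² ‖a(k-m)‖)`. [folklore] -/
theorem weighted_enorm_leray_nl_right (x a : (Fin 3 → ℤ) → (EuclideanSpace ℂ (Fin 3))) (k : (Fin 3 → ℤ)) :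
    ENNReal.ofReal (sobolevWeight 1 k) * ‖Torus.lerayCoeff k ((WithLp.toLp 2 (fun pp : Fin 3 => transportSym (fun jj
        mm => (((fun mm : Fin 3 → ℤ => (((freqNormSq mm)⁻¹ : ℝ) : ℂ)) • (x : (Fin 3 → ℤ) → EuclideanSpace ℂ (Fin 3))))
        mm jj) (fun mm => a mm pp) k) : EuclideanSpace ℂ (Fin 3)))‖ₑ ≤
      ENNReal.ofReal (72 * Real.pi) * ∑' m, ‖x m‖ₑ *
        ((ENNReal.ofReal (sobolevWeight 1 (k - m)) * ENNReal.ofReal (sobolevWeight 1 (k - m))) * ‖a (k - m)‖ₑ) := by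
  have h1 := (enorm_lerayCoeff_le k _).trans (enorm_nl_le (((fun mm : Fin 3 → ℤ => (((freqNormSq mm)⁻¹ : ℝ) : ℂ)) •
      (x : (Fin 3 → ℤ) → EuclideanSpace ℂ (Fin 3)))) a k)
  calc ENNReal.ofReal (sobolevWeight 1 k) * ‖Torus.lerayCoeff k ((WithLp.toLp 2 (fun pp : Fin 3 => transportSym (fun
      jj mm => (((fun mm : Fin 3 → ℤ => (((freqNormSq mm)⁻¹ : ℝ) : ℂ)) • (x : (Fin 3 → ℤ) → EuclideanSpace ℂ (Fin
      3)))) mm jj) (fun mm => a mm pp) k) : EuclideanSpace ℂ (Fin 3)))‖ₑ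
      ≤ ENNReal.ofReal (sobolevWeight 1 k) * (ENNReal.ofReal (18 * Real.pi) *
          ∑' m, ‖(((fun mm : Fin 3 → ℤ => (((freqNormSq mm)⁻¹ : ℝ) : ℂ)) • (x : (Fin 3 → ℤ) → EuclideanSpace ℂ (Fin
              3)))) m‖ₑ * (ENNReal.ofReal (sobolevWeight 1 (k - m)) * ‖a (k - m)‖ₑ)) :=
        mul_le_mul_right h1 _
    _ = ENNReal.ofReal (18 * Real.pi) * ∑' m, ENNReal.ofReal (sobolevWeight 1 k) *
          (‖(((fun mm : Fin 3 → ℤ => (((freqNormSq mm)⁻¹ : ℝ) : ℂ)) • (x : (Fin 3 → ℤ) → EuclideanSpace ℂ (Fin 3))))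
              m‖ₑ * (ENNReal.ofReal (sobolevWeight 1 (k - m)) * ‖a (k - m)‖ₑ)) := by
        rw [mul_left_comm]
        congr 1
        exact ENNReal.tsum_mul_left.symm
    _ ≤ ENNReal.ofReal (18 * Real.pi) * ∑' m, 4 * (‖x m‖ₑ *
          ((ENNReal.ofReal (sobolevWeight 1 (k - m)) * ENNReal.ofReal (sobolevWeight 1 (k - m))) * ‖a (k -
              m)‖ₑ)) := by
        refine mul_le_mul_right (ENNReal.tsum_le_tsum fun m => ?_) _
        have hP : ENNReal.ofReal (sobolevWeight 1 k) ≤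
            2 * ENNReal.ofReal (sobolevWeight 1 (k - m)) * ENNReal.ofReal (sobolevWeight 1 m) := by
          rw [← ENNReal.ofReal_ofNat, ← ENNReal.ofReal_mul (by norm_num),
            ← ENNReal.ofReal_mul (mul_nonneg (by norm_num) (sobolevWeight_pos _ _).le)]
          exact ENNReal.ofReal_le_ofReal (weight_le_two_mul k m)
        calc ENNReal.ofReal (sobolevWeight 1 k) *
              (‖(((fun mm : Fin 3 → ℤ => (((freqNormSq mm)⁻¹ : ℝ) : ℂ)) • (x : (Fin 3 → ℤ) → EuclideanSpace ℂ (Fin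
                  3)))) m‖ₑ * (ENNReal.ofReal (sobolevWeight 1 (k - m)) * ‖a (k - m)‖ₑ))
            ≤ (2 * ENNReal.ofReal (sobolevWeight 1 (k - m)) * ENNReal.ofReal (sobolevWeight 1 m)) *
              (‖(((fun mm : Fin 3 → ℤ => (((freqNormSq mm)⁻¹ : ℝ) : ℂ)) • (x : (Fin 3 → ℤ) → EuclideanSpace ℂ (Fin
                  3)))) m‖ₑ * (ENNReal.ofReal (sobolevWeight 1 (k - m)) * ‖a (k - m)‖ₑ)) :=
              mul_le_mul_left hP _
          _ = 2 * (ENNReal.ofReal (sobolevWeight 1 m) * ‖(((fun mm : Fin 3 → ℤ => (((freqNormSq mm)⁻¹ : ℝ) : ℂ)) •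
              (x : (Fin 3 → ℤ) → EuclideanSpace ℂ (Fin 3)))) m‖ₑ) *
              ((ENNReal.ofReal (sobolevWeight 1 (k - m)) * ENNReal.ofReal (sobolevWeight 1 (k - m))) *
                ‖a (k - m)‖ₑ) := by ring
          _ ≤ 2 * (2 * ‖x m‖ₑ) *
              ((ENNReal.ofReal (sobolevWeight 1 (k - m)) * ENNReal.ofReal (sobolevWeight 1 (k - m))) *
                ‖a (k - m)‖ₑ) :=
              mul_le_mul_left (mul_le_mul_right (weight_mul_enorm_cf_le x m) _) _
          _ = 4 * (‖x m‖ₑ *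
              ((ENNReal.ofReal (sobolevWeight 1 (k - m)) * ENNReal.ofReal (sobolevWeight 1 (k - m))) *
                ‖a (k - m)‖ₑ)) := by ring
    _ = ENNReal.ofReal (72 * Real.pi) * ∑' m, ‖x m‖ₑ *
          ((ENNReal.ofReal (sobolevWeight 1 (k - m)) * ENNReal.ofReal (sobolevWeight 1 (k - m))) *
            ‖a (k - m)‖ₑ) := by
        rw [ENNReal.tsum_mul_left, ← mul_assoc, show (72 : ℝ) * Real.pi = (18 * Real.pi) * 4 by ring,
          ENNReal.ofReal_mul (p := 18 * Real.pi) (q := 4) (by positivity), ENNReal.ofReal_ofNat]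

/-- Commuting a lattice convolution of `ℝ≥0∞` families: `∑ₘ f(m) g(k-m) = ∑ₘ g(m) f(k-m)`. [folklore] -/
theorem tsum_mul_sub_comm (f g : (Fin 3 → ℤ) → ℝ≥0∞) (k : (Fin 3 → ℤ)) :
    ∑' m, f m * g (k - m) = ∑' m, g m * f (k - m) := by
  have h := SteadyNS.lconv_comm g f k
  calc ∑' m, f m * g (k - m) = ∑' l, g (k - l) * f l := tsum_congr fun l => mul_comm _ _
    _ = ∑' l, f (k - l) * g l := h
    _ = ∑' m, g m * f (k - m) := tsum_congr fun l => mul_comm _ _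

/-- **The `H¹`-type gain of the linearised convective operator**: for `(K w)(k) = Π_k N(a, w̌)(k) +
Π_k N(w̌, a)(k)` one has `∑ₖ ⟨k⟩² ‖(K w)(k)‖² ≤ (2 · 72π · A)² ∑ₖ ‖w k‖²` with
`A = ∑ₘ ⟨m⟩² ‖a m‖`. [folklore] -/
theorem eNormSq_one_linearised_le (a w : (Fin 3 → ℤ) → (EuclideanSpace ℂ (Fin 3))) :
    Lattice.eNormSq 1 (fun k => Torus.lerayCoeff k ((WithLp.toLp 2 (fun pp : Fin 3 => transportSym (fun jj mm => a mm
        jj) (fun mm => (((fun mm : Fin 3 → ℤ => (((freqNormSq mm)⁻¹ : ℝ) : ℂ)) • (w : (Fin 3 → ℤ) → EuclideanSpace ℂ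
        (Fin 3)))) mm pp) k) : EuclideanSpace ℂ (Fin 3))) + Torus.lerayCoeff k ((WithLp.toLp 2 (fun pp : Fin
        3 => transportSym (fun jj mm => (((fun mm : Fin 3 → ℤ => (((freqNormSq mm)⁻¹ : ℝ) : ℂ)) • (w : (Fin 3 → ℤ) →
        EuclideanSpace ℂ (Fin 3)))) mm jj) (fun mm => a mm pp) k) : EuclideanSpace ℂ (Fin 3)))) ≤
      (2 * ENNReal.ofReal (72 * Real.pi) *
        (∑' m, (ENNReal.ofReal (sobolevWeight 1 m) * ENNReal.ofReal (sobolevWeight 1 m)) * ‖a m‖ₑ)) ^ 2 *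
        ∑' k, ‖w k‖ₑ ^ 2 := by
  set A : ℝ≥0∞ := ∑' m, (ENNReal.ofReal (sobolevWeight 1 m) * ENNReal.ofReal (sobolevWeight 1 m)) * ‖a m‖ₑ
    with hA
  set A₁ : ℝ≥0∞ := ∑' m, ENNReal.ofReal (sobolevWeight 1 m) * ‖a m‖ₑ with hA₁
  have hA₁ : A₁ ≤ A := by
    refine ENNReal.tsum_le_tsum fun m => mul_le_mul_left ?_ _
    have h1 : 1 ≤ ENNReal.ofReal (sobolevWeight 1 m) :=
      ENNReal.one_le_ofReal.2 (Torus.one_le_sobolevWeight zero_le_one m)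
    calc ENNReal.ofReal (sobolevWeight 1 m) = 1 * ENNReal.ofReal (sobolevWeight 1 m) := (one_mul _).symm
      _ ≤ ENNReal.ofReal (sobolevWeight 1 m) * ENNReal.ofReal (sobolevWeight 1 m) := mul_le_mul_left h1 _
  set C : ℝ≥0∞ := ENNReal.ofReal (72 * Real.pi) with hC
  -- the two pieces
  have hT₁ : ∑' k, (ENNReal.ofReal (sobolevWeight 1 k) * ‖Torus.lerayCoeff k ((WithLp.toLp 2 (fun pp : Fin
      3 => transportSym (fun jj mm => a mm jj) (fun mm => (((fun mm : Fin 3 → ℤ => (((freqNormSq mm)⁻¹ : ℝ) : ℂ)) •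
      (w : (Fin 3 → ℤ) → EuclideanSpace ℂ (Fin 3)))) mm pp) k) : EuclideanSpace ℂ (Fin 3)))‖ₑ) ^ 2 ≤
      C ^ 2 * (A₁ ^ 2 * ∑' k, ‖w k‖ₑ ^ 2) := by
    calc ∑' k, (ENNReal.ofReal (sobolevWeight 1 k) * ‖Torus.lerayCoeff k ((WithLp.toLp 2 (fun pp : Fin
        3 => transportSym (fun jj mm => a mm jj) (fun mm => (((fun mm : Fin 3 → ℤ => (((freqNormSq mm)⁻¹ : ℝ) : ℂ)) •
        (w : (Fin 3 → ℤ) → EuclideanSpace ℂ (Fin 3)))) mm pp) k) : EuclideanSpace ℂ (Fin 3)))‖ₑ) ^ 2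
        ≤ ∑' k, (C * ∑' m, (ENNReal.ofReal (sobolevWeight 1 m) * ‖a m‖ₑ) * ‖w (k - m)‖ₑ) ^ 2 :=
          ENNReal.tsum_le_tsum fun k => pow_le_pow_left' (weighted_enorm_leray_nl_left a w k) 2
      _ = C ^ 2 * ∑' k, (∑' m, (ENNReal.ofReal (sobolevWeight 1 m) * ‖a m‖ₑ) * ‖w (k - m)‖ₑ) ^ 2 := by
          rw [← ENNReal.tsum_mul_left]; exact tsum_congr fun k => by ring
      _ ≤ C ^ 2 * (A₁ ^ 2 * ∑' k, ‖w k‖ₑ ^ 2) := mul_le_mul_right (young_one_two _ _) _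
  have hT₂ : ∑' k, (ENNReal.ofReal (sobolevWeight 1 k) * ‖Torus.lerayCoeff k ((WithLp.toLp 2 (fun pp : Fin
      3 => transportSym (fun jj mm => (((fun mm : Fin 3 → ℤ => (((freqNormSq mm)⁻¹ : ℝ) : ℂ)) • (w : (Fin 3 → ℤ) →
      EuclideanSpace ℂ (Fin 3)))) mm jj) (fun mm => a mm pp) k) : EuclideanSpace ℂ (Fin 3)))‖ₑ) ^ 2 ≤
      C ^ 2 * (A ^ 2 * ∑' k, ‖w k‖ₑ ^ 2) := by
    calc ∑' k, (ENNReal.ofReal (sobolevWeight 1 k) * ‖Torus.lerayCoeff k ((WithLp.toLp 2 (fun pp : Fin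
        3 => transportSym (fun jj mm => (((fun mm : Fin 3 → ℤ => (((freqNormSq mm)⁻¹ : ℝ) : ℂ)) • (w : (Fin 3 → ℤ) →
        EuclideanSpace ℂ (Fin 3)))) mm jj) (fun mm => a mm pp) k) : EuclideanSpace ℂ (Fin 3)))‖ₑ) ^ 2
        ≤ ∑' k, (C * ∑' m, ‖w m‖ₑ * ((ENNReal.ofReal (sobolevWeight 1 (k - m)) *
            ENNReal.ofReal (sobolevWeight 1 (k - m))) * ‖a (k - m)‖ₑ)) ^ 2 :=
          ENNReal.tsum_le_tsum fun k => pow_le_pow_left' (weighted_enorm_leray_nl_right w a k) 2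
      _ = C ^ 2 * ∑' k, (∑' m, ((ENNReal.ofReal (sobolevWeight 1 m) * ENNReal.ofReal (sobolevWeight 1 m)) *
            ‖a m‖ₑ) * ‖w (k - m)‖ₑ) ^ 2 := by
          rw [← ENNReal.tsum_mul_left]
          refine tsum_congr fun k => ?_
          rw [mul_pow]
          congr 2
          exact tsum_mul_sub_comm (fun m => ‖w m‖ₑ)
            (fun l => (ENNReal.ofReal (sobolevWeight 1 l) * ENNReal.ofReal (sobolevWeight 1 l)) * ‖a l‖ₑ) k
      _ ≤ C ^ 2 * (A ^ 2 * ∑' k, ‖w k‖ₑ ^ 2) := mul_le_mul_right (young_one_two _ _) _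
  -- assemble
  unfold Lattice.eNormSq
  calc ∑' k, ENNReal.ofReal (sobolevWeight 1 k ^ 2) *
        ‖Torus.lerayCoeff k ((WithLp.toLp 2 (fun pp : Fin 3 => transportSym (fun jj mm => a mm jj) (fun mm => (((fun
            mm : Fin 3 → ℤ => (((freqNormSq mm)⁻¹ : ℝ) : ℂ)) • (w : (Fin 3 → ℤ) → EuclideanSpace ℂ (Fin 3)))) mm pp)
            k) : EuclideanSpace ℂ (Fin 3))) + Torus.lerayCoeff k ((WithLp.toLp 2 (fun pp : Fin 3 => transportSym (fun
            jj mm => (((fun mm : Fin 3 → ℤ => (((freqNormSq mm)⁻¹ : ℝ) : ℂ)) • (w : (Fin 3 → ℤ) → EuclideanSpace ℂ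
            (Fin 3)))) mm jj) (fun mm => a mm pp) k) : EuclideanSpace ℂ (Fin 3)))‖ₑ ^ 2
      ≤ ∑' k, (2 * (ENNReal.ofReal (sobolevWeight 1 k) * ‖Torus.lerayCoeff k ((WithLp.toLp 2 (fun pp : Fin
          3 => transportSym (fun jj mm => a mm jj) (fun mm => (((fun mm : Fin 3 → ℤ => (((freqNormSq mm)⁻¹ : ℝ) : ℂ))
          • (w : (Fin 3 → ℤ) → EuclideanSpace ℂ (Fin 3)))) mm pp) k) : EuclideanSpace ℂ (Fin 3)))‖ₑ) ^ 2 +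
          2 * (ENNReal.ofReal (sobolevWeight 1 k) * ‖Torus.lerayCoeff k ((WithLp.toLp 2 (fun pp : Fin
              3 => transportSym (fun jj mm => (((fun mm : Fin 3 → ℤ => (((freqNormSq mm)⁻¹ : ℝ) : ℂ)) • (w : (Fin 3 →
              ℤ) → EuclideanSpace ℂ (Fin 3)))) mm jj) (fun mm => a mm pp) k) : EuclideanSpace ℂ (Fin 3)))‖ₑ) ^
              2) := by
        refine ENNReal.tsum_le_tsum fun k => ?_
        rw [ENNReal.ofReal_pow (sobolevWeight_pos 1 k).le]
        calc ENNReal.ofReal (sobolevWeight 1 k) ^ 2 *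
              ‖Torus.lerayCoeff k ((WithLp.toLp 2 (fun pp : Fin 3 => transportSym (fun jj mm => a mm jj) (fun
                  mm => (((fun mm : Fin 3 → ℤ => (((freqNormSq mm)⁻¹ : ℝ) : ℂ)) • (w : (Fin 3 → ℤ) → EuclideanSpace ℂ
                  (Fin 3)))) mm pp) k) : EuclideanSpace ℂ (Fin 3))) + Torus.lerayCoeff k ((WithLp.toLp 2 (fun pp : Fin
                  3 => transportSym (fun jj mm => (((fun mm : Fin 3 → ℤ => (((freqNormSq mm)⁻¹ : ℝ) : ℂ)) • (w : (Fin
                  3 → ℤ) → EuclideanSpace ℂ (Fin 3)))) mm jj) (fun mm => a mm pp) k) : EuclideanSpace ℂ (Fin 3)))‖ₑ ^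
                  2
            ≤ ENNReal.ofReal (sobolevWeight 1 k) ^ 2 *
              (‖Torus.lerayCoeff k ((WithLp.toLp 2 (fun pp : Fin 3 => transportSym (fun jj mm => a mm jj) (fun
                  mm => (((fun mm : Fin 3 → ℤ => (((freqNormSq mm)⁻¹ : ℝ) : ℂ)) • (w : (Fin 3 → ℤ) → EuclideanSpace ℂ
                  (Fin 3)))) mm pp) k) : EuclideanSpace ℂ (Fin 3)))‖ₑ + ‖Torus.lerayCoeff k ((WithLp.toLp 2 (fun pp :
                  Fin 3 => transportSym (fun jj mm => (((fun mm : Fin 3 → ℤ => (((freqNormSq mm)⁻¹ : ℝ) : ℂ)) • (w :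
                  (Fin 3 → ℤ) → EuclideanSpace ℂ (Fin 3)))) mm jj) (fun mm => a mm pp) k) : EuclideanSpace ℂ (Fin
                  3)))‖ₑ) ^ 2 :=
              mul_le_mul_right (pow_le_pow_left' (enorm_add_le _ _) 2) _
          _ = (ENNReal.ofReal (sobolevWeight 1 k) * ‖Torus.lerayCoeff k ((WithLp.toLp 2 (fun pp : Fin
              3 => transportSym (fun jj mm => a mm jj) (fun mm => (((fun mm : Fin 3 → ℤ => (((freqNormSq mm)⁻¹ : ℝ) :
              ℂ)) • (w : (Fin 3 → ℤ) → EuclideanSpace ℂ (Fin 3)))) mm pp) k) : EuclideanSpace ℂ (Fin 3)))‖ₑ +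
              ENNReal.ofReal (sobolevWeight 1 k) * ‖Torus.lerayCoeff k ((WithLp.toLp 2 (fun pp : Fin 3 => transportSym
                  (fun jj mm => (((fun mm : Fin 3 → ℤ => (((freqNormSq mm)⁻¹ : ℝ) : ℂ)) • (w : (Fin 3 → ℤ) →
                  EuclideanSpace ℂ (Fin 3)))) mm jj) (fun mm => a mm pp) k) : EuclideanSpace ℂ (Fin 3)))‖ₑ) ^
                  2 := by ring
          _ ≤ _ := Lattice.ennreal_add_pow_two_le _ _
    _ = 2 * ∑' k, (ENNReal.ofReal (sobolevWeight 1 k) * ‖Torus.lerayCoeff k ((WithLp.toLp 2 (fun pp : Fin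
        3 => transportSym (fun jj mm => a mm jj) (fun mm => (((fun mm : Fin 3 → ℤ => (((freqNormSq mm)⁻¹ : ℝ) : ℂ)) •
        (w : (Fin 3 → ℤ) → EuclideanSpace ℂ (Fin 3)))) mm pp) k) : EuclideanSpace ℂ (Fin 3)))‖ₑ) ^ 2 +
          2 * ∑' k, (ENNReal.ofReal (sobolevWeight 1 k) * ‖Torus.lerayCoeff k ((WithLp.toLp 2 (fun pp : Fin
              3 => transportSym (fun jj mm => (((fun mm : Fin 3 → ℤ => (((freqNormSq mm)⁻¹ : ℝ) : ℂ)) • (w : (Fin 3 →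
              ℤ) → EuclideanSpace ℂ (Fin 3)))) mm jj) (fun mm => a mm pp) k) : EuclideanSpace ℂ (Fin 3)))‖ₑ) ^ 2 := by
        rw [ENNReal.tsum_add, ENNReal.tsum_mul_left, ENNReal.tsum_mul_left]
    _ ≤ 2 * (C ^ 2 * (A₁ ^ 2 * ∑' k, ‖w k‖ₑ ^ 2)) + 2 * (C ^ 2 * (A ^ 2 * ∑' k, ‖w k‖ₑ ^ 2)) :=
        add_le_add (mul_le_mul_right hT₁ _) (mul_le_mul_right hT₂ _)
    _ ≤ 2 * (C ^ 2 * (A ^ 2 * ∑' k, ‖w k‖ₑ ^ 2)) + 2 * (C ^ 2 * (A ^ 2 * ∑' k, ‖w k‖ₑ ^ 2)) :=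
        add_le_add (mul_le_mul_right (mul_le_mul_right (mul_le_mul_left (pow_le_pow_left' hA₁ 2) _) _) _) le_rfl
    _ = (2 * C * A) ^ 2 * ∑' k, ‖w k‖ₑ ^ 2 := by ring

/-- The weight sum `∑ₘ ⟨m⟩² ‖a m‖` is finite for rapidly decaying `a`. [folklore] -/
theorem tsum_weight_sq_enorm_ne_top_of_rapidDecay {a : (Fin 3 → ℤ) → (EuclideanSpace ℂ (Fin 3))} (ha : RapidDecay a) :
    ∑' m, (ENNReal.ofReal (sobolevWeight 1 m) * ENNReal.ofReal (sobolevWeight 1 m)) * ‖a m‖ₑ ≠ ∞ := by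
  have hs : Summable fun m : (Fin 3 → ℤ) => (1 + freqNormSq m) ^ 1 * ‖a m‖ := ha 1
  have heq : ∀ m : (Fin 3 → ℤ), (ENNReal.ofReal (sobolevWeight 1 m) * ENNReal.ofReal (sobolevWeight 1 m)) * ‖a m‖ₑ =
      ENNReal.ofReal ((1 + freqNormSq m) ^ 1 * ‖a m‖) := by
    intro m
    rw [pow_one, ← ENNReal.ofReal_mul (sobolevWeight_pos 1 m).le, ← sq, SteadyNS.sobolevWeight_one_sq,
      ← ofReal_norm, ← ENNReal.ofReal_mul (by linarith [freqNormSq_nonneg m])]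
  simp_rw [heq]
  rw [← ENNReal.ofReal_tsum_of_nonneg (fun m => mul_nonneg (one_add_freqNormSq_pow_nonneg m 1) (norm_nonneg _)) hs]
  exact ENNReal.ofReal_ne_top

/-- **Closed `H¹`-bounded subsets of `ℓ²` are compact** (Rellich on the lattice, `Lattice.rellich`,
plus completeness): for a closed subspace `W` and finite `ρ`, `{z ∈ W | ∑ ⟨k⟩² ‖z k‖² ≤ ρ}` is
compact. [folklore] -/
theorem isCompact_eNormSq_one_le {W : Submodule ℝ (lp (fun _ : Fin 3 → ℤ => EuclideanSpace ℂ (Fin 3)) 2)} (hWc :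
    IsClosed (W : Set (lp (fun _ : Fin 3 → ℤ => EuclideanSpace ℂ (Fin 3)) 2))) {ρ : ℝ≥0∞} (hρ : ρ ≠ ∞) :
    IsCompact {z : W | Lattice.eNormSq 1 ((z : (lp (fun _ : Fin 3 → ℤ => EuclideanSpace ℂ (Fin 3)) 2)) : (Fin 3 → ℤ) →
        (EuclideanSpace ℂ (Fin 3))) ≤ ρ} := by
  haveI : CompleteSpace W := hWc.completeSpace_coe
  -- closedness: the weighted sum is a supremum of continuous finite sums
  have hclosed : IsClosed {z : W | Lattice.eNormSq 1 ((z : (lp (fun _ : Fin 3 → ℤ => EuclideanSpace ℂ (Fin 3)) 2)) :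
      (Fin 3 → ℤ) → (EuclideanSpace ℂ (Fin 3))) ≤ ρ} := by
    have hcont : ∀ k : (Fin 3 → ℤ), Continuous fun z : W =>
        ENNReal.ofReal (sobolevWeight 1 k ^ 2) * ‖((z : (lp (fun _ : Fin 3 → ℤ => EuclideanSpace ℂ (Fin 3)) 2)) : (Fin
            3 → ℤ) → (EuclideanSpace ℂ (Fin 3))) k‖ₑ ^ 2 := by
      intro k
      have e : (fun z : W => ENNReal.ofReal (sobolevWeight 1 k ^ 2) * ‖((z : (lp (fun _ : Fin 3 → ℤ => EuclideanSpace
          ℂ (Fin 3)) 2)) : (Fin 3 → ℤ) → (EuclideanSpace ℂ (Fin 3))) k‖ₑ ^ 2) =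
          fun z : W => ENNReal.ofReal (sobolevWeight 1 k ^ 2 * ‖((z : (lp (fun _ : Fin 3 → ℤ => EuclideanSpace ℂ (Fin
              3)) 2)) : (Fin 3 → ℤ) → (EuclideanSpace ℂ (Fin 3))) k‖ ^ 2) := by
        funext z
        rw [ENNReal.ofReal_mul (sq_nonneg _), ENNReal.ofReal_pow (norm_nonneg _), ofReal_norm]
      rw [e]
      exact ENNReal.continuous_ofReal.comp (continuous_const.mul
        (((l2_continuous_apply k).comp continuous_subtype_val).norm.pow 2))
    have e : {z : W | Lattice.eNormSq 1 ((z : (lp (fun _ : Fin 3 → ℤ => EuclideanSpace ℂ (Fin 3)) 2)) : (Fin 3 → ℤ) →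
        (EuclideanSpace ℂ (Fin 3))) ≤ ρ} =
        ⋂ F : Finset (Fin 3 → ℤ), {z : W | ∑ k ∈ F, ENNReal.ofReal (sobolevWeight 1 k ^ 2) *
          ‖((z : (lp (fun _ : Fin 3 → ℤ => EuclideanSpace ℂ (Fin 3)) 2)) : (Fin 3 → ℤ) → (EuclideanSpace ℂ (Fin 3)))
              k‖ₑ ^ 2 ≤ ρ} := by
      ext z
      simp only [Set.mem_setOf_eq, Set.mem_iInter, Lattice.eNormSq, ENNReal.tsum_eq_iSup_sum, iSup_le_iff]
    rw [e]
    exact isClosed_iInter fun F => isClosed_le (continuous_finsetSum F fun k _ => hcont k) continuous_const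
  -- sequential compactness by Rellich
  rw [isCompact_iff_isSeqCompact]
  intro z hz
  obtain ⟨φ, hφ, hC⟩ := Lattice.rellich (V := (EuclideanSpace ℂ (Fin 3))) (s := (0 : ℝ)) (t := 1) zero_lt_one hρ
    (u := fun n => ((z n : (lp (fun _ : Fin 3 → ℤ => EuclideanSpace ℂ (Fin 3)) 2)) : (Fin 3 → ℤ) → (EuclideanSpace ℂ
        (Fin 3)))) (fun n => hz n)
  -- the subsequence is Cauchy in `W`
  have hcau : CauchySeq (z ∘ φ) := by
    rw [Metric.cauchySeq_iff]
    intro ε hε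
    obtain ⟨N, hN⟩ := hC (ENNReal.ofReal (ε / 2) ^ 2) (by positivity)
    refine ⟨N, fun m hm n hn => ?_⟩
    have h := hN m n hm hn
    have hdist : ‖(z ∘ φ) m - (z ∘ φ) n‖ₑ ^ 2 ≤ ENNReal.ofReal (ε / 2) ^ 2 := by
      refine le_trans (le_of_eq ?_) h
      rw [Function.comp_apply, Function.comp_apply, ← enorm_coeW_sub, l2_enorm_sq_eq_tsum, Lattice.eNormSq]
      refine tsum_congr fun k => ?_
      rw [sobolevWeight_zero, one_pow, ENNReal.ofReal_one, one_mul]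
      rfl
    have h2 : ‖(z ∘ φ) m - (z ∘ φ) n‖ₑ ≤ ENNReal.ofReal (ε / 2) :=
      (ENNReal.pow_le_pow_left_iff two_ne_zero).1 hdist
    rw [← ofReal_norm, ENNReal.ofReal_le_ofReal_iff (by positivity)] at h2
    rw [dist_eq_norm]
    linarith
  obtain ⟨x, hx⟩ := cauchySeq_tendsto_of_complete hcau
  exact ⟨x, hclosed.mem_of_tendsto hx (Eventually.of_forall fun n => hz (φ n)), φ, hφ, hx⟩

end Compact


/-! ## §G Abstract functional analysis: compactness of `K`, the derivative of `G`, Fredholm, local inversion -/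

section Operator

variable {W : Submodule ℝ (lp (fun _ : Fin 3 → ℤ => EuclideanSpace ℂ (Fin 3)) 2)}

/-- **The linearised convective operator is compact**: for `x₀ ∈ W` with rapidly decaying physical
coefficients, `K w = B(x₀, w) + B(w, x₀)` maps the unit ball of `W` into an `H¹`-bounded, hence
compact, subset (`eNormSq_one_linearised_le`, `isCompact_eNormSq_one_le`). [folklore] -/
theorem isCompactOperator_linearised (hWc : IsClosed (W : Set (lp (fun _ : Fin 3 → ℤ => EuclideanSpace ℂ (Fin 3)) 2)))
    {B : W → W → W}
    (hB : ∀ x y : W, (((B x y : W) : (lp (fun _ : Fin 3 → ℤ => EuclideanSpace ℂ (Fin 3)) 2)) : (Fin 3 → ℤ) →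
        (EuclideanSpace ℂ (Fin 3))) = fun k =>
      Torus.lerayCoeff k ((WithLp.toLp 2 (fun pp : Fin 3 => transportSym (fun jj mm => (((fun mm : Fin 3 →
          ℤ => (((freqNormSq mm)⁻¹ : ℝ) : ℂ)) • (((x : (lp (fun _ : Fin 3 → ℤ => EuclideanSpace ℂ (Fin 3)) 2)) : (Fin
          3 → ℤ) → (EuclideanSpace ℂ (Fin 3))) : (Fin 3 → ℤ) → EuclideanSpace ℂ (Fin 3)))) mm jj) (fun mm => (((fun
          mm : Fin 3 → ℤ => (((freqNormSq mm)⁻¹ : ℝ) : ℂ)) • (((y : (lp (fun _ : Fin 3 → ℤ => EuclideanSpace ℂ (Fin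
          3)) 2)) : (Fin 3 → ℤ) → (EuclideanSpace ℂ (Fin 3))) : (Fin 3 → ℤ) → EuclideanSpace ℂ (Fin 3)))) mm pp) k) :
          EuclideanSpace ℂ (Fin 3))))
    (x₀ : W) (hx₀ : RapidDecay (((fun mm : Fin 3 → ℤ => (((freqNormSq mm)⁻¹ : ℝ) : ℂ)) • (((x₀ : (lp (fun _ : Fin 3 →
        ℤ => EuclideanSpace ℂ (Fin 3)) 2)) : (Fin 3 → ℤ) → (EuclideanSpace ℂ (Fin 3))) : (Fin 3 → ℤ) → EuclideanSpace
        ℂ (Fin 3))))) (K : W →L[ℝ] W)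
    (hK : ∀ w, K w = B x₀ w + B w x₀) : IsCompactOperator K := by
  set A : ℝ≥0∞ := ∑' m, (ENNReal.ofReal (sobolevWeight 1 m) * ENNReal.ofReal (sobolevWeight 1 m)) *
    ‖(((fun mm : Fin 3 → ℤ => (((freqNormSq mm)⁻¹ : ℝ) : ℂ)) • (((x₀ : (lp (fun _ : Fin 3 → ℤ => EuclideanSpace ℂ (Fin
        3)) 2)) : (Fin 3 → ℤ) → (EuclideanSpace ℂ (Fin 3))) : (Fin 3 → ℤ) → EuclideanSpace ℂ (Fin 3)))) m‖ₑ with hA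
  have hAtop : A ≠ ∞ := tsum_weight_sq_enorm_ne_top_of_rapidDecay hx₀
  set R : ℝ≥0∞ := 2 * ENNReal.ofReal (72 * Real.pi) * A with hR
  have hRtop : R ≠ ∞ := ENNReal.mul_ne_top (ENNReal.mul_ne_top (by simp) ENNReal.ofReal_ne_top) hAtop
  refine (isCompactOperator_iff_image_closedBall_subset_compact (K : W →ₗ[ℝ] W) zero_lt_one).2
    ⟨{z : W | Lattice.eNormSq 1 ((z : (lp (fun _ : Fin 3 → ℤ => EuclideanSpace ℂ (Fin 3)) 2)) : (Fin 3 → ℤ) →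
        (EuclideanSpace ℂ (Fin 3))) ≤ R ^ 2},
      isCompact_eNormSq_one_le hWc (ENNReal.pow_ne_top hRtop), ?_⟩
  rintro _ ⟨w, hw, rfl⟩
  rw [Metric.mem_closedBall, dist_zero_right] at hw
  change Lattice.eNormSq 1 (((K w : W) : (lp (fun _ : Fin 3 → ℤ => EuclideanSpace ℂ (Fin 3)) 2)) : (Fin 3 → ℤ) →
      (EuclideanSpace ℂ (Fin 3))) ≤ R ^ 2
  have hcoe : (((K w : W) : (lp (fun _ : Fin 3 → ℤ => EuclideanSpace ℂ (Fin 3)) 2)) : (Fin 3 → ℤ) → (EuclideanSpace ℂ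
      (Fin 3))) = fun k =>
      Torus.lerayCoeff k ((WithLp.toLp 2 (fun pp : Fin 3 => transportSym (fun jj mm => (((fun mm : Fin 3 →
          ℤ => (((freqNormSq mm)⁻¹ : ℝ) : ℂ)) • (((x₀ : (lp (fun _ : Fin 3 → ℤ => EuclideanSpace ℂ (Fin 3)) 2)) : (Fin
          3 → ℤ) → (EuclideanSpace ℂ (Fin 3))) : (Fin 3 → ℤ) → EuclideanSpace ℂ (Fin 3)))) mm jj) (fun mm => (((fun
          mm : Fin 3 → ℤ => (((freqNormSq mm)⁻¹ : ℝ) : ℂ)) • (((w : (lp (fun _ : Fin 3 → ℤ => EuclideanSpace ℂ (Fin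
          3)) 2)) : (Fin 3 → ℤ) → (EuclideanSpace ℂ (Fin 3))) : (Fin 3 → ℤ) → EuclideanSpace ℂ (Fin 3)))) mm pp) k) :
          EuclideanSpace ℂ (Fin 3))) +
      Torus.lerayCoeff k ((WithLp.toLp 2 (fun pp : Fin 3 => transportSym (fun jj mm => (((fun mm : Fin 3 →
          ℤ => (((freqNormSq mm)⁻¹ : ℝ) : ℂ)) • (((w : (lp (fun _ : Fin 3 → ℤ => EuclideanSpace ℂ (Fin 3)) 2)) : (Fin
          3 → ℤ) → (EuclideanSpace ℂ (Fin 3))) : (Fin 3 → ℤ) → EuclideanSpace ℂ (Fin 3)))) mm jj) (fun mm => (((fun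
          mm : Fin 3 → ℤ => (((freqNormSq mm)⁻¹ : ℝ) : ℂ)) • (((x₀ : (lp (fun _ : Fin 3 → ℤ => EuclideanSpace ℂ (Fin
          3)) 2)) : (Fin 3 → ℤ) → (EuclideanSpace ℂ (Fin 3))) : (Fin 3 → ℤ) → EuclideanSpace ℂ (Fin 3)))) mm pp) k) :
          EuclideanSpace ℂ (Fin 3))) := by
    rw [hK, coeW_add, hB, hB]; rfl
  rw [hcoe]
  refine (eNormSq_one_linearised_le _ _).trans ?_
  rw [← l2_enorm_sq_eq_tsum]
  have hw' : ‖(w : (lp (fun _ : Fin 3 → ℤ => EuclideanSpace ℂ (Fin 3)) 2))‖ₑ ≤ 1 := by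
    rw [← ofReal_norm, ← ENNReal.ofReal_one]
    exact ENNReal.ofReal_le_ofReal hw
  calc (2 * ENNReal.ofReal (72 * Real.pi) * A) ^ 2 * ‖(w : (lp (fun _ : Fin 3 → ℤ => EuclideanSpace ℂ (Fin 3)) 2))‖ₑ ^
      2 ≤ R ^ 2 * 1 ^ 2 :=
        mul_le_mul_right (pow_le_pow_left' hw' 2) _
    _ = R ^ 2 := by rw [one_pow, mul_one]

/-- **Strict derivative of the steady map** `G(x) = c x + B(x, x)`:
`DG(x₀) h = c h + B(x₀, h) + B(h, x₀)`. [folklore] -/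
theorem hasStrictFDerivAt_steadyMap {E : Type*} [NormedAddCommGroup E] [NormedSpace ℝ E]
    {B : E → E → E} (hBb : IsBoundedBilinearMap ℝ (fun p : E × E => B p.1 p.2)) (c : ℝ) (x₀ : E) :
    HasStrictFDerivAt (fun x : E => c • x + B x x)
      (c • ContinuousLinearMap.id ℝ E +
        (hBb.deriv (x₀, x₀)).comp ((ContinuousLinearMap.id ℝ E).prod (ContinuousLinearMap.id ℝ E))) x₀ := by
  have h1 : HasStrictFDerivAt (fun x : E => c • x) (c • ContinuousLinearMap.id ℝ E) x₀ :=
    (hasStrictFDerivAt_id x₀).const_smul c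
  have hd : HasStrictFDerivAt (fun x : E => (x, x))
      ((ContinuousLinearMap.id ℝ E).prod (ContinuousLinearMap.id ℝ E)) x₀ :=
    (hasStrictFDerivAt_id x₀).prodMk (hasStrictFDerivAt_id x₀)
  have h2 : HasStrictFDerivAt (fun x : E => B x x)
      ((hBb.deriv (x₀, x₀)).comp ((ContinuousLinearMap.id ℝ E).prod (ContinuousLinearMap.id ℝ E))) x₀ :=
    HasStrictFDerivAt.comp x₀ (g := fun p : E × E => B p.1 p.2) (f := fun x : E => (x, x))
      (hBb.hasStrictFDerivAt (x₀, x₀)) hd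
  exact h1.add h2

/-- The derivative of the steady map applied: `DG(x₀) h = c h + (B(x₀, h) + B(h, x₀))`. [folklore] -/
theorem steadyMap_deriv_apply {E : Type*} [NormedAddCommGroup E] [NormedSpace ℝ E]
    {B : E → E → E} (hBb : IsBoundedBilinearMap ℝ (fun p : E × E => B p.1 p.2)) (c : ℝ) (x₀ h : E) :
    (c • ContinuousLinearMap.id ℝ E +
        (hBb.deriv (x₀, x₀)).comp ((ContinuousLinearMap.id ℝ E).prod (ContinuousLinearMap.id ℝ E))) h =
      c • h + (B x₀ h + B h x₀) := by
  simp [IsBoundedBilinearMap.deriv_apply]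

/-- **Fredholm alternative, packaged**: on a real Banach space, `c·1 + K` with `K` compact,
`c ≠ 0`, and trivial kernel is a linear homeomorphism
(`IsCompactOperator.hasEigenvalue_or_mem_resolventSet` and the open mapping theorem). [folklore] -/
theorem exists_equiv_of_injective {E : Type*} [NormedAddCommGroup E] [NormedSpace ℝ E] [CompleteSpace E]
    {K : E →L[ℝ] E} (hK : IsCompactOperator K) {c : ℝ} (hc : c ≠ 0)
    (hinj : ∀ x, c • x + K x = 0 → x = 0) :
    ∃ L : E ≃L[ℝ] E, ∀ x, L x = c • x + K x := by
  set T : E →L[ℝ] E := (-c⁻¹) • K with hT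
  have hTc : IsCompactOperator T := hK.smul (-c⁻¹)
  have hT1 : ∀ x, x - T x = c⁻¹ • (c • x + K x) := fun x => by
    have : T x = -(c⁻¹ • K x) := by simp [hT]
    rw [this, sub_neg_eq_add, smul_add, smul_smul, inv_mul_cancel₀ hc, one_smul]
  rcases hTc.hasEigenvalue_or_mem_resolventSet one_ne_zero with h | h
  · exfalso
    obtain ⟨v, hv⟩ := h.exists_hasEigenvector
    have hv1 : (T : Module.End ℝ E) v = (1 : ℝ) • v := Module.End.mem_eigenspace_iff.1 hv.1
    rw [one_smul] at hv1
    have h0 : c • v + K v = 0 := by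
      have : v - T v = 0 := by rw [show T v = v from hv1, sub_self]
      rw [hT1] at this
      exact (smul_eq_zero.1 this).resolve_left (inv_ne_zero hc)
    exact hv.2 (hinj v h0)
  · rw [spectrum.mem_resolventSet_iff, ContinuousLinearMap.isUnit_iff_bijective] at h
    have hS : ∀ x, (algebraMap ℝ (E →L[ℝ] E) 1 - T) x = x - T x := fun x => by simp
    set L : E →L[ℝ] E := c • ContinuousLinearMap.id ℝ E + K with hL
    have hLx : ∀ x, L x = c • x + K x := fun x => by simp [hL]
    have hinjL : Function.Injective L := by
      intro x y hxy
      have : L (x - y) = 0 := by rw [map_sub, hxy, sub_self]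
      rw [hLx] at this
      exact sub_eq_zero.1 (hinj _ this)
    have hsurjL : Function.Surjective L := by
      intro y
      obtain ⟨x, hx⟩ := h.2 (c⁻¹ • y)
      refine ⟨x, ?_⟩
      rw [hS, hT1] at hx
      have := congrArg (fun z => c • z) hx
      simp only [smul_smul, mul_inv_cancel₀ hc, one_smul] at this
      rw [hLx]; exact this
    refine ⟨ContinuousLinearEquiv.ofBijective L (LinearMap.ker_eq_bot.2 hinjL)
      (LinearMap.range_eq_top.2 hsurjL), fun x => ?_⟩
    rw [ContinuousLinearEquiv.coeFn_ofBijective, hLx]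

/-- **Local solvability with continuity** (the inverse function theorem,
`HasStrictFDerivAt.localInverse`): if `G` has an invertible strict derivative at `x₀`, every `y`
close to `G x₀` is `G x` for some `x` close to `x₀`. [folklore] -/
theorem local_solve {E : Type*} [NormedAddCommGroup E] [NormedSpace ℝ E] [CompleteSpace E]
    {G : E → E} {L : E ≃L[ℝ] E} {x₀ : E} (hG : HasStrictFDerivAt G (L : E →L[ℝ] E) x₀)
    {δ : ℝ} (hδ : 0 < δ) : ∃ r : ℝ, 0 < r ∧ ∀ y, dist y (G x₀) < r → ∃ x, G x = y ∧ dist x x₀ < δ := by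
  have h1 := hG.eventually_right_inverse
  have h2 : ∀ᶠ y in 𝓝 (G x₀), dist (hG.localInverse G L x₀ y) x₀ < δ := by
    have hc := hG.localInverse_continuousAt
    have := Metric.tendsto_nhds.1 hc δ hδ
    simpa only [HasStrictFDerivAt.localInverse_apply_image] using this
  obtain ⟨r, hr, hball⟩ := Metric.eventually_nhds_iff.1 (h1.and h2)
  exact ⟨r, hr, fun y hy => ⟨hG.localInverse G L x₀ y, (hball hy).1, (hball hy).2⟩⟩

end Operator


/-! ## §H Fourier coefficients of the classical operators (the dictionary) -/

section Dictionary

/-- Coefficients of a real component: `𝓕(u_p)(m) = û(m)_p`. [folklore] -/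
theorem coeff_ofReal_apply {u : (UnitAddTorus (Fin 3)) → (EuclideanSpace ℝ (Fin 3))} (hu : IsSmooth u) (m : (Fin 3 →
    ℤ)) (p : Fin 3) :
    mFourierCoeff (fun y => ((u y p : ℝ) : ℂ)) m = (mFourierCoeff (complexify ∘ u) m) p :=
  (mFourierCoeff_complexify_apply hu.integrable m p).symm

/-- Coefficients of a complex component: `𝓕(w_p)(m) = ŵ(m)_p`. [folklore] -/
theorem coeff_apply_complex {w : (UnitAddTorus (Fin 3)) → (EuclideanSpace ℂ (Fin 3))} (hw : IsSmooth w) (m : (Fin 3 →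
    ℤ)) (p : Fin 3) :
    mFourierCoeff (fun y => w y p) m = (mFourierCoeff w m) p :=
  (mFourierCoeff_apply_euclidean hw.integrable m p).symm

/-- The component coefficients of a smooth real field are absolutely summable. [folklore] -/
theorem summable_norm_coeff_ofReal_apply {u : (UnitAddTorus (Fin 3)) → (EuclideanSpace ℝ (Fin 3))} (hu : IsSmooth u)
    (p : Fin 3) :
    Summable fun m => ‖mFourierCoeff (fun y => ((u y p : ℝ) : ℂ)) m‖ := by
  have h := (hu.complexify_comp.rapidDecay_mFourierCoeff).summable_norm
  refine Summable.of_nonneg_of_le (fun _ => norm_nonneg _) (fun m => ?_) h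
  rw [coeff_ofReal_apply hu]
  exact norm_apply_le_norm' _ p

/-- The component coefficients of a smooth complex field are absolutely summable. [folklore] -/
theorem summable_norm_coeff_apply {w : (UnitAddTorus (Fin 3)) → (EuclideanSpace ℂ (Fin 3))} (hw : IsSmooth w) (p : Fin
    3) :
    Summable fun m => ‖mFourierCoeff (fun y => w y p) m‖ := by
  have h := hw.rapidDecay_mFourierCoeff.summable_norm
  refine Summable.of_nonneg_of_le (fun _ => norm_nonneg _) (fun m => ?_) h
  rw [coeff_apply_complex hw]
  exact norm_apply_le_norm' _ p

/-- Complexification commutes with partial derivatives of a component. [folklore] -/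
theorem partialDeriv_ofReal_apply {v : (UnitAddTorus (Fin 3)) → (EuclideanSpace ℝ (Fin 3))} (hv : IsSmooth v) (j p :
    Fin 3) (y : (UnitAddTorus (Fin 3))) :
    Torus.partialDeriv j (fun z => ((v z p : ℝ) : ℂ)) y = ((Torus.partialDeriv j (fun z => v z p) y : ℝ) : ℂ) :=
  partialDeriv_clm_comp (hv.apply p) Complex.ofRealCLM j y

/-- Complexification commutes with partial derivatives of a real scalar. [folklore] -/
theorem partialDeriv_ofReal_scalar {θ : (UnitAddTorus (Fin 3)) → ℝ} (hθ : IsSmooth θ) (j : Fin 3) (y : (UnitAddTorus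
    (Fin 3))) :
    Torus.partialDeriv j (fun z => ((θ z : ℝ) : ℂ)) y = ((Torus.partialDeriv j θ y : ℝ) : ℂ) :=
  partialDeriv_clm_comp hθ Complex.ofRealCLM j y

/-- Components of partial derivatives of a real field. [folklore] -/
theorem partialDeriv_apply_real {v : (UnitAddTorus (Fin 3)) → (EuclideanSpace ℝ (Fin 3))} (hv : IsSmooth v) (j p : Fin
    3) (y : (UnitAddTorus (Fin 3))) :
    (Torus.partialDeriv j v y) p = Torus.partialDeriv j (fun z => v z p) y := by
  have h := partialDeriv_clm_comp hv (EuclideanSpace.proj p : (EuclideanSpace ℝ (Fin 3)) →L[ℝ] ℝ) j y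
  have e : ((EuclideanSpace.proj p : (EuclideanSpace ℝ (Fin 3)) →L[ℝ] ℝ) ∘ v) = fun z => v z p := by
    funext z; simp
  rw [e] at h
  simpa using h.symm

/-- Components of partial derivatives of a complex field. [folklore] -/
theorem partialDeriv_apply_complex {w : (UnitAddTorus (Fin 3)) → (EuclideanSpace ℂ (Fin 3))} (hw : IsSmooth w) (j p :
    Fin 3) (y : (UnitAddTorus (Fin 3))) :
    (Torus.partialDeriv j w y) p = Torus.partialDeriv j (fun z => w z p) y := by
  have h := partialDeriv_clm_comp hw ((EuclideanSpace.proj p : (EuclideanSpace ℂ (Fin 3)) →L[ℂ] ℂ).restrictScalars ℝ)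
      j y
  have e : (((EuclideanSpace.proj p : (EuclideanSpace ℂ (Fin 3)) →L[ℂ] ℂ).restrictScalars ℝ) ∘ w) = fun z => w z
      p := by
    funext z; simp
  rw [e] at h
  simpa using h.symm

/-- **Coefficients of the convective term of two real fields**:
`𝓕((u·∇)v)(k) = N(û, v̂)(k)`. [folklore] -/
theorem mFourierCoeff_convect_real {u v : (UnitAddTorus (Fin 3)) → (EuclideanSpace ℝ (Fin 3))} (hu : IsSmooth u) (hv :
    IsSmooth v) (k : (Fin 3 → ℤ)) :
    mFourierCoeff (complexify ∘ Torus.convect u v) k =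
      (WithLp.toLp 2 (fun pp : Fin 3 => transportSym (fun jj mm => (mFourierCoeff (complexify ∘ u)) mm jj) (fun
          mm => (mFourierCoeff (complexify ∘ v)) mm pp) k) : EuclideanSpace ℂ (Fin 3)) := by
  have hcs : IsSmooth (Torus.convect u v) := hu.convect hv
  ext p
  rw [mFourierCoeff_apply_euclidean hcs.complexify_comp.integrable, PiLp.toLp_apply, transportSym_apply]
  have hfun : (fun y => (complexify ∘ Torus.convect u v) y p) =
      fun y => ∑ j, (fun z => ((u z j : ℝ) : ℂ)) y * Torus.partialDeriv j (fun z => ((v z p : ℝ) : ℂ)) y := by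
    funext y
    simp only [Function.comp_apply, complexify_apply]
    rw [Torus.convect, fderiv_apply_eq_sum_partialDeriv (hv.isContDiff (by simp)) y (u y)]
    simp only [WithLp.ofLp_sum, WithLp.ofLp_smul, Finset.sum_apply, Pi.smul_apply, smul_eq_mul]
    push_cast
    refine Finset.sum_congr rfl fun j _ => ?_
    rw [partialDeriv_ofReal_apply hv j p y, partialDeriv_apply_real hv j p y]
  rw [hfun, mFourierCoeff_finset_sum
    (f := fun j y => (fun z => ((u z j : ℝ) : ℂ)) y * Torus.partialDeriv j (fun z => ((v z p : ℝ) : ℂ)) y) _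
    fun j _ => (((hu.apply j).ofReal).continuous.mul
      (((hv.apply p).ofReal).partialDeriv j).continuous).integrable_unitAddTorus]
  refine Finset.sum_congr rfl fun j _ => ?_
  rw [ScalarFourier.mFourierCoeff_mul ((hu.apply j).ofReal).continuous (summable_norm_coeff_ofReal_apply hu j)
    (((hv.apply p).ofReal).partialDeriv j).continuous]
  simp only [lconv_apply]
  refine tsum_congr fun m => ?_
  rw [coeff_ofReal_apply hu m j, mFourierCoeff_partialDeriv ((hv.apply p).ofReal) j (k - m),
    coeff_ofReal_apply hv (k - m) p, dsym_apply, smul_eq_mul]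

/-- **Coefficients of the convective term, complex transported field**:
`𝓕((u·∇)w)(k) = N(û, ŵ)(k)`. [folklore] -/
theorem mFourierCoeff_convect_complex {u : (UnitAddTorus (Fin 3)) → (EuclideanSpace ℝ (Fin 3))} {w : (UnitAddTorus
    (Fin 3)) → (EuclideanSpace ℂ (Fin 3))} (hu : IsSmooth u) (hw : IsSmooth w)
    (k : (Fin 3 → ℤ)) :
    mFourierCoeff (Torus.convect u w) k = (WithLp.toLp 2 (fun pp : Fin 3 => transportSym (fun jj mm => (mFourierCoeff
        (complexify ∘ u)) mm jj) (fun mm => (mFourierCoeff w) mm pp) k) : EuclideanSpace ℂ (Fin 3)) := by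
  have hcs : IsSmooth (Torus.convect u w) := hu.convect hw
  ext p
  rw [mFourierCoeff_apply_euclidean hcs.integrable, PiLp.toLp_apply, transportSym_apply]
  have hfun : (fun y => (Torus.convect u w) y p) =
      fun y => ∑ j, (fun z => ((u z j : ℝ) : ℂ)) y * Torus.partialDeriv j (fun z => w z p) y := by
    funext y
    rw [Torus.convect, fderiv_apply_eq_sum_partialDeriv (hw.isContDiff (by simp)) y (u y)]
    simp only [WithLp.ofLp_sum, WithLp.ofLp_smul, Finset.sum_apply, Pi.smul_apply, Complex.real_smul]
    refine Finset.sum_congr rfl fun j _ => ?_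
    rw [partialDeriv_apply_complex hw j p y]
  have hwp : IsSmooth (fun z => w z p) :=
    hw.comp_clm ((EuclideanSpace.proj p : (EuclideanSpace ℂ (Fin 3)) →L[ℂ] ℂ).restrictScalars ℝ)
  rw [hfun, mFourierCoeff_finset_sum
    (f := fun j y => (fun z => ((u z j : ℝ) : ℂ)) y * Torus.partialDeriv j (fun z => w z p) y) _
    fun j _ => (((hu.apply j).ofReal).continuous.mul (hwp.partialDeriv j).continuous).integrable_unitAddTorus]
  · refine Finset.sum_congr rfl fun j _ => ?_
    rw [ScalarFourier.mFourierCoeff_mul ((hu.apply j).ofReal).continuous (summable_norm_coeff_ofReal_apply hu j)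
      (hwp.partialDeriv j).continuous]
    simp only [lconv_apply]
    refine tsum_congr fun m => ?_
    rw [coeff_ofReal_apply hu m j, mFourierCoeff_partialDeriv hwp j (k - m), coeff_apply_complex hw (k - m) p,
      dsym_apply, smul_eq_mul]

/-- **Coefficients of the stretching term**: `𝓕((w·∇)u)(k) = N(ŵ, û)(k)`. [folklore] -/
theorem mFourierCoeff_stretch {u : (UnitAddTorus (Fin 3)) → (EuclideanSpace ℝ (Fin 3))} {w : (UnitAddTorus (Fin 3)) →
    (EuclideanSpace ℂ (Fin 3))} (hu : IsSmooth u) (hw : IsSmooth w) (k : (Fin 3 → ℤ)) :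
    mFourierCoeff (Torus.stretch w u) k = (WithLp.toLp 2 (fun pp : Fin 3 => transportSym (fun jj mm => (mFourierCoeff
        w) mm jj) (fun mm => (mFourierCoeff (complexify ∘ u)) mm pp) k) : EuclideanSpace ℂ (Fin 3)) := by
  -- the stretching term componentwise
  have hwp : ∀ p, IsSmooth (fun z => w z p) := fun p =>
    hw.comp_clm ((EuclideanSpace.proj p : (EuclideanSpace ℂ (Fin 3)) →L[ℂ] ℂ).restrictScalars ℝ)
  have hfun : ∀ p, (fun y => (Torus.stretch w u) y p) =
      fun y => ∑ j, (fun z => w z j) y * Torus.partialDeriv j (fun z => ((u z p : ℝ) : ℂ)) y := by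
    intro p
    funext y
    rw [Torus.stretch]
    simp only [WithLp.ofLp_sum, WithLp.ofLp_smul, Finset.sum_apply, Pi.smul_apply, smul_eq_mul,
      Torus.realToComplex_apply]
    refine Finset.sum_congr rfl fun j _ => ?_
    rw [partialDeriv_ofReal_apply hu j p y, partialDeriv_apply_real hu j p y]
  have hcont : ∀ p, Continuous fun y => (Torus.stretch w u) y p := fun p => by
    rw [hfun p]
    exact continuous_finsetSum _ fun j _ => (hwp j).continuous.mul (((hu.apply p).ofReal).partialDeriv j).continuous
  have hint : Integrable (Torus.stretch w u) volume := by
    refine Continuous.integrable_unitAddTorus ?_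
    rw [show Torus.stretch w u = fun y => WithLp.toLp 2 (fun p => Torus.stretch w u y p) from
      funext fun y => by ext p; rfl]
    exact (PiLp.continuous_toLp 2 _).comp (continuous_pi fun p => hcont p)
  ext p
  rw [mFourierCoeff_apply_euclidean hint, PiLp.toLp_apply, transportSym_apply, hfun p,
    mFourierCoeff_finset_sum
      (f := fun j y => (fun z => w z j) y * Torus.partialDeriv j (fun z => ((u z p : ℝ) : ℂ)) y) _
      fun j _ => ((hwp j).continuous.mul (((hu.apply p).ofReal).partialDeriv j).continuous).integrable_unitAddTorus]
  refine Finset.sum_congr rfl fun j _ => ?_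
  rw [ScalarFourier.mFourierCoeff_mul (hwp j).continuous (summable_norm_coeff_apply hw j)
    (((hu.apply p).ofReal).partialDeriv j).continuous]
  simp only [lconv_apply]
  refine tsum_congr fun m => ?_
  rw [coeff_apply_complex hw m j, mFourierCoeff_partialDeriv ((hu.apply p).ofReal) j (k - m),
    coeff_ofReal_apply hu (k - m) p, dsym_apply, smul_eq_mul]

/-- **Coefficients of a complexified real gradient**: `𝓕(∇θ)(k) = (2πi θ̂(k)) k`. [folklore] -/
theorem mFourierCoeff_gradient_real {θ : (UnitAddTorus (Fin 3)) → ℝ} (hθ : IsSmooth θ) (k : (Fin 3 → ℤ)) :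
    mFourierCoeff (complexify ∘ Torus.gradient θ) k =
      (2 * Real.pi * Complex.I * mFourierCoeff (fun y => ((θ y : ℝ) : ℂ)) k) • Torus.freqVec k := by
  have hg : IsSmooth (Torus.gradient θ) := hθ.gradient
  ext l
  rw [mFourierCoeff_apply_euclidean hg.complexify_comp.integrable, PiLp.smul_apply, Torus.freqVec_apply,
    smul_eq_mul]
  have hfun : (fun y => (complexify ∘ Torus.gradient θ) y l) = Torus.partialDeriv l (fun z => ((θ z : ℝ) : ℂ)) := by
    funext y
    simp only [Function.comp_apply, complexify_apply]
    rw [Torus.gradient_coord (hθ.isContDiff (by simp)) y l, partialDeriv_ofReal_scalar hθ l y]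
  rw [hfun, mFourierCoeff_partialDeriv hθ.ofReal l k, smul_eq_mul]
  ring

/-- **Coefficients of a complex gradient**: `𝓕(∇q)(k) = (2πi q̂(k)) k`. [folklore] -/
theorem mFourierCoeff_gradientC {q : (UnitAddTorus (Fin 3)) → ℂ} (hq : IsSmooth q) (k : (Fin 3 → ℤ)) :
    mFourierCoeff (Torus.gradientC q) k = (2 * Real.pi * Complex.I * mFourierCoeff q k) • Torus.freqVec k := by
  have hcont : ∀ l, Continuous fun y => Torus.gradientC q y l := fun l => by
    simp only [Torus.gradientC, PiLp.toLp_apply]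
    exact (hq.partialDeriv l).continuous
  have hint : Integrable (Torus.gradientC q) volume := by
    refine Continuous.integrable_unitAddTorus ?_
    exact (PiLp.continuous_toLp 2 _).comp (continuous_pi fun l => (hq.partialDeriv l).continuous)
  ext l
  rw [mFourierCoeff_apply_euclidean hint, PiLp.smul_apply, Torus.freqVec_apply, smul_eq_mul]
  simp only [Torus.gradientC, PiLp.toLp_apply]
  rw [show (fun y => Torus.partialDeriv l q y) = Torus.partialDeriv l q from rfl, mFourierCoeff_partialDeriv hq l k,
    smul_eq_mul]
  ring

/-- The zero Fourier mode of a mean-zero field vanishes. [folklore] -/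
theorem mFourierCoeff_zero_of_hasZeroMean {V : Type*} [NormedAddCommGroup V] [NormedSpace ℂ V]
    [CompleteSpace V] {g : (UnitAddTorus (Fin 3)) → V} (hg : HasZeroMean g) : mFourierCoeff g 0 = 0 := by
  rw [mFourierCoeff_eq_integral_volume]
  simp only [neg_zero, mFourier_zero, ContinuousMap.one_apply, one_smul]
  exact hg

/-- The zero mode of a complexified mean-zero real field vanishes. [folklore] -/
theorem mFourierCoeff_complexify_zero_of_hasZeroMean {u : (UnitAddTorus (Fin 3)) → (EuclideanSpace ℝ (Fin 3))} (hu :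
    IsSmooth u) (h0 : HasZeroMean u) :
    mFourierCoeff (complexify ∘ u) 0 = 0 := by
  refine mFourierCoeff_zero_of_hasZeroMean ?_
  unfold HasZeroMean at h0 ⊢
  rw [show (complexify ∘ u : (UnitAddTorus (Fin 3)) → (EuclideanSpace ℂ (Fin 3))) = fun x => (complexify :
      (EuclideanSpace ℝ (Fin 3)) →ₗᵢ[ℝ] (EuclideanSpace ℂ (Fin 3))).toContinuousLinearMap (u x)
    from rfl, ContinuousLinearMap.integral_comp_comm _ hu.integrable, h0, map_zero]

/-- A field whose zero mode vanishes has zero mean. [folklore] -/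
theorem hasZeroMean_of_mFourierCoeff_zero {V : Type*} [NormedAddCommGroup V] [NormedSpace ℂ V]
    [CompleteSpace V] {g : (UnitAddTorus (Fin 3)) → V} (hg : mFourierCoeff g 0 = 0) : HasZeroMean g := by
  rw [mFourierCoeff_eq_integral_volume] at hg
  simp only [neg_zero, mFourier_zero, ContinuousMap.one_apply, one_smul] at hg
  exact hg

/-- Rapid decay of a coefficient family gives all the weighted `ℓ¹` bounds `∑ ⟨k⟩^s ‖c k‖ < ∞`
(pattern from `SteadyNS.tsum_weight_mul_enorm_ne_top_of_isSmooth`). [folklore] -/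
theorem tsum_weight_mul_enorm_ne_top_of_rapidDecay {c : (Fin 3 → ℤ) → (EuclideanSpace ℂ (Fin 3))} (hc : RapidDecay c)
    (s : ℝ) :
    ∑' k, ENNReal.ofReal (sobolevWeight s k) * ‖c k‖ₑ ≠ ∞ := by
  obtain ⟨m, hm⟩ : ∃ m : ℕ, s / 2 ≤ m := exists_nat_ge (s / 2)
  have hR : Summable fun k => (1 + freqNormSq k) ^ m * ‖c k‖ := hc m
  have hle : ∀ k, ENNReal.ofReal (sobolevWeight s k) * ‖c k‖ₑ ≤
      ENNReal.ofReal ((1 + freqNormSq k) ^ m * ‖c k‖) := by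
    intro k
    rw [← ofReal_norm, ← ENNReal.ofReal_mul (sobolevWeight_pos s k).le]
    refine ENNReal.ofReal_le_ofReal (mul_le_mul_of_nonneg_right ?_ (norm_nonneg _))
    rw [sobolevWeight, ← Real.rpow_natCast]
    exact Real.rpow_le_rpow_of_exponent_le (by linarith [freqNormSq_nonneg k]) hm
  refine ne_top_of_le_ne_top ?_ (ENNReal.tsum_le_tsum hle)
  rw [← ENNReal.ofReal_tsum_of_nonneg (fun k => mul_nonneg (one_add_freqNormSq_pow_nonneg k m) (norm_nonneg _)) hR]
  exact ENNReal.ofReal_ne_top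

/-- **The synthesis of a conjugate-symmetric family is real**: `conj F_c(y) = F_c(y)`. [folklore] -/
theorem conjVec_fourierSynth {c : (Fin 3 → ℤ) → (EuclideanSpace ℂ (Fin 3))} (hc : RapidDecay c) (hcs : IsConjSymm c)
    (y : (UnitAddTorus (Fin 3))) :
    conjVec (fourierSynth c y) = fourierSynth c y := by
  rw [fourierSynth, ← conjVecL_apply, ContinuousLinearMap.map_tsum _ (hc.hasSum_fourierSynth y).summable]
  simp only [conjVecL_apply]
  have h : ∀ m, conjVec (mFourier m y • c m) = mFourier (-m) y • c (-m) := fun m => by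
    rw [conjVec_smul, hcs m, mFourier_neg]
  simp_rw [h]
  exact (Equiv.neg (Fin 3 → ℤ)).tsum_eq (fun m => mFourier m y • c m)

/-- **Real velocity from coefficients**: for a rapidly decaying conjugate-symmetric family `c`,
`u = Re F_c` is a smooth real field with `𝓕(complexify ∘ u) = c`. [folklore] -/
theorem realSynth_spec {c : (Fin 3 → ℤ) → (EuclideanSpace ℂ (Fin 3))} (hc : RapidDecay c) (hcs : IsConjSymm c) :
    IsSmooth (fun y => EuclideanSpace.realPart (fourierSynth c y)) ∧
      (complexify ∘ fun y => EuclideanSpace.realPart (fourierSynth c y)) = fourierSynth c ∧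
      mFourierCoeff (complexify ∘ fun y => EuclideanSpace.realPart (fourierSynth c y)) = c := by
  have hs : IsSmooth (fourierSynth c) := hc.isSmooth_fourierSynth
  have he : (complexify ∘ fun y => EuclideanSpace.realPart (fourierSynth c y)) = fourierSynth c := by
    funext y
    exact complexify_realPart (conjVec_fourierSynth hc hcs y)
  refine ⟨hs.comp_clm (G := (EuclideanSpace ℝ (Fin 3))) EuclideanSpace.realPart, he, ?_⟩
  rw [he]
  funext m
  exact hc.mFourierCoeff_fourierSynth m

end Dictionary


/-! ## §I Elliptic regularity on the lattice: `H²` solutions are rapidly decaying -/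

section Regularity

/-- `⟨k⟩₂ ‖(cf x) k‖ ≤ 2 ‖x k‖` with `⟨k⟩₂ = 1 + |k|²`. [folklore] -/
theorem weight_two_mul_enorm_cf_le (x : (Fin 3 → ℤ) → (EuclideanSpace ℂ (Fin 3))) (k : (Fin 3 → ℤ)) :
    ENNReal.ofReal (sobolevWeight 2 k) * ‖(((fun mm : Fin 3 → ℤ => (((freqNormSq mm)⁻¹ : ℝ) : ℂ)) • (x : (Fin 3 → ℤ) →
        EuclideanSpace ℂ (Fin 3)))) k‖ₑ ≤ 2 * ‖x k‖ₑ := by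
  by_cases hk : k = 0
  · subst hk; rw [cf_zero, enorm_zero, mul_zero]; exact bot_le
  · have h : sobolevWeight 2 k * ‖(((fun mm : Fin 3 → ℤ => (((freqNormSq mm)⁻¹ : ℝ) : ℂ)) • (x : (Fin 3 → ℤ) →
      EuclideanSpace ℂ (Fin 3)))) k‖ ≤ 2 * ‖x k‖ := by
      rw [norm_cf, ← mul_assoc, SteadyNS.sobolevWeight_two]
      refine mul_le_mul_of_nonneg_right ?_ (norm_nonneg _)
      have hf : 0 < freqNormSq k := lt_of_lt_of_le one_pos (one_le_freqNormSq' hk)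
      rw [mul_inv_le_iff₀ hf]
      linarith [one_le_freqNormSq' hk]
    have h' := ENNReal.ofReal_le_ofReal h
    rw [ENNReal.ofReal_mul (sobolevWeight_pos 2 k).le, ofReal_norm, ENNReal.ofReal_mul (by norm_num),
      ofReal_norm, ENNReal.ofReal_ofNat] at h'
    exact h'

/-- The `H¹`-type finiteness `∑ ⟨k⟩₂ ‖(cf x) k‖² < ∞` for `x ∈ ℓ²`. [folklore] -/
theorem tsum_weight_two_mul_enorm_cf_sq_ne_top (x : (lp (fun _ : Fin 3 → ℤ => EuclideanSpace ℂ (Fin 3)) 2)) :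
    ∑' k, ENNReal.ofReal (sobolevWeight 2 k) * ‖(((fun mm : Fin 3 → ℤ => (((freqNormSq mm)⁻¹ : ℝ) : ℂ)) • ((x : (Fin 3
        → ℤ) → (EuclideanSpace ℂ (Fin 3))) : (Fin 3 → ℤ) → EuclideanSpace ℂ (Fin 3)))) k‖ₑ ^ (2 : ℝ) ≠ ∞ := by
  have h2 : (2 : ℝ≥0∞) * ∑' k, ‖(x : (Fin 3 → ℤ) → (EuclideanSpace ℂ (Fin 3))) k‖ₑ ^ 2 ≠ ∞ :=
    ENNReal.mul_ne_top (by simp) (l2_tsum_enorm_sq_ne_top x)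
  refine ne_top_of_le_ne_top h2 ?_
  rw [← ENNReal.tsum_mul_left]
  refine ENNReal.tsum_le_tsum fun k => ?_
  rw [ENNReal.rpow_two, sq, ← mul_assoc]
  calc ENNReal.ofReal (sobolevWeight 2 k) * ‖(((fun mm : Fin 3 → ℤ => (((freqNormSq mm)⁻¹ : ℝ) : ℂ)) • ((x : (Fin 3 →
      ℤ) → (EuclideanSpace ℂ (Fin 3))) : (Fin 3 → ℤ) → EuclideanSpace ℂ (Fin 3)))) k‖ₑ * ‖(((fun mm : Fin 3 →
      ℤ => (((freqNormSq mm)⁻¹ : ℝ) : ℂ)) • ((x : (Fin 3 → ℤ) → (EuclideanSpace ℂ (Fin 3))) : (Fin 3 → ℤ) →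
      EuclideanSpace ℂ (Fin 3)))) k‖ₑ
      ≤ (2 * ‖(x : (Fin 3 → ℤ) → (EuclideanSpace ℂ (Fin 3))) k‖ₑ) * ‖(x : (Fin 3 → ℤ) → (EuclideanSpace ℂ (Fin 3)))
          k‖ₑ := by
        refine mul_le_mul' (weight_two_mul_enorm_cf_le _ k) ?_
        rw [← ofReal_norm, ← ofReal_norm]
        exact ENNReal.ofReal_le_ofReal (norm_cf_le _ k)
    _ = 2 * ‖(x : (Fin 3 → ℤ) → (EuclideanSpace ℂ (Fin 3))) k‖ₑ ^ 2 := by ring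

/-- `cf x` is transversal when `x` is. [folklore] -/
theorem cf_transversal {x : (Fin 3 → ℤ) → (EuclideanSpace ℂ (Fin 3))} (hxt : ∀ k : (Fin 3 → ℤ), (∑ jj : Fin 3, ((k
    jj : ℤ) : ℂ) * (x k) jj) = 0) (m : (Fin 3 → ℤ)) : (∑ jj : Fin 3, ((m jj : ℤ) : ℂ) * ((((fun mm : Fin 3 →
    ℤ => (((freqNormSq mm)⁻¹ : ℝ) : ℂ)) • (x : (Fin 3 → ℤ) → EuclideanSpace ℂ (Fin 3)))) m) jj) = 0 := by
  rw [cf_apply, kdot_smul, hxt m, mul_zero]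

/-- From `c x = F - v` with `c > 0`: `‖x‖ ≤ c⁻¹ (‖F‖ + ‖v‖)`, in `ℝ≥0∞`. [folklore] -/
theorem enorm_le_of_smul_add_eq {c : ℝ} (hc : 0 < c) {X V F : (EuclideanSpace ℂ (Fin 3))} (h : ((c : ℝ) : ℂ) • X + V =
    F) :
    ‖X‖ₑ ≤ ENNReal.ofReal c⁻¹ * (‖F‖ₑ + ‖V‖ₑ) := by
  have hX : X = ((c⁻¹ : ℝ) : ℂ) • (F - V) := by
    rw [← eq_sub_of_add_eq h, smul_smul, ← Complex.ofReal_mul, inv_mul_cancel₀ hc.ne', Complex.ofReal_one, one_smul]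
  rw [hX, enorm_smul, ← ofReal_norm ((c⁻¹ : ℝ) : ℂ), Complex.norm_real, Real.norm_of_nonneg (inv_nonneg.2 hc.le)]
  exact mul_le_mul_right (enorm_sub_le) _

/-- **Regularity of `H²` solutions of the steady lattice equation**
(`SteadyNS.tsum_weight_mul_ne_top`): if `x ∈ ℓ²` is transversal with `x 0 = 0` and solves
`4π²ν x(k) + Π_k N(x̌, x̌)(k) = F(k)` with `F` rapidly decaying, then `x̌ = cf x` decays rapidly. [folklore] -/
theorem rapidDecay_of_steady_eq {ν : ℝ} (hν : 0 < ν) (x : (lp (fun _ : Fin 3 → ℤ => EuclideanSpace ℂ (Fin 3)) 2))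
    (hxt : ∀ k : (Fin 3 → ℤ), (∑ jj : Fin 3, ((k jj : ℤ) : ℂ) * ((x : (Fin 3 → ℤ) → (EuclideanSpace ℂ (Fin 3))) k) jj)
        = 0) {F : (Fin 3 → ℤ) → (EuclideanSpace ℂ (Fin 3))}
    (hF : ∀ s : ℝ, ∑' k, ENNReal.ofReal (sobolevWeight s k) * ‖F k‖ₑ ≠ ∞)
    (heq : ∀ k : (Fin 3 → ℤ), (((4 * Real.pi ^ 2 * ν : ℝ)) : ℂ) • (x : (Fin 3 → ℤ) → (EuclideanSpace ℂ (Fin 3))) k +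
      Torus.lerayCoeff k ((WithLp.toLp 2 (fun pp : Fin 3 => transportSym (fun jj mm => (((fun mm : Fin 3 →
          ℤ => (((freqNormSq mm)⁻¹ : ℝ) : ℂ)) • ((x : (Fin 3 → ℤ) → (EuclideanSpace ℂ (Fin 3))) : (Fin 3 → ℤ) →
          EuclideanSpace ℂ (Fin 3)))) mm jj) (fun mm => (((fun mm : Fin 3 → ℤ => (((freqNormSq mm)⁻¹ : ℝ) : ℂ)) •
          ((x : (Fin 3 → ℤ) → (EuclideanSpace ℂ (Fin 3))) : (Fin 3 → ℤ) → EuclideanSpace ℂ (Fin 3)))) mm pp) k) :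
          EuclideanSpace ℂ (Fin 3))) = F k) :
    RapidDecay (((fun mm : Fin 3 → ℤ => (((freqNormSq mm)⁻¹ : ℝ) : ℂ)) • ((x : (Fin 3 → ℤ) → (EuclideanSpace ℂ (Fin
        3))) : (Fin 3 → ℤ) → EuclideanSpace ℂ (Fin 3)))) := by
  set A : (Fin 3 → ℤ) → ℝ≥0∞ := fun k => ‖(((fun mm : Fin 3 → ℤ => (((freqNormSq mm)⁻¹ : ℝ) : ℂ)) • ((x : (Fin 3 → ℤ)
      → (EuclideanSpace ℂ (Fin 3))) : (Fin 3 → ℤ) → EuclideanSpace ℂ (Fin 3)))) k‖ₑ with hA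
  have hc : 0 < 4 * Real.pi ^ 2 * ν := by positivity
  have hconv : ∀ k, ‖Torus.lerayCoeff k ((WithLp.toLp 2 (fun pp : Fin 3 => transportSym (fun jj mm => (((fun mm : Fin
      3 → ℤ => (((freqNormSq mm)⁻¹ : ℝ) : ℂ)) • ((x : (Fin 3 → ℤ) → (EuclideanSpace ℂ (Fin 3))) : (Fin 3 → ℤ) →
      EuclideanSpace ℂ (Fin 3)))) mm jj) (fun mm => (((fun mm : Fin 3 → ℤ => (((freqNormSq mm)⁻¹ : ℝ) : ℂ)) • ((x :
      (Fin 3 → ℤ) → (EuclideanSpace ℂ (Fin 3))) : (Fin 3 → ℤ) → EuclideanSpace ℂ (Fin 3)))) mm pp) k) : EuclideanSpace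
      ℂ (Fin 3)))‖ₑ ≤
      ENNReal.ofReal (18 * Real.pi) * ENNReal.ofReal (sobolevWeight 1 k) * ∑' l, A (k - l) * A l := by
    intro k
    refine (enorm_lerayCoeff_le k _).trans ((enorm_nl_le_of_transversal _ _ k (cf_transversal hxt)
      (fun j p => summable_nl_cf x x k j p)).trans (le_of_eq ?_))
    congr 1
    exact tsum_congr fun l => mul_comm _ _
  -- the coefficient inequality
  set C : ℝ≥0∞ := ENNReal.ofReal (2 * (4 * Real.pi ^ 2 * ν)⁻¹ * (18 * Real.pi)) with hC
  have hCeq : C = 2 * (ENNReal.ofReal (4 * Real.pi ^ 2 * ν)⁻¹ * ENNReal.ofReal (18 * Real.pi)) := by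
    rw [hC, mul_assoc, ENNReal.ofReal_mul (p := 2) (by norm_num), ENNReal.ofReal_ofNat,
      ENNReal.ofReal_mul (p := (4 * Real.pi ^ 2 * ν)⁻¹) (by positivity)]
  have hineq : ∀ k, ENNReal.ofReal (sobolevWeight 2 k) * A k ≤
      C * (‖F k‖ₑ + ENNReal.ofReal (sobolevWeight 1 k) * ∑' l, A (k - l) * A l) := by
    intro k
    have h1 := weight_two_mul_enorm_cf_le (x : (Fin 3 → ℤ) → (EuclideanSpace ℂ (Fin 3))) k
    have h2 := enorm_le_of_smul_add_eq hc (heq k)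
    have h18 : (1 : ℝ≥0∞) ≤ ENNReal.ofReal (18 * Real.pi) :=
      ENNReal.one_le_ofReal.2 (by nlinarith [Real.pi_gt_three])
    calc ENNReal.ofReal (sobolevWeight 2 k) * A k ≤ 2 * ‖(x : (Fin 3 → ℤ) → (EuclideanSpace ℂ (Fin 3))) k‖ₑ := h1
      _ ≤ 2 * (ENNReal.ofReal (4 * Real.pi ^ 2 * ν)⁻¹ * (‖F k‖ₑ +
          ‖Torus.lerayCoeff k ((WithLp.toLp 2 (fun pp : Fin 3 => transportSym (fun jj mm => (((fun mm : Fin 3 →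
              ℤ => (((freqNormSq mm)⁻¹ : ℝ) : ℂ)) • ((x : (Fin 3 → ℤ) → (EuclideanSpace ℂ (Fin 3))) : (Fin 3 → ℤ) →
              EuclideanSpace ℂ (Fin 3)))) mm jj) (fun mm => (((fun mm : Fin 3 → ℤ => (((freqNormSq mm)⁻¹ : ℝ) : ℂ)) •
              ((x : (Fin 3 → ℤ) → (EuclideanSpace ℂ (Fin 3))) : (Fin 3 → ℤ) → EuclideanSpace ℂ (Fin 3)))) mm pp) k) :
              EuclideanSpace ℂ (Fin 3)))‖ₑ)) := mul_le_mul_right h2 _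
      _ ≤ 2 * (ENNReal.ofReal (4 * Real.pi ^ 2 * ν)⁻¹ * (ENNReal.ofReal (18 * Real.pi) * ‖F k‖ₑ +
          ENNReal.ofReal (18 * Real.pi) * ENNReal.ofReal (sobolevWeight 1 k) * ∑' l, A (k - l) * A l)) := by
          gcongr
          · calc ‖F k‖ₑ = 1 * ‖F k‖ₑ := (one_mul _).symm
              _ ≤ ENNReal.ofReal (18 * Real.pi) * ‖F k‖ₑ := mul_le_mul_left h18 _
          · exact hconv k
      _ = C * (‖F k‖ₑ + ENNReal.ofReal (sobolevWeight 1 k) * ∑' l, A (k - l) * A l) := by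
          rw [hCeq]
          ring
  have hCtop : C ≠ ∞ := ENNReal.ofReal_ne_top
  have hfin := SteadyNS.tsum_weight_mul_ne_top (A := A) (F := fun k => ‖F k‖ₑ) hCtop hF hineq
    (by simp) (tsum_weight_two_mul_enorm_cf_sq_ne_top x)
  exact SteadyNS.rapidDecay_of_tsum_weight_mul_enorm_ne_top hfin

/-- A rapidly decaying family is weighted-bounded: `⟨l⟩ ‖a l‖ ≤ ∑ (1+|m|²) ‖a m‖`. [folklore] -/
theorem weight_mul_norm_le_of_rapidDecay {a : (Fin 3 → ℤ) → (EuclideanSpace ℂ (Fin 3))} (ha : RapidDecay a) (l : (Fin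
    3 → ℤ)) :
    sobolevWeight 1 l * ‖a l‖ ≤ ∑' m, (1 + freqNormSq m) ^ 1 * ‖a m‖ := by
  have hs : Summable fun m => (1 + freqNormSq m) ^ 1 * ‖a m‖ := ha 1
  have h1 : sobolevWeight 1 l * ‖a l‖ ≤ (1 + freqNormSq l) ^ 1 * ‖a l‖ := by
    refine mul_le_mul_of_nonneg_right ?_ (norm_nonneg _)
    rw [pow_one]
    have hw := Torus.one_le_sobolevWeight zero_le_one l
    have hsq := SteadyNS.sobolevWeight_one_sq l
    nlinarith
  exact h1.trans (hs.le_tsum l fun m _ => mul_nonneg (one_add_freqNormSq_pow_nonneg m 1) (norm_nonneg _))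

/-- **Regularity of `H²` kernel vectors of the linearised lattice operator**: for rapidly decaying
transversal `a` and `x ∈ ℓ²` transversal solving `4π²ν x(k) + Π_k (N(a, x̌) + N(x̌, a))(k) = 0`,
the family `x̌ = cf x` decays rapidly (bootstrap applied to `‖a‖ + ‖x̌‖`). [folklore] -/
theorem rapidDecay_of_linearised_eq {ν : ℝ} (hν : 0 < ν) {a : (Fin 3 → ℤ) → (EuclideanSpace ℂ (Fin 3))} (ha :
    RapidDecay a)
    (hat : ∀ m : (Fin 3 → ℤ), (∑ jj : Fin 3, ((m jj : ℤ) : ℂ) * (a m) jj) = 0) (x : (lp (fun _ : Fin 3 →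
        ℤ => EuclideanSpace ℂ (Fin 3)) 2)) (hxt : ∀ k : (Fin 3 → ℤ), (∑ jj : Fin 3, ((k jj : ℤ) : ℂ) * ((x : (Fin 3 →
        ℤ) → (EuclideanSpace ℂ (Fin 3))) k) jj) = 0)
    (heq : ∀ k : (Fin 3 → ℤ), (((4 * Real.pi ^ 2 * ν : ℝ)) : ℂ) • (x : (Fin 3 → ℤ) → (EuclideanSpace ℂ (Fin 3))) k +
      Torus.lerayCoeff k ((WithLp.toLp 2 (fun pp : Fin 3 => transportSym (fun jj mm => a mm jj) (fun mm => (((fun mm :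
          Fin 3 → ℤ => (((freqNormSq mm)⁻¹ : ℝ) : ℂ)) • ((x : (Fin 3 → ℤ) → (EuclideanSpace ℂ (Fin 3))) : (Fin 3 → ℤ)
          → EuclideanSpace ℂ (Fin 3)))) mm pp) k) : EuclideanSpace ℂ (Fin 3)) + (WithLp.toLp 2 (fun pp : Fin
          3 => transportSym (fun jj mm => (((fun mm : Fin 3 → ℤ => (((freqNormSq mm)⁻¹ : ℝ) : ℂ)) • ((x : (Fin 3 → ℤ)
          → (EuclideanSpace ℂ (Fin 3))) : (Fin 3 → ℤ) → EuclideanSpace ℂ (Fin 3)))) mm jj) (fun mm => a mm pp) k) :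
          EuclideanSpace ℂ (Fin 3))) = 0) :
    RapidDecay (((fun mm : Fin 3 → ℤ => (((freqNormSq mm)⁻¹ : ℝ) : ℂ)) • ((x : (Fin 3 → ℤ) → (EuclideanSpace ℂ (Fin
        3))) : (Fin 3 → ℤ) → EuclideanSpace ℂ (Fin 3)))) := by
  set A : (Fin 3 → ℤ) → ℝ≥0∞ := fun k => ‖a k‖ₑ + ‖(((fun mm : Fin 3 → ℤ => (((freqNormSq mm)⁻¹ : ℝ) : ℂ)) • ((x :
      (Fin 3 → ℤ) → (EuclideanSpace ℂ (Fin 3))) : (Fin 3 → ℤ) → EuclideanSpace ℂ (Fin 3)))) k‖ₑ with hA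
  have hc : 0 < 4 * Real.pi ^ 2 * ν := by positivity
  -- summabilities of the two symbols
  have hsa : Summable fun m => ‖a m‖ := ha.summable_norm
  have hs1 : ∀ k j p, Summable fun m => a m j * (dsym j (k - m) * (((fun mm : Fin 3 → ℤ => (((freqNormSq mm)⁻¹ : ℝ) :
      ℂ)) • ((x : (Fin 3 → ℤ) → (EuclideanSpace ℂ (Fin 3))) : (Fin 3 → ℤ) → EuclideanSpace ℂ (Fin 3)))) (k - m) p) :=
    fun k j p => summable_nl_term hsa (weight_mul_norm_cf_le_norm x) k j p
  have hs2 : ∀ k j p, Summable fun m => (((fun mm : Fin 3 → ℤ => (((freqNormSq mm)⁻¹ : ℝ) : ℂ)) • ((x : (Fin 3 → ℤ) →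
      (EuclideanSpace ℂ (Fin 3))) : (Fin 3 → ℤ) → EuclideanSpace ℂ (Fin 3)))) m j * (dsym j (k - m) * a (k - m) p) :=
    fun k j p => summable_nl_term (summable_norm_cf x) (weight_mul_norm_le_of_rapidDecay ha) k j p
  -- the convolution bound
  have hconv : ∀ k, ‖Torus.lerayCoeff k ((WithLp.toLp 2 (fun pp : Fin 3 => transportSym (fun jj mm => a mm jj) (fun
      mm => (((fun mm : Fin 3 → ℤ => (((freqNormSq mm)⁻¹ : ℝ) : ℂ)) • ((x : (Fin 3 → ℤ) → (EuclideanSpace ℂ (Fin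
      3))) : (Fin 3 → ℤ) → EuclideanSpace ℂ (Fin 3)))) mm pp) k) : EuclideanSpace ℂ (Fin 3)) + (WithLp.toLp 2 (fun
      pp : Fin 3 => transportSym (fun jj mm => (((fun mm : Fin 3 → ℤ => (((freqNormSq mm)⁻¹ : ℝ) : ℂ)) • ((x : (Fin 3
      → ℤ) → (EuclideanSpace ℂ (Fin 3))) : (Fin 3 → ℤ) → EuclideanSpace ℂ (Fin 3)))) mm jj) (fun mm => a mm pp) k) :
      EuclideanSpace ℂ (Fin 3)))‖ₑ ≤
      2 * (ENNReal.ofReal (18 * Real.pi) * ENNReal.ofReal (sobolevWeight 1 k) * ∑' l, A (k - l) * A l) := by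
    intro k
    refine (enorm_lerayCoeff_le k _).trans ((enorm_add_le _ _).trans ?_)
    rw [two_mul]
    refine add_le_add ?_ ?_
    · refine (enorm_nl_le_of_transversal _ _ k hat (hs1 k)).trans ?_
      refine mul_le_mul_right ?_ _
      calc ∑' m, ‖a m‖ₑ * ‖(((fun mm : Fin 3 → ℤ => (((freqNormSq mm)⁻¹ : ℝ) : ℂ)) • ((x : (Fin 3 → ℤ) →
          (EuclideanSpace ℂ (Fin 3))) : (Fin 3 → ℤ) → EuclideanSpace ℂ (Fin 3)))) (k - m)‖ₑ ≤ ∑' m, A m * A (k - m) :=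
            ENNReal.tsum_le_tsum fun m => mul_le_mul' le_self_add le_add_self
        _ = ∑' l, A (k - l) * A l := tsum_congr fun l => mul_comm _ _
    · refine (enorm_nl_le_of_transversal _ _ k (cf_transversal hxt) (hs2 k)).trans ?_
      refine mul_le_mul_right ?_ _
      calc ∑' m, ‖(((fun mm : Fin 3 → ℤ => (((freqNormSq mm)⁻¹ : ℝ) : ℂ)) • ((x : (Fin 3 → ℤ) → (EuclideanSpace ℂ (Fin
          3))) : (Fin 3 → ℤ) → EuclideanSpace ℂ (Fin 3)))) m‖ₑ * ‖a (k - m)‖ₑ ≤ ∑' m, A m * A (k - m) :=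
            ENNReal.tsum_le_tsum fun m => mul_le_mul' le_add_self le_self_add
        _ = ∑' l, A (k - l) * A l := tsum_congr fun l => mul_comm _ _
  -- the rapidly decaying forcing `F k = ⟨k⟩₂ ‖a k‖`
  set C : ℝ≥0∞ := ENNReal.ofReal (1 + 2 * (4 * Real.pi ^ 2 * ν)⁻¹ * (2 * (18 * Real.pi))) with hC
  have hineq : ∀ k, ENNReal.ofReal (sobolevWeight 2 k) * A k ≤
      C * (ENNReal.ofReal (sobolevWeight 2 k) * ‖a k‖ₑ +
        ENNReal.ofReal (sobolevWeight 1 k) * ∑' l, A (k - l) * A l) := by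
    intro k
    have h1 := weight_two_mul_enorm_cf_le (x : (Fin 3 → ℤ) → (EuclideanSpace ℂ (Fin 3))) k
    have h2 := enorm_le_of_smul_add_eq hc (heq k)
    rw [enorm_zero, zero_add] at h2
    have hC1 : (1 : ℝ≥0∞) ≤ C := ENNReal.one_le_ofReal.2 (by
      have : (0:ℝ) ≤ 2 * (4 * Real.pi ^ 2 * ν)⁻¹ * (2 * (18 * Real.pi)) := by positivity
      linarith)
    have hC2 : 2 * (ENNReal.ofReal (4 * Real.pi ^ 2 * ν)⁻¹ * (2 * ENNReal.ofReal (18 * Real.pi))) ≤ C := by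
      have e : ENNReal.ofReal (2 * (4 * Real.pi ^ 2 * ν)⁻¹ * (2 * (18 * Real.pi))) =
          2 * (ENNReal.ofReal (4 * Real.pi ^ 2 * ν)⁻¹ * (2 * ENNReal.ofReal (18 * Real.pi))) := by
        rw [ENNReal.ofReal_mul (p := 2 * (4 * Real.pi ^ 2 * ν)⁻¹) (by positivity),
          ENNReal.ofReal_mul (p := 2) (by norm_num), ENNReal.ofReal_mul (p := 2) (by norm_num),
          ENNReal.ofReal_ofNat]
        ring
      rw [← e, hC]
      exact ENNReal.ofReal_le_ofReal (by linarith)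
    calc ENNReal.ofReal (sobolevWeight 2 k) * A k
        = ENNReal.ofReal (sobolevWeight 2 k) * ‖a k‖ₑ +
            ENNReal.ofReal (sobolevWeight 2 k) * ‖(((fun mm : Fin 3 → ℤ => (((freqNormSq mm)⁻¹ : ℝ) : ℂ)) • ((x : (Fin
                3 → ℤ) → (EuclideanSpace ℂ (Fin 3))) : (Fin 3 → ℤ) → EuclideanSpace ℂ (Fin 3))))
                k‖ₑ := by rw [hA]; ring
      _ ≤ ENNReal.ofReal (sobolevWeight 2 k) * ‖a k‖ₑ + 2 * ‖(x : (Fin 3 → ℤ) → (EuclideanSpace ℂ (Fin 3))) k‖ₑ :=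
          add_le_add le_rfl h1
      _ ≤ ENNReal.ofReal (sobolevWeight 2 k) * ‖a k‖ₑ + 2 * (ENNReal.ofReal (4 * Real.pi ^ 2 * ν)⁻¹ *
            (2 * (ENNReal.ofReal (18 * Real.pi) * ENNReal.ofReal (sobolevWeight 1 k) * ∑' l, A (k - l) * A l))) :=
          add_le_add le_rfl (mul_le_mul_right (h2.trans (mul_le_mul_right (hconv k) _)) _)
      _ = 1 * (ENNReal.ofReal (sobolevWeight 2 k) * ‖a k‖ₑ) +
            (2 * (ENNReal.ofReal (4 * Real.pi ^ 2 * ν)⁻¹ * (2 * ENNReal.ofReal (18 * Real.pi)))) *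
            (ENNReal.ofReal (sobolevWeight 1 k) * ∑' l, A (k - l) * A l) := by ring
      _ ≤ C * (ENNReal.ofReal (sobolevWeight 2 k) * ‖a k‖ₑ) +
            C * (ENNReal.ofReal (sobolevWeight 1 k) * ∑' l, A (k - l) * A l) :=
          add_le_add (mul_le_mul_left hC1 _) (mul_le_mul_left hC2 _)
      _ = C * (ENNReal.ofReal (sobolevWeight 2 k) * ‖a k‖ₑ +
            ENNReal.ofReal (sobolevWeight 1 k) * ∑' l, A (k - l) * A l) := by ring
  have hF : ∀ s : ℝ, ∑' k, ENNReal.ofReal (sobolevWeight s k) * (ENNReal.ofReal (sobolevWeight 2 k) * ‖a k‖ₑ) ≠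
      ∞ := by
    intro s
    have h := tsum_weight_mul_enorm_ne_top_of_rapidDecay ha (s + 2)
    refine fun htop => h ?_
    rw [← htop]
    refine tsum_congr fun k => ?_
    rw [← mul_assoc, SteadyNS.ofReal_sobolevWeight_mul]
  -- the `H¹` bound for `A`
  have hA2 : ∑' k, ENNReal.ofReal (sobolevWeight 2 k) * A k ^ (2 : ℝ) ≠ ∞ := by
    have hSa : ∑' m, ‖a m‖ₑ ≠ ∞ := by
      have := tsum_weight_mul_enorm_ne_top_of_rapidDecay ha 0
      simpa only [sobolevWeight_zero, ENNReal.ofReal_one, one_mul] using this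
    have hWa : ∑' k, ENNReal.ofReal (sobolevWeight 2 k) * ‖a k‖ₑ ≠ ∞ :=
      tsum_weight_mul_enorm_ne_top_of_rapidDecay ha 2
    have hle : ∀ k, ENNReal.ofReal (sobolevWeight 2 k) * A k ^ (2 : ℝ) ≤
        2 * ((∑' m, ‖a m‖ₑ) * (ENNReal.ofReal (sobolevWeight 2 k) * ‖a k‖ₑ)) +
        2 * (ENNReal.ofReal (sobolevWeight 2 k) * ‖(((fun mm : Fin 3 → ℤ => (((freqNormSq mm)⁻¹ : ℝ) : ℂ)) • ((x :
            (Fin 3 → ℤ) → (EuclideanSpace ℂ (Fin 3))) : (Fin 3 → ℤ) → EuclideanSpace ℂ (Fin 3)))) k‖ₑ ^ (2 : ℝ)) := by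
      intro k
      rw [ENNReal.rpow_two, ENNReal.rpow_two]
      have hak : ‖a k‖ₑ ≤ ∑' m, ‖a m‖ₑ := ENNReal.le_tsum k
      calc ENNReal.ofReal (sobolevWeight 2 k) * A k ^ 2
          ≤ ENNReal.ofReal (sobolevWeight 2 k) * (2 * ‖a k‖ₑ ^ 2 + 2 * ‖(((fun mm : Fin 3 → ℤ => (((freqNormSq mm)⁻¹ :
              ℝ) : ℂ)) • ((x : (Fin 3 → ℤ) → (EuclideanSpace ℂ (Fin 3))) : (Fin 3 → ℤ) → EuclideanSpace ℂ (Fin 3))))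
              k‖ₑ ^ 2) :=
            mul_le_mul_right (Lattice.ennreal_add_pow_two_le _ _) _
        _ = 2 * (‖a k‖ₑ * (ENNReal.ofReal (sobolevWeight 2 k) * ‖a k‖ₑ)) +
            2 * (ENNReal.ofReal (sobolevWeight 2 k) * ‖(((fun mm : Fin 3 → ℤ => (((freqNormSq mm)⁻¹ : ℝ) : ℂ)) • ((x :
                (Fin 3 → ℤ) → (EuclideanSpace ℂ (Fin 3))) : (Fin 3 → ℤ) → EuclideanSpace ℂ (Fin 3)))) k‖ₑ ^
                2) := by ring
        _ ≤ _ := add_le_add (mul_le_mul_right (mul_le_mul_left hak _) _) le_rfl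
    refine ne_top_of_le_ne_top ?_ (ENNReal.tsum_le_tsum hle)
    rw [ENNReal.tsum_add, ENNReal.tsum_mul_left, ENNReal.tsum_mul_left, ENNReal.tsum_mul_left]
    exact ENNReal.add_ne_top.2 ⟨ENNReal.mul_ne_top (by simp) (ENNReal.mul_ne_top hSa hWa),
      ENNReal.mul_ne_top (by simp) (tsum_weight_two_mul_enorm_cf_sq_ne_top x)⟩
  have hCtop : C ≠ ∞ := ENNReal.ofReal_ne_top
  have hfin := SteadyNS.tsum_weight_mul_ne_top (A := A)
    (F := fun k => ENNReal.ofReal (sobolevWeight 2 k) * ‖a k‖ₑ) hCtop hF hineq (by simp) hA2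
  refine SteadyNS.rapidDecay_of_tsum_weight_mul_enorm_ne_top fun m => ?_
  exact ne_top_of_le_ne_top (hfin m) (ENNReal.tsum_le_tsum fun k => mul_le_mul_right le_add_self _)

end Regularity


/-! ## §K Classical steady states and eigenvectors versus their Fourier equations -/

section Classical

/-- Complex multiples of complexified vectors. [folklore] -/
theorem coe_smul_complexify (a : ℝ) (V : (EuclideanSpace ℝ (Fin 3))) : (a : ℂ) • complexify V = complexify (a •
    V) := by
  ext i
  simp only [PiLp.smul_apply, complexify_apply, smul_eq_mul, Complex.ofReal_mul]

/-- `Π_k 0 = 0`. [folklore] -/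
theorem lerayCoeff_zero_vec (k : (Fin 3 → ℤ)) : Torus.lerayCoeff k (0 : (EuclideanSpace ℂ (Fin 3))) = 0 := by
  by_cases hk : k = 0
  · subst hk; exact Torus.lerayCoeff_zero 0
  · rw [Torus.lerayCoeff_of_ne_zero hk, Torus.leraySym_zero]

/-- `Π_k` respects differences. [folklore] -/
theorem lerayCoeff_sub' (k : (Fin 3 → ℤ)) (v w : (EuclideanSpace ℂ (Fin 3))) :
    Torus.lerayCoeff k (v - w) = Torus.lerayCoeff k v - Torus.lerayCoeff k w := by
  by_cases hk : k = 0
  · subst hk; simp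
  · rw [Torus.lerayCoeff_of_ne_zero hk, Torus.lerayCoeff_of_ne_zero hk, Torus.lerayCoeff_of_ne_zero hk,
      Torus.leraySym_sub]

/-- `Π_k` kills the frequency vector `k`. [folklore] -/
theorem lerayCoeff_freqVec (k : (Fin 3 → ℤ)) : Torus.lerayCoeff k (Torus.freqVec k) = 0 := by
  by_cases hk0 : k = 0
  · subst hk0; exact Torus.lerayCoeff_zero _
  · rw [Torus.lerayCoeff_of_ne_zero hk0, Torus.leraySym_def]
    have hq : ((freqNormSq k : ℝ) : ℂ) ≠ 0 := by
      exact_mod_cast (ne_of_gt (lt_of_lt_of_le one_pos (one_le_freqNormSq' hk0)))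
    have hs : (∑ i, ((k i : ℤ) : ℂ) * Torus.freqVec k i) = ((freqNormSq k : ℝ) : ℂ) := by
      simp only [Torus.freqVec_apply, freqNormSq]
      push_cast
      exact Finset.sum_congr rfl fun i _ => by ring
    rw [hs, div_self hq, one_smul, sub_self]

/-- `Π_k` fixes transversal vectors. [folklore] -/
theorem lerayCoeff_of_kdot_eq_zero {k : (Fin 3 → ℤ)} (hk : k ≠ 0) {v : (EuclideanSpace ℂ (Fin 3))} (hv : (∑ jj : Fin
    3, ((k jj : ℤ) : ℂ) * v jj) = 0) : Torus.lerayCoeff k v = v := by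
  rw [Torus.lerayCoeff_of_ne_zero hk, Torus.leraySym_of_transversal hv]

/-- For `k ≠ 0`: `v − Π_k v = ((k·v)/|k|²) k`. [folklore] -/
theorem sub_lerayCoeff {k : (Fin 3 → ℤ)} (hk : k ≠ 0) (v : (EuclideanSpace ℂ (Fin 3))) :
    v - Torus.lerayCoeff k v = ((∑ jj : Fin 3, ((k jj : ℤ) : ℂ) * v jj) / ((freqNormSq k : ℝ) : ℂ)) • Torus.freqVec
        k := by
  rw [Torus.lerayCoeff_of_ne_zero hk, Torus.leraySym_def, sub_sub_cancel]

/-- `kdot` respects differences in the vector. [folklore] -/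
theorem kdot_sub' (k : (Fin 3 → ℤ)) (v w : (EuclideanSpace ℂ (Fin 3))) : (∑ jj : Fin 3, ((k jj : ℤ) : ℂ) * (v - w) jj)
    = (∑ jj : Fin 3, ((k jj : ℤ) : ℂ) * v jj) - (∑ jj : Fin 3, ((k jj : ℤ) : ℂ) * w jj) := by
  simp only [PiLp.sub_apply, mul_sub, Finset.sum_sub_distrib]

/-- The complex gradient of a complexified real scalar is the complexified gradient. [folklore] -/
theorem gradientC_ofReal {θ : (UnitAddTorus (Fin 3)) → ℝ} (hθ : IsSmooth θ) (y : (UnitAddTorus (Fin 3))) :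
    Torus.gradientC (fun z => ((θ z : ℝ) : ℂ)) y = complexify (Torus.gradient θ y) := by
  ext l
  rw [Torus.gradientC, PiLp.toLp_apply, complexify_apply, Torus.gradient_coord (hθ.isContDiff (by simp)) y l,
    partialDeriv_ofReal_scalar hθ l y]

/-- **Fourier coefficients of the steady residual** with a complex pressure `P`:
`𝓕(complexify ((u·∇)u) − ν complexify (Δu) + ∇P − complexify f)(k)
  = N(û,û)(k) + ν 4π²|k|² û(k) + (2πi P̂(k)) k − f̂(k)`. [folklore] -/
theorem mFourierCoeff_steadyResidual {ν : ℝ} {u f : (UnitAddTorus (Fin 3)) → (EuclideanSpace ℝ (Fin 3))} {P :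
    (UnitAddTorus (Fin 3)) → ℂ} (hu : IsSmooth u) (hf : IsSmooth f)
    (hP : IsSmooth P) (k : (Fin 3 → ℤ)) :
    mFourierCoeff (fun y => complexify (Torus.convect u u y) - (ν : ℂ) • complexify (laplacian u y) +
        Torus.gradientC P y - complexify (f y)) k =
      (WithLp.toLp 2 (fun pp : Fin 3 => transportSym (fun jj mm => (mFourierCoeff (complexify ∘ u)) mm jj) (fun
          mm => (mFourierCoeff (complexify ∘ u)) mm pp) k) : EuclideanSpace ℂ (Fin 3)) +
        (((ν * (4 * Real.pi ^ 2 * freqNormSq k)) : ℝ) : ℂ) • mFourierCoeff (complexify ∘ u) k +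
        (2 * Real.pi * Complex.I * mFourierCoeff P k) • Torus.freqVec k - mFourierCoeff (complexify ∘ f) k := by
  -- the four smooth pieces
  have h1 : IsSmooth (complexify ∘ Torus.convect u u) := (hu.convect hu).complexify_comp
  have h2 : IsSmooth (complexify ∘ laplacian u) := hu.laplacian.complexify_comp
  have h3 : Continuous (Torus.gradientC P) :=
    (PiLp.continuous_toLp 2 _).comp (continuous_pi fun l => (hP.partialDeriv l).continuous)
  have h4 : IsSmooth (complexify ∘ f) := hf.complexify_comp
  have i1 := h1.integrable
  have i2 : Integrable ((ν : ℂ) • (complexify ∘ laplacian u)) volume := h2.integrable.smul (ν : ℂ)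
  have i3 := h3.integrable_unitAddTorus
  have i4 := h4.integrable
  have hfun : (fun y => complexify (Torus.convect u u y) - (ν : ℂ) • complexify (laplacian u y) +
      Torus.gradientC P y - complexify (f y)) =
      (complexify ∘ Torus.convect u u) - (ν : ℂ) • (complexify ∘ laplacian u) + Torus.gradientC P - complexify
          ∘ f := by
    funext y; simp
  rw [hfun, mFourierCoeff_sub ((i1.sub i2).add i3) i4, mFourierCoeff_add (i1.sub i2) i3, mFourierCoeff_sub i1 i2,
    mFourierCoeff_const_smul, mFourierCoeff_convect_real hu hu k, mFourierCoeff_complexify_laplacian hu k,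
    mFourierCoeff_gradientC hP k]
  simp only [smul_neg, sub_neg_eq_add, smul_smul]
  congr 2
  push_cast
  ring_nf

/-- **A classical steady state solves the projected steady equations on the lattice** (the
Leray multiplier kills the pressure and fixes the transversal coefficients):
`ν4π²|k|² û(k) + Π_k N(û,û)(k) = Π_k f̂(k)`. [folklore] -/
theorem fourier_eq_of_isSteadyNSState {ν : ℝ} {f u : (UnitAddTorus (Fin 3)) → (EuclideanSpace ℝ (Fin 3))} {p :
    (UnitAddTorus (Fin 3)) → ℝ} (h : Torus.IsSteadyNSState ν f u p)
    (hf : IsSmooth f) (h0 : HasZeroMean u) (k : (Fin 3 → ℤ)) :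
    (((ν * (4 * Real.pi ^ 2 * freqNormSq k)) : ℝ) : ℂ) • mFourierCoeff (complexify ∘ u) k +
      Torus.lerayCoeff k ((WithLp.toLp 2 (fun pp : Fin 3 => transportSym (fun jj mm => (mFourierCoeff (complexify
          ∘ u)) mm jj) (fun mm => (mFourierCoeff (complexify ∘ u)) mm pp) k) : EuclideanSpace ℂ (Fin 3))) =
      Torus.lerayCoeff k (mFourierCoeff (complexify ∘ f) k) := by
  have hu : IsSmooth u := h.smooth_velocity.isSmooth_slice (Set.mem_univ 0)
  have hp : IsSmooth p := h.smooth_pressure.isSmooth_slice (Set.mem_univ 0)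
  have hdiv : IsDivFree u := h.divFree 0 (Set.mem_univ 0)
  -- the residual vanishes identically
  have hres : (fun y => complexify (Torus.convect u u y) - (ν : ℂ) • complexify (laplacian u y) +
      Torus.gradientC (fun z => ((p z : ℝ) : ℂ)) y - complexify (f y)) = 0 := by
    funext y
    have hm := h.momentum 0 (Set.mem_univ 0) y
    have ht : Torus.timeDerivWithin Set.univ (fun _ : ℝ => u) 0 y = 0 := by simp [Torus.timeDerivWithin]
    simp only [ht, zero_add] at hm
    rw [gradientC_ofReal hp, Pi.zero_apply, coe_smul_complexify, hm, ← map_sub, ← map_add, ← map_sub,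
      show ν • laplacian u y - Torus.gradient p y + f y - ν • laplacian u y + Torus.gradient p y - f y = 0 by abel,
      map_zero]
  have hk := mFourierCoeff_steadyResidual (ν := ν) (P := fun z => ((p z : ℝ) : ℂ)) hu hf hp.ofReal k
  rw [hres] at hk
  have hzero : mFourierCoeff (0 : (UnitAddTorus (Fin 3)) → (EuclideanSpace ℂ (Fin 3))) k = 0 := by
    rw [show (0 : (UnitAddTorus (Fin 3)) → (EuclideanSpace ℂ (Fin 3))) = (0 : ℂ) • (0 : (UnitAddTorus (Fin 3)) →
        (EuclideanSpace ℂ (Fin 3))) by simp, mFourierCoeff_const_smul, zero_smul]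
  rw [hzero] at hk
  -- apply the Leray multiplier
  by_cases hk0 : k = 0
  · subst hk0
    simp [Torus.lerayCoeff_zero, freqNormSq_zero, mFourierCoeff_complexify_zero_of_hasZeroMean hu h0]
  · have htr : (∑ jj : Fin 3, ((k jj : ℤ) : ℂ) * (mFourierCoeff (complexify ∘ u) k) jj) = 0 :=
      hdiv.sum_mul_mFourierCoeff_eq_zero hu k
    have e1 := lerayCoeff_of_kdot_eq_zero hk0 htr
    -- `Π (N + c•û + q•kvec − f̂) = 0`
    have h' := congrArg (Torus.lerayCoeff k) hk
    rw [lerayCoeff_zero_vec, lerayCoeff_sub', lerayCoeff_add', lerayCoeff_add', lerayCoeff_smul', lerayCoeff_smul',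
      e1, lerayCoeff_freqVec, smul_zero, add_zero] at h'
    rw [add_comm]
    exact sub_eq_zero.1 h'.symm


/-- Summability of the symbol's terms for two rapidly decaying families. [folklore] -/
theorem summable_nl_rapid {a b : (Fin 3 → ℤ) → (EuclideanSpace ℂ (Fin 3))} (ha : RapidDecay a) (hb : RapidDecay b)
    (k : (Fin 3 → ℤ)) (j p : Fin 3) :
    Summable fun m => a m j * (dsym j (k - m) * b (k - m) p) :=
  summable_nl_term ha.summable_norm (weight_mul_norm_le_of_rapidDecay hb) k j p

/-- Rapid decay of the pressure symbol `(k · g(k)) / (2πi |k|²)` built from a rapidly decaying `g`. [folklore] -/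
theorem rapidDecay_pressureSymbol {g : (Fin 3 → ℤ) → (EuclideanSpace ℂ (Fin 3))} (hg : RapidDecay g) :
    RapidDecay (fun k : (Fin 3 → ℤ) => (∑ jj : Fin 3, ((k jj : ℤ) : ℂ) * (g k) jj) / (2 * Real.pi * Complex.I *
        ((freqNormSq k : ℝ) : ℂ))) := by
  intro m
  have hs := hg m
  refine Summable.of_nonneg_of_le (fun k => mul_nonneg (one_add_freqNormSq_pow_nonneg k m) (norm_nonneg _))
    (fun k => ?_) (hs.mul_left 3)
  dsimp only
  have hb : ‖(∑ jj : Fin 3, ((k jj : ℤ) : ℂ) * (g k) jj) / (2 * Real.pi * Complex.I * ((freqNormSq k : ℝ) : ℂ))‖ ≤ 3 *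
      ‖g k‖ := by
    by_cases hk : k = 0
    · subst hk
      simp only [freqNormSq_zero, Complex.ofReal_zero, mul_zero, div_zero, norm_zero]
      positivity
    · have hf : 0 < freqNormSq k := lt_of_lt_of_le one_pos (one_le_freqNormSq' hk)
      rw [norm_div]
      have hden : ‖(2 * Real.pi * Complex.I * ((freqNormSq k : ℝ) : ℂ) : ℂ)‖ = 2 * Real.pi * freqNormSq k := by
        simp [abs_of_pos Real.pi_pos, abs_of_nonneg (freqNormSq_nonneg k)]
      rw [hden, div_le_iff₀ (by positivity)]
      calc ‖(∑ jj : Fin 3, ((k jj : ℤ) : ℂ) * (g k) jj)‖ ≤ 3 * sobolevWeight 1 k * ‖g k‖ := norm_kdot_le k (g k)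
        _ ≤ 3 * (2 * freqNormSq k) * ‖g k‖ :=
            mul_le_mul_of_nonneg_right (mul_le_mul_of_nonneg_left (sobolevWeight_one_le hk) (by norm_num))
                (norm_nonneg _)
        _ ≤ 3 * ‖g k‖ * (2 * Real.pi * freqNormSq k) := by
            have : (0:ℝ) ≤ ‖g k‖ * freqNormSq k := mul_nonneg (norm_nonneg _) hf.le
            nlinarith [Real.pi_gt_three]
  calc (1 + freqNormSq k) ^ m * ‖(∑ jj : Fin 3, ((k jj : ℤ) : ℂ) * (g k) jj) / (2 * Real.pi * Complex.I * ((freqNormSq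
      k : ℝ) : ℂ))‖
      ≤ (1 + freqNormSq k) ^ m * (3 * ‖g k‖) := mul_le_mul_of_nonneg_left hb (one_add_freqNormSq_pow_nonneg k m)
    _ = 3 * ((1 + freqNormSq k) ^ m * ‖g k‖) := by ring

set_option maxHeartbeats 800000 in
/-- **From a rapidly decaying solution of the projected lattice equations to a classical mean-zero
steady state** (Fourier synthesis; the pressure symbol cancels the gradient part of the residual;
realness from conjugate symmetry). [folklore] -/
theorem steadyState_of_fourier {ν : ℝ} {f : (UnitAddTorus (Fin 3)) → (EuclideanSpace ℝ (Fin 3))} (hf : IsSmooth f)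
    (hfd : IsDivFree f) (hf0 : HasZeroMean f)
    {c : (Fin 3 → ℤ) → (EuclideanSpace ℂ (Fin 3))} (hc : RapidDecay c) (hcs : IsConjSymm c) (hct : ∀ k : (Fin 3 → ℤ),
        (∑ jj : Fin 3, ((k jj : ℤ) : ℂ) * (c k) jj) = 0) (hc0 : c 0 = 0)
    (heq : ∀ k : (Fin 3 → ℤ), (((ν * (4 * Real.pi ^ 2 * freqNormSq k)) : ℝ) : ℂ) • c k + Torus.lerayCoeff k
        ((WithLp.toLp 2 (fun pp : Fin 3 => transportSym (fun jj mm => c mm jj) (fun mm => c mm pp) k) : EuclideanSpace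
        ℂ (Fin 3))) =
      mFourierCoeff (complexify ∘ f) k) :
    ∃ (u : (UnitAddTorus (Fin 3)) → (EuclideanSpace ℝ (Fin 3))) (p : (UnitAddTorus (Fin 3)) → ℝ),
        Torus.IsSteadyNSState ν f u p ∧ HasZeroMean u ∧ IsSmooth u ∧
      mFourierCoeff (complexify ∘ u) = c := by
  obtain ⟨hu, hcu, hû⟩ := realSynth_spec hc hcs
  set u : (UnitAddTorus (Fin 3)) → (EuclideanSpace ℝ (Fin 3)) := fun y => EuclideanSpace.realPart (fourierSynth c
      y) with hudef
  -- the convective symbol is the coefficient family of a smooth field, hence rapidly decaying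
  have hN : ∀ k, mFourierCoeff (complexify ∘ Torus.convect u u) k = (WithLp.toLp 2 (fun pp : Fin 3 => transportSym
      (fun jj mm => c mm jj) (fun mm => c mm pp) k) : EuclideanSpace ℂ (Fin 3)) := fun k => by
    rw [mFourierCoeff_convect_real hu hu k, hû]
  have hNr : RapidDecay (fun k => (WithLp.toLp 2 (fun pp : Fin 3 => transportSym (fun jj mm => c mm jj) (fun mm => c
      mm pp) k) : EuclideanSpace ℂ (Fin 3))) := by
    have h := ((hu.convect hu).complexify_comp).rapidDecay_mFourierCoeff
    have e : mFourierCoeff (complexify ∘ Torus.convect u u) = fun k => (WithLp.toLp 2 (fun pp : Fin 3 => transportSym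
        (fun jj mm => c mm jj) (fun mm => c mm pp) k) : EuclideanSpace ℂ (Fin 3)) := funext hN
    rwa [e] at h
  set F : (Fin 3 → ℤ) → (EuclideanSpace ℂ (Fin 3)) := mFourierCoeff (complexify ∘ f) with hF
  have hFr : RapidDecay F := hf.complexify_comp.rapidDecay_mFourierCoeff
  have hFt : ∀ k : (Fin 3 → ℤ), (∑ jj : Fin 3, ((k jj : ℤ) : ℂ) * (F k) jj) = 0 :=
      fun k => hfd.sum_mul_mFourierCoeff_eq_zero hf k
  have hF0 : F 0 = 0 := mFourierCoeff_complexify_zero_of_hasZeroMean hf hf0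
  -- the pressure
  set ph : (Fin 3 → ℤ) → ℂ := fun k => (∑ jj : Fin 3, ((k jj : ℤ) : ℂ) * (F k - (WithLp.toLp 2 (fun pp : Fin
      3 => transportSym (fun jj mm => c mm jj) (fun mm => c mm pp) k) : EuclideanSpace ℂ (Fin 3))) jj) / (2 * Real.pi
      * Complex.I * ((freqNormSq k : ℝ) : ℂ)) with hph
  have hphr : RapidDecay ph := by
    have hg : RapidDecay (fun k => F k - (WithLp.toLp 2 (fun pp : Fin 3 => transportSym (fun jj mm => c mm jj) (fun
        mm => c mm pp) k) : EuclideanSpace ℂ (Fin 3))) := by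
      have := hFr.add (hNr.const_smul (-1))
      convert this using 1
      funext k; simp [sub_eq_add_neg]
    exact rapidDecay_pressureSymbol hg
  set P : (UnitAddTorus (Fin 3)) → ℂ := fourierSynth ph with hP
  have hPs : IsSmooth P := hphr.isSmooth_fourierSynth
  have hPc : ∀ k, mFourierCoeff P k = ph k := hphr.mFourierCoeff_fourierSynth
  set p : (UnitAddTorus (Fin 3)) → ℝ := fun y => (P y).re with hp
  have hps : IsSmooth p := hPs.comp_clm (G := ℝ) Complex.reCLM
  -- the complex residual vanishes
  have hEc : Continuous (fun y => complexify (Torus.convect u u y) - (ν : ℂ) • complexify (laplacian u y) +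
      Torus.gradientC P y - complexify (f y)) := by
    have c1 : Continuous fun y => complexify (Torus.convect u u y) := ((hu.convect hu).complexify_comp).continuous
    have c2 : Continuous fun y => complexify (laplacian u y) := (hu.laplacian.complexify_comp).continuous
    have c3 : Continuous fun y => Torus.gradientC P y :=
      (PiLp.continuous_toLp 2 _).comp (continuous_pi fun l => (hPs.partialDeriv l).continuous)
    have c4 : Continuous fun y => complexify (f y) := hf.complexify_comp.continuous
    exact ((c1.sub (c2.const_smul (ν : ℂ))).add c3).sub c4
  set E : (UnitAddTorus (Fin 3)) → (EuclideanSpace ℂ (Fin 3)) := fun y => complexify (Torus.convect u u y) - (ν : ℂ) •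
      complexify (laplacian u y) +
    Torus.gradientC P y - complexify (f y) with hE
  have hEcoeff : ∀ k, mFourierCoeff E k = 0 := by
    intro k
    rw [hE, mFourierCoeff_steadyResidual hu hf hPs k, hû, hPc k]
    by_cases hk : k = 0
    · subst hk
      have hn0 : (WithLp.toLp 2 (fun pp : Fin 3 => transportSym (fun jj mm => c mm jj) (fun mm => c mm pp) 0) :
          EuclideanSpace ℂ (Fin 3)) = 0 := nl_zero_of_transversal c c hct (fun j p => summable_nl_rapid hc hc 0 j p)
      rw [hn0, freqNormSq_zero, Torus.freqVec_zero, smul_zero]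
      simp [hF0, ← hF]
    · have h1 := heq k
      rw [← hF]
      have hq : ((freqNormSq k : ℝ) : ℂ) ≠ 0 := by
        exact_mod_cast (ne_of_gt (lt_of_lt_of_le one_pos (one_le_freqNormSq' hk)))
      have hI : (2 * Real.pi * Complex.I : ℂ) ≠ 0 :=
        mul_ne_zero (mul_ne_zero two_ne_zero (by exact_mod_cast Real.pi_ne_zero)) Complex.I_ne_zero
      have hsplit := sub_lerayCoeff hk ((WithLp.toLp 2 (fun pp : Fin 3 => transportSym (fun jj mm => c mm jj) (fun
          mm => c mm pp) k) : EuclideanSpace ℂ (Fin 3)))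
      have hcoef : 2 * Real.pi * Complex.I * ph k = -((∑ jj : Fin 3, ((k jj : ℤ) : ℂ) * ((WithLp.toLp 2 (fun pp : Fin
          3 => transportSym (fun jj mm => c mm jj) (fun mm => c mm pp) k) : EuclideanSpace ℂ (Fin 3))) jj) /
          ((freqNormSq k : ℝ) : ℂ)) := by
        have e : ph k = ((∑ jj : Fin 3, ((k jj : ℤ) : ℂ) * (F k) jj) - (∑ jj : Fin 3, ((k jj : ℤ) : ℂ) * ((WithLp.toLp
            2 (fun pp : Fin 3 => transportSym (fun jj mm => c mm jj) (fun mm => c mm pp) k) : EuclideanSpace ℂ (Fin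
            3))) jj)) / (2 * Real.pi * Complex.I * ((freqNormSq k : ℝ) : ℂ)) := by
          rw [hph]
          dsimp only
          rw [kdot_sub']
        rw [e, hFt k, zero_sub]
        field_simp
      rw [hcoef, neg_smul]
      -- `N + c•ĉ + (−α kvec) − F = (N − ΠN) − α kvec + (ΠN + c ĉ − F) = 0`
      have e3 : (((ν * (4 * Real.pi ^ 2 * freqNormSq k)) : ℝ) : ℂ) • c k = F k - Torus.lerayCoeff k ((WithLp.toLp 2
          (fun pp : Fin 3 => transportSym (fun jj mm => c mm jj) (fun mm => c mm pp) k) : EuclideanSpace ℂ (Fin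
          3))) :=
        eq_sub_of_add_eq h1
      rw [e3]
      linear_combination (norm := module) hsplit
  have hE0 : E = 0 := eq_zero_of_forall_mFourierCoeff_eq_zero hEc hEcoeff
  -- the real momentum equation
  have hmom : ∀ y, Torus.convect u u y = ν • laplacian u y - Torus.gradient p y + f y := by
    intro y
    have hy := congrFun hE0 y
    simp only [hE, Pi.zero_apply] at hy
    ext l
    have hl := congrArg (fun v : (EuclideanSpace ℂ (Fin 3)) => (v l).re) hy
    simp only [PiLp.sub_apply, PiLp.add_apply, PiLp.smul_apply, complexify_apply, smul_eq_mul, Complex.sub_re,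
      Complex.add_re, Complex.ofReal_re, Complex.mul_re, Complex.ofReal_im, zero_mul, sub_zero,
      PiLp.zero_apply, Complex.zero_re] at hl
    have hg : (Torus.gradientC P y l).re = Torus.gradient p y l := by
      rw [Torus.gradientC, PiLp.toLp_apply, Torus.gradient_coord (hps.isContDiff (by simp)) y l, hp]
      exact (Torus.partialDeriv_re hPs l y).symm
    rw [hg] at hl
    simp only [PiLp.sub_apply, PiLp.add_apply, PiLp.smul_apply, smul_eq_mul]
    linarith
  -- incompressibility
  have hdiv : IsDivFree u := by
    intro y
    set D : (UnitAddTorus (Fin 3)) → ℂ := fun z => ∑ l, Torus.partialDeriv l (fun w => ((u w l : ℝ) : ℂ)) z with hD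
    have hDc : Continuous D := continuous_finsetSum _ fun l _ => (((hu.apply l).ofReal).partialDeriv l).continuous
    have hDcoeff : ∀ k, mFourierCoeff D k = 0 := by
      intro k
      rw [hD, mFourierCoeff_finset_sum (f := fun l => Torus.partialDeriv l (fun w => ((u w l : ℝ) : ℂ))) _
        (fun l _ => (((hu.apply l).ofReal).partialDeriv l).integrable)]
      have h2 : ∀ l, mFourierCoeff (Torus.partialDeriv l (fun w => ((u w l : ℝ) : ℂ))) k = dsym l k * c k l :=
          fun l => by
        rw [mFourierCoeff_partialDeriv ((hu.apply l).ofReal) l k, coeff_ofReal_apply hu k l, hû, dsym_apply,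
            smul_eq_mul]
      simp only [h2, dsym_apply]
      calc ∑ l, 2 * ↑Real.pi * Complex.I * (((k l : ℤ) : ℂ)) * c k l
          = 2 * ↑Real.pi * Complex.I * (∑ jj : Fin 3, ((k jj : ℤ) : ℂ) * (c k) jj) := by
            rw [Finset.mul_sum]; exact Finset.sum_congr rfl fun l _ => by ring
        _ = 0 := by rw [hct k, mul_zero]
    have hD0 : D = 0 := eq_zero_of_forall_mFourierCoeff_eq_zero hDc hDcoeff
    have hy := congrFun hD0 y
    simp only [hD, Pi.zero_apply, partialDeriv_ofReal_apply hu] at hy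
    unfold Torus.divergence
    exact_mod_cast hy
  -- zero mean
  have hmean : HasZeroMean u := by
    have h0 : HasZeroMean (complexify ∘ u) := hasZeroMean_of_mFourierCoeff_zero (by rw [hû]; exact hc0)
    unfold HasZeroMean at h0 ⊢
    rw [show (complexify ∘ u : (UnitAddTorus (Fin 3)) → (EuclideanSpace ℂ (Fin 3))) = fun x => (complexify :
        (EuclideanSpace ℝ (Fin 3)) →ₗᵢ[ℝ] (EuclideanSpace ℂ (Fin 3))).toContinuousLinearMap (u x)
      from rfl, ContinuousLinearMap.integral_comp_comm _ hu.integrable] at h0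
    exact complexify_injective (by simpa using h0)
  refine ⟨u, p, ⟨isSmoothSpaceTimeOn_const hu _, isSmoothSpaceTimeOn_const hps _, fun t _ y => ?_,
    fun _ _ => hdiv⟩, hmean, hu, hû⟩
  have ht : Torus.timeDerivWithin Set.univ (fun _ : ℝ => u) t y = 0 := by simp [Torus.timeDerivWithin]
  rw [ht, zero_add]
  exact hmom y


/-- `Torus.realToComplex` is the complexification `EuclideanSpace.complexify`. [folklore] -/
theorem realToComplex_eq_complexify (v : (EuclideanSpace ℝ (Fin 3))) : Torus.realToComplex v = complexify v := by
  ext i; rw [Torus.realToComplex_apply, complexify_apply]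

/-- The stretching term `(w·∇)u` of a smooth complex field against a smooth real field is smooth. [folklore] -/
theorem isSmooth_stretch {u : (UnitAddTorus (Fin 3)) → (EuclideanSpace ℝ (Fin 3))} {w : (UnitAddTorus (Fin 3)) →
    (EuclideanSpace ℂ (Fin 3))} (hu : IsSmooth u) (hw : IsSmooth w) :
    IsSmooth (Torus.stretch w u) := by
  have e : Torus.stretch w u = fun y => ∑ j, (fun z => w z j) y • (complexify ∘ Torus.partialDeriv j u) y := by
    funext y
    rw [Torus.stretch]
    refine Finset.sum_congr rfl fun j _ => ?_
    rw [Function.comp_apply, realToComplex_eq_complexify]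
  rw [e]
  have hterm : ∀ j, IsSmooth (fun y => (fun z => w z j) y • (complexify ∘ Torus.partialDeriv j u) y) := fun j =>
    ContDiff.smul (hw.comp_clm ((EuclideanSpace.proj j : (EuclideanSpace ℂ (Fin 3)) →L[ℂ] ℂ).restrictScalars ℝ))
      (hu.partialDeriv j).complexify_comp
  have h := ContDiff.sum (s := (Finset.univ : Finset (Fin 3))) (fun j _ => hterm j)
  exact h

set_option maxHeartbeats 800000 in
/-- **From a rapidly decaying non-zero kernel vector of the linearised lattice operator to a
classical eigenvector** of the linearised Navier–Stokes operator at a smooth divergence-free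
`u₀` (Fourier synthesis with the pressure symbol `−(k·M(k))/(2πi|k|²)`). [folklore] -/
theorem isLinNSEigenvalue_of_fourier {ν : ℝ} {u₀ : (UnitAddTorus (Fin 3)) → (EuclideanSpace ℝ (Fin 3))} (hu₀ :
    IsSmooth u₀) (hdiv₀ : IsDivFree u₀)
    {c : (Fin 3 → ℤ) → (EuclideanSpace ℂ (Fin 3))} (hc : RapidDecay c) (hct : ∀ k : (Fin 3 → ℤ), (∑ jj : Fin 3, ((k
        jj : ℤ) : ℂ) * (c k) jj) = 0) (hc0 : c 0 = 0) (hcne : c ≠ 0)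
    (heq : ∀ k : (Fin 3 → ℤ), (((ν * (4 * Real.pi ^ 2 * freqNormSq k)) : ℝ) : ℂ) • c k +
      Torus.lerayCoeff k ((WithLp.toLp 2 (fun pp : Fin 3 => transportSym (fun jj mm => (mFourierCoeff (complexify
          ∘ u₀)) mm jj) (fun mm => c mm pp) k) : EuclideanSpace ℂ (Fin 3)) + (WithLp.toLp 2 (fun pp : Fin
          3 => transportSym (fun jj mm => c mm jj) (fun mm => (mFourierCoeff (complexify ∘ u₀)) mm pp) k) :
          EuclideanSpace ℂ (Fin 3))) = 0) :
    Torus.IsLinNSEigenvalue ν u₀ 0 := by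
  set a : (Fin 3 → ℤ) → (EuclideanSpace ℂ (Fin 3)) := mFourierCoeff (complexify ∘ u₀) with ha
  have har : RapidDecay a := hu₀.complexify_comp.rapidDecay_mFourierCoeff
  have hat : ∀ m : (Fin 3 → ℤ), (∑ jj : Fin 3, ((m jj : ℤ) : ℂ) * (a m) jj) = 0 :=
      fun m => hdiv₀.sum_mul_mFourierCoeff_eq_zero hu₀ m
  -- the velocity
  set w : (UnitAddTorus (Fin 3)) → (EuclideanSpace ℂ (Fin 3)) := fourierSynth c with hwdef
  have hw : IsSmooth w := hc.isSmooth_fourierSynth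
  have hŵ : mFourierCoeff w = c := funext hc.mFourierCoeff_fourierSynth
  -- the linearised convective symbol is the coefficient family of a smooth field
  have hM : ∀ k, mFourierCoeff (Torus.convect u₀ w) k + mFourierCoeff (Torus.stretch w u₀) k = (WithLp.toLp 2 (fun
      pp : Fin 3 => transportSym (fun jj mm => a mm jj) (fun mm => c mm pp) k) : EuclideanSpace ℂ (Fin 3)) +
      (WithLp.toLp 2 (fun pp : Fin 3 => transportSym (fun jj mm => c mm jj) (fun mm => a mm pp) k) : EuclideanSpace ℂ
      (Fin 3)) := by
    intro k
    rw [mFourierCoeff_convect_complex hu₀ hw k, mFourierCoeff_stretch hu₀ hw k, hŵ]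
  have hMr : RapidDecay (fun k => (WithLp.toLp 2 (fun pp : Fin 3 => transportSym (fun jj mm => a mm jj) (fun mm => c
      mm pp) k) : EuclideanSpace ℂ (Fin 3)) + (WithLp.toLp 2 (fun pp : Fin 3 => transportSym (fun jj mm => c mm jj)
      (fun mm => a mm pp) k) : EuclideanSpace ℂ (Fin 3))) := by
    have h := ((hu₀.convect hw).rapidDecay_mFourierCoeff).add ((isSmooth_stretch hu₀ hw).rapidDecay_mFourierCoeff)
    have e : mFourierCoeff (Torus.convect u₀ w) + mFourierCoeff (Torus.stretch w u₀) = fun k => (WithLp.toLp 2 (fun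
        pp : Fin 3 => transportSym (fun jj mm => a mm jj) (fun mm => c mm pp) k) : EuclideanSpace ℂ (Fin 3)) +
        (WithLp.toLp 2 (fun pp : Fin 3 => transportSym (fun jj mm => c mm jj) (fun mm => a mm pp) k) : EuclideanSpace
        ℂ (Fin 3)) :=
      funext hM
    rwa [e] at h
  have hM0 : (WithLp.toLp 2 (fun pp : Fin 3 => transportSym (fun jj mm => a mm jj) (fun mm => c mm pp) 0) :
      EuclideanSpace ℂ (Fin 3)) + (WithLp.toLp 2 (fun pp : Fin 3 => transportSym (fun jj mm => c mm jj) (fun mm => a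
      mm pp) 0) : EuclideanSpace ℂ (Fin 3)) = 0 := by
    rw [nl_zero_of_transversal a c hat (fun j p => summable_nl_rapid har hc 0 j p),
      nl_zero_of_transversal c a hct (fun j p => summable_nl_rapid hc har 0 j p), add_zero]
  -- the pressure
  set qh : (Fin 3 → ℤ) → ℂ := fun k => (∑ jj : Fin 3, ((k jj : ℤ) : ℂ) * (-((WithLp.toLp 2 (fun pp : Fin
      3 => transportSym (fun jj mm => a mm jj) (fun mm => c mm pp) k) : EuclideanSpace ℂ (Fin 3)) + (WithLp.toLp 2
      (fun pp : Fin 3 => transportSym (fun jj mm => c mm jj) (fun mm => a mm pp) k) : EuclideanSpace ℂ (Fin 3)))) jj)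
      / (2 * Real.pi * Complex.I * ((freqNormSq k : ℝ) : ℂ))
    with hqh
  have hqhr : RapidDecay qh := by
    have hg : RapidDecay (fun k => -((WithLp.toLp 2 (fun pp : Fin 3 => transportSym (fun jj mm => a mm jj) (fun
        mm => c mm pp) k) : EuclideanSpace ℂ (Fin 3)) + (WithLp.toLp 2 (fun pp : Fin 3 => transportSym (fun jj mm => c
        mm jj) (fun mm => a mm pp) k) : EuclideanSpace ℂ (Fin 3)))) := by
      have := hMr.const_smul (-1)
      convert this using 1
      funext k
      exact (neg_one_smul ℂ _).symm
    exact rapidDecay_pressureSymbol hg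
  set q : (UnitAddTorus (Fin 3)) → ℂ := fourierSynth qh with hq
  have hqs : IsSmooth q := hqhr.isSmooth_fourierSynth
  have hqc : ∀ k, mFourierCoeff q k = qh k := hqhr.mFourierCoeff_fourierSynth
  -- the linearised residual
  have hEc : Continuous (fun y => Torus.linearizedNSOperator ν u₀ w q y) := by
    have c1 : Continuous fun y => laplacian w y := hw.laplacian.continuous
    have c2 : Continuous (Torus.convect u₀ w) := (hu₀.convect hw).continuous
    have c3 : Continuous (Torus.stretch w u₀) := (isSmooth_stretch hu₀ hw).continuous
    have c4 : Continuous fun y => Torus.gradientC q y :=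
      (PiLp.continuous_toLp 2 _).comp (continuous_pi fun l => (hqs.partialDeriv l).continuous)
    simp only [Torus.linearizedNSOperator_apply]
    exact ((c1.const_smul ν).sub (c2.add c3)).sub c4
  have hEcoeff : ∀ k, mFourierCoeff (fun y => Torus.linearizedNSOperator ν u₀ w q y) k = 0 := by
    intro k
    have i1 : Integrable (fun y => laplacian w y) volume := hw.laplacian.integrable
    have i1' : Integrable ((ν : ℂ) • fun y => laplacian w y) volume := i1.smul (ν : ℂ)
    have i2 : Integrable (Torus.convect u₀ w) volume := (hu₀.convect hw).integrable
    have i3 : Integrable (Torus.stretch w u₀) volume := (isSmooth_stretch hu₀ hw).integrable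
    have i4 : Integrable (Torus.gradientC q) volume := by
      refine Continuous.integrable_unitAddTorus ?_
      exact (PiLp.continuous_toLp 2 _).comp (continuous_pi fun l => (hqs.partialDeriv l).continuous)
    have hfun : (fun y => Torus.linearizedNSOperator ν u₀ w q y) =
        ((ν : ℂ) • fun y => laplacian w y) - (Torus.convect u₀ w + Torus.stretch w u₀) - Torus.gradientC q := by
      funext y
      simp only [Torus.linearizedNSOperator_apply, Pi.sub_apply, Pi.add_apply, Pi.smul_apply, Complex.coe_smul]
    rw [hfun, mFourierCoeff_sub (i1'.sub (i2.add i3)) i4, mFourierCoeff_sub i1' (i2.add i3), mFourierCoeff_add i2 i3,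
      mFourierCoeff_const_smul, hM k, mFourierCoeff_gradientC hqs k, hqc k,
      show (fun y => laplacian w y) = laplacian w from rfl, Torus.mFourierCoeff_laplacian hw k, hŵ]
    by_cases hk : k = 0
    · subst hk
      rw [hM0, freqNormSq_zero, Torus.freqVec_zero, smul_zero, hc0]
      simp
    · have h1 := heq k
      have hq' : ((freqNormSq k : ℝ) : ℂ) ≠ 0 := by
        exact_mod_cast (ne_of_gt (lt_of_lt_of_le one_pos (one_le_freqNormSq' hk)))
      have hI : (2 * Real.pi * Complex.I : ℂ) ≠ 0 :=
        mul_ne_zero (mul_ne_zero two_ne_zero (by exact_mod_cast Real.pi_ne_zero)) Complex.I_ne_zero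
      have hsplit := sub_lerayCoeff hk ((WithLp.toLp 2 (fun pp : Fin 3 => transportSym (fun jj mm => a mm jj) (fun
          mm => c mm pp) k) : EuclideanSpace ℂ (Fin 3)) + (WithLp.toLp 2 (fun pp : Fin 3 => transportSym (fun jj
          mm => c mm jj) (fun mm => a mm pp) k) : EuclideanSpace ℂ (Fin 3)))
      have hcoef : 2 * Real.pi * Complex.I * qh k = -((∑ jj : Fin 3, ((k jj : ℤ) : ℂ) * ((WithLp.toLp 2 (fun pp : Fin
          3 => transportSym (fun jj mm => a mm jj) (fun mm => c mm pp) k) : EuclideanSpace ℂ (Fin 3)) + (WithLp.toLp 2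
          (fun pp : Fin 3 => transportSym (fun jj mm => c mm jj) (fun mm => a mm pp) k) : EuclideanSpace ℂ (Fin 3)))
          jj) / ((freqNormSq k : ℝ) : ℂ)) := by
        have e : qh k = -((∑ jj : Fin 3, ((k jj : ℤ) : ℂ) * ((WithLp.toLp 2 (fun pp : Fin 3 => transportSym (fun jj
            mm => a mm jj) (fun mm => c mm pp) k) : EuclideanSpace ℂ (Fin 3)) + (WithLp.toLp 2 (fun pp : Fin
            3 => transportSym (fun jj mm => c mm jj) (fun mm => a mm pp) k) : EuclideanSpace ℂ (Fin 3))) jj)) / (2 *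
            Real.pi * Complex.I * ((freqNormSq k : ℝ) : ℂ)) := by
          rw [hqh]
          dsimp only
          rw [show -((WithLp.toLp 2 (fun pp : Fin 3 => transportSym (fun jj mm => a mm jj) (fun mm => c mm pp) k) :
              EuclideanSpace ℂ (Fin 3)) + (WithLp.toLp 2 (fun pp : Fin 3 => transportSym (fun jj mm => c mm jj) (fun
              mm => a mm pp) k) : EuclideanSpace ℂ (Fin 3))) = (0 : (EuclideanSpace ℂ (Fin 3))) - ((WithLp.toLp 2 (fun
              pp : Fin 3 => transportSym (fun jj mm => a mm jj) (fun mm => c mm pp) k) : EuclideanSpace ℂ (Fin 3)) +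
              (WithLp.toLp 2 (fun pp : Fin 3 => transportSym (fun jj mm => c mm jj) (fun mm => a mm pp) k) :
              EuclideanSpace ℂ (Fin 3))) from (zero_sub _).symm, kdot_sub', kdot_zero,
            zero_sub]
        rw [e]
        field_simp
      rw [hcoef, neg_smul]
      have e3 : (ν : ℂ) • -((((4 * Real.pi ^ 2 * freqNormSq k : ℝ)) : ℂ) • c k) =
          Torus.lerayCoeff k ((WithLp.toLp 2 (fun pp : Fin 3 => transportSym (fun jj mm => a mm jj) (fun mm => c mm
              pp) k) : EuclideanSpace ℂ (Fin 3)) + (WithLp.toLp 2 (fun pp : Fin 3 => transportSym (fun jj mm => c mm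
              jj) (fun mm => a mm pp) k) : EuclideanSpace ℂ (Fin 3))) := by
        rw [smul_neg, smul_smul, ← Complex.ofReal_mul]
        exact (eq_neg_of_add_eq_zero_right h1).symm
      rw [e3]
      linear_combination (norm := module) -hsplit
  have hE0 : (fun y => Torus.linearizedNSOperator ν u₀ w q y) = 0 := eq_zero_of_forall_mFourierCoeff_eq_zero hEc
      hEcoeff
  -- divergence
  have hdivC : Torus.IsDivFreeC w := by
    intro y
    set D : (UnitAddTorus (Fin 3)) → ℂ := fun z => ∑ l, Torus.partialDeriv l (fun x => w x l) z with hD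
    have hwl : ∀ l, IsSmooth (fun x => w x l) := fun l =>
      hw.comp_clm ((EuclideanSpace.proj l : (EuclideanSpace ℂ (Fin 3)) →L[ℂ] ℂ).restrictScalars ℝ)
    have hDc : Continuous D := continuous_finsetSum _ fun l _ => ((hwl l).partialDeriv l).continuous
    have hDcoeff : ∀ k, mFourierCoeff D k = 0 := by
      intro k
      rw [hD, mFourierCoeff_finset_sum (f := fun l => Torus.partialDeriv l (fun x => w x l)) _
        (fun l _ => ((hwl l).partialDeriv l).integrable)]
      have h2 : ∀ l, mFourierCoeff (Torus.partialDeriv l (fun x => w x l)) k = dsym l k * c k l := fun l => by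
        rw [mFourierCoeff_partialDeriv (hwl l) l k, coeff_apply_complex hw k l, hŵ, dsym_apply, smul_eq_mul]
      simp only [h2, dsym_apply]
      calc ∑ l, 2 * ↑Real.pi * Complex.I * (((k l : ℤ) : ℂ)) * c k l
          = 2 * ↑Real.pi * Complex.I * (∑ jj : Fin 3, ((k jj : ℤ) : ℂ) * (c k) jj) := by
            rw [Finset.mul_sum]; exact Finset.sum_congr rfl fun l _ => by ring
        _ = 0 := by rw [hct k, mul_zero]
    have hD0 : D = 0 := eq_zero_of_forall_mFourierCoeff_eq_zero hDc hDcoeff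
    have hy := congrFun hD0 y
    simpa only [hD, Pi.zero_apply, Torus.divergenceC] using hy
  -- zero mean
  have hmean : HasZeroMean w := hasZeroMean_of_mFourierCoeff_zero (by rw [hŵ]; exact hc0)
  -- non-triviality
  have hwne : w ≠ 0 := by
    intro h0
    apply hcne
    rw [← hŵ, h0]
    funext k
    rw [show (0 : (UnitAddTorus (Fin 3)) → (EuclideanSpace ℂ (Fin 3))) = (0 : ℂ) • (0 : (UnitAddTorus (Fin 3)) →
        (EuclideanSpace ℂ (Fin 3))) by simp, mFourierCoeff_const_smul, zero_smul]
    rfl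
  refine ⟨w, hwne, hw, hdivC, hmean, q, hqs, fun y => ?_⟩
  have hy := congrFun hE0 y
  simp only [Pi.zero_apply] at hy
  rw [hy, zero_smul, sub_zero, Pi.zero_apply]

end Classical

/-! ## §J Leray-projected trigonometric-polynomial force families `c ↦ realTrigPoly S (Π ĉ)` -/

section Force

/-- A rapidly decaying family is square summable. [folklore] -/
theorem memℓp_two_of_rapidDecay {g : (Fin 3 → ℤ) → (EuclideanSpace ℂ (Fin 3))} (hg : RapidDecay g) : Memℓp g 2 := by
  have hs : Summable fun k => ‖g k‖ := hg.summable_norm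
  rw [memℓp_gen_iff (by norm_num : 0 < (2 : ℝ≥0∞).toReal)]
  simp only [ENNReal.toReal_ofNat, Real.rpow_two]
  refine Summable.of_nonneg_of_le (fun k => sq_nonneg _) (fun k => ?_) (hs.mul_left (∑' m, ‖g m‖))
  rw [sq]
  exact mul_le_mul_of_nonneg_right (hs.le_tsum k fun m _ => norm_nonneg _) (norm_nonneg _)

variable {S : Finset (Fin 3 → ℤ)}

/-- The coefficient family of `f_c` is additive in `c`. [folklore] -/
theorem forceFamily_add (c c' : (↥S → EuclideanSpace ℂ (Fin 3))) :
    (fun k => Torus.lerayCoeff k (coeffExt S (c + c') k)) =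
      (fun k => Torus.lerayCoeff k (coeffExt S c k)) + fun k => Torus.lerayCoeff k (coeffExt S c' k) := by
  funext k
  simp [coeffExt_add, Torus.lerayCoeff_add]

/-- The coefficient family of `f_c` is `ℝ`-homogeneous in `c`. [folklore] -/
theorem forceFamily_smul (a : ℝ) (c : (↥S → EuclideanSpace ℂ (Fin 3))) :
    (fun k => Torus.lerayCoeff k (coeffExt S (a • c) k)) = (a : ℂ) • fun k => Torus.lerayCoeff k (coeffExt S c
        k) := by
  funext k
  simp only [Pi.smul_apply]
  rw [← lerayCoeff_smul']
  congr 1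
  by_cases hk : k ∈ S
  · simp [coeffExt, hk, Complex.coe_smul]
  · simp [coeffExt, hk]

/-- `c ↦ f_c` is additive (pattern of the summit-side force bookkeeping). [folklore] -/
theorem projForce_add (c c' : (↥S → EuclideanSpace ℂ (Fin 3))) : realTrigPoly S (fun k => Torus.lerayCoeff k (coeffExt
    S (c + c') k)) = realTrigPoly S (fun k => Torus.lerayCoeff k (coeffExt S c k)) + realTrigPoly S (fun
    k => Torus.lerayCoeff k (coeffExt S c' k)) := by
  rw [forceFamily_add, realTrigPoly_add]

/-- `c ↦ f_c` is `ℝ`-homogeneous (pattern of the summit-side force bookkeeping). [folklore] -/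
theorem projForce_smul (a : ℝ) (c : (↥S → EuclideanSpace ℂ (Fin 3))) : realTrigPoly S (fun k => Torus.lerayCoeff k
    (coeffExt S (a • c) k)) = a • realTrigPoly S (fun k => Torus.lerayCoeff k (coeffExt S c k)) := by
  funext x
  ext i
  change realTrigPoly S (fun k => Torus.lerayCoeff k (coeffExt S (a • c) k)) x i =
    (a • realTrigPoly S (fun k => Torus.lerayCoeff k (coeffExt S c k)) x) i
  rw [forceFamily_smul]
  simp only [realTrigPoly_apply_coord, trigPoly_apply_coord, Pi.smul_apply, PiLp.smul_apply, smul_eq_mul]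
  have hsum : (∑ k ∈ S, mFourier k x * ((a : ℂ) * Torus.lerayCoeff k (coeffExt S c k) i)) =
      (a : ℂ) * ∑ k ∈ S, mFourier k x * Torus.lerayCoeff k (coeffExt S c k) i := by
    rw [Finset.mul_sum]
    exact Finset.sum_congr rfl fun k _ => by ring
  rw [hsum, Complex.re_ofReal_mul]

/-- `f_c` is smooth. [folklore] -/
theorem isSmooth_projForce (c : (↥S → EuclideanSpace ℂ (Fin 3))) : IsSmooth (realTrigPoly S (fun k => Torus.lerayCoeff
    k (coeffExt S c k))) := isSmooth_realTrigPoly _ _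

/-- `f_c` is divergence free (pattern of the summit-side force bookkeeping). [folklore] -/
theorem isDivFree_projForce (c : (↥S → EuclideanSpace ℂ (Fin 3))) : IsDivFree (realTrigPoly S (fun
    k => Torus.lerayCoeff k (coeffExt S c k))) :=
  isDivFree_realTrigPoly fun k _ => kdot_lerayCoeff k _

/-- `f_c` has zero mean (pattern of the summit-side force bookkeeping). [folklore] -/
theorem hasZeroMean_projForce (c : (↥S → EuclideanSpace ℂ (Fin 3))) : HasZeroMean (realTrigPoly S (fun
    k => Torus.lerayCoeff k (coeffExt S c k))) := by
  unfold HasZeroMean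
  change ∫ x, realTrigPoly S (fun k => Torus.lerayCoeff k (coeffExt S c k)) x = 0
  simp only [realTrigPoly_apply]
  have hint : Integrable (trigPoly S (fun k => Torus.lerayCoeff k (coeffExt S c k))) volume :=
    (continuous_trigPoly S _).integrable_unitAddTorus
  rw [ContinuousLinearMap.integral_comp_comm _ hint]
  have h0 : ∫ x, trigPoly S (fun k => Torus.lerayCoeff k (coeffExt S c k)) x = 0 := by
    simp only [trigPoly_apply]
    rw [integral_finsetSum S (f := fun k x => UnitAddTorus.mFourier k x • Torus.lerayCoeff k (coeffExt S c k))
      fun k _ => ((UnitAddTorus.mFourier k).continuous.smul continuous_const).integrable_unitAddTorus]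
    refine Finset.sum_eq_zero fun k _ => ?_
    rw [integral_smul_const, integral_mFourier]
    by_cases hk : k = 0
    · subst hk; simp
    · simp [hk]
  rw [h0, map_zero]

/-- The Fourier coefficients of the forces: rapid decay. [folklore] -/
theorem rapidDecay_projForceCoeff (c : (↥S → EuclideanSpace ℂ (Fin 3))) : RapidDecay (mFourierCoeff (complexify
    ∘ realTrigPoly S (fun k => Torus.lerayCoeff k (coeffExt S c k)))) :=
  (isSmooth_projForce c).complexify_comp.rapidDecay_mFourierCoeff

/-- The Leray multiplier fixes the force coefficients (divergence free, mean zero). [folklore] -/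
theorem lerayCoeff_projForceCoeff (c : (↥S → EuclideanSpace ℂ (Fin 3))) (k : (Fin 3 → ℤ)) :
    Torus.lerayCoeff k (mFourierCoeff (complexify ∘ realTrigPoly S (fun k => Torus.lerayCoeff k (coeffExt S c k))) k)
        = mFourierCoeff (complexify ∘ realTrigPoly S (fun k => Torus.lerayCoeff k (coeffExt S c k))) k := by
  by_cases hk : k = 0
  · subst hk
    rw [mFourierCoeff_complexify_zero_of_hasZeroMean (isSmooth_projForce c) (hasZeroMean_projForce c),
      Torus.lerayCoeff_zero]
  · exact lerayCoeff_of_kdot_eq_zero hk ((isDivFree_projForce c).sum_mul_mFourierCoeff_eq_zero (isSmooth_projForce c)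
      k)

variable {W : Submodule ℝ (lp (fun _ : Fin 3 → ℤ => EuclideanSpace ℂ (Fin 3)) 2)} (hW : ∀ x : (lp (fun _ : Fin 3 →
    ℤ => EuclideanSpace ℂ (Fin 3)) 2), x ∈ W ↔ (((x : (Fin 3 → ℤ) → (EuclideanSpace ℂ (Fin 3))) : (Fin 3 → ℤ) →
    EuclideanSpace ℂ (Fin 3)) 0 = 0 ∧ (∀ kk : Fin 3 → ℤ, (∑ jj : Fin 3, ((kk jj : ℤ) : ℂ) * (((x : (Fin 3 → ℤ) →
    (EuclideanSpace ℂ (Fin 3))) : (Fin 3 → ℤ) → EuclideanSpace ℂ (Fin 3)) kk) jj) = 0) ∧ IsConjSymm ((x : (Fin 3 → ℤ)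
    → (EuclideanSpace ℂ (Fin 3))) : (Fin 3 → ℤ) → EuclideanSpace ℂ (Fin 3))))
include hW

/-- **The force coefficients as a linear map into the state space**:
`c' ↦ (𝓕(complexify ∘ f_{c'})(k))_k ∈ W`, `ℝ`-linear in `c'`. [folklore] -/
theorem exists_projForceMap : ∃ Fm : (↥S → EuclideanSpace ℂ (Fin 3)) →ₗ[ℝ] W,
    ∀ c' : (↥S → EuclideanSpace ℂ (Fin 3)), (((Fm c' : W) : (lp (fun _ : Fin 3 → ℤ => EuclideanSpace ℂ (Fin 3)) 2)) :
        (Fin 3 → ℤ) → (EuclideanSpace ℂ (Fin 3))) = mFourierCoeff (complexify ∘ realTrigPoly S (fun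
        k => Torus.lerayCoeff k (coeffExt S c' k))) := by
  have hV : ∀ c' : (↥S → EuclideanSpace ℂ (Fin 3)), (((mFourierCoeff (complexify ∘ realTrigPoly S (fun
      k => Torus.lerayCoeff k (coeffExt S c' k)))) : (Fin 3 → ℤ) → EuclideanSpace ℂ (Fin 3)) 0 = 0 ∧ (∀ kk : Fin 3 →
      ℤ, (∑ jj : Fin 3, ((kk jj : ℤ) : ℂ) * (((mFourierCoeff (complexify ∘ realTrigPoly S (fun k => Torus.lerayCoeff k
      (coeffExt S c' k)))) : (Fin 3 → ℤ) → EuclideanSpace ℂ (Fin 3)) kk) jj) = 0) ∧ IsConjSymm ((mFourierCoeff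
      (complexify ∘ realTrigPoly S (fun k => Torus.lerayCoeff k (coeffExt S c' k)))) : (Fin 3 → ℤ) → EuclideanSpace ℂ
      (Fin 3))) := fun c' =>
    ⟨mFourierCoeff_complexify_zero_of_hasZeroMean (isSmooth_projForce c') (hasZeroMean_projForce c'),
      fun k => (isDivFree_projForce c').sum_mul_mFourierCoeff_eq_zero (isSmooth_projForce c') k,
      isConjSymm_mFourierCoeff (isSmooth_projForce c').integrable⟩
  set T : (↥S → EuclideanSpace ℂ (Fin 3)) → W := fun c' => ⟨⟨mFourierCoeff (complexify ∘ realTrigPoly S (fun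
      k => Torus.lerayCoeff k (coeffExt S c' k))),
    memℓp_two_of_rapidDecay (rapidDecay_projForceCoeff c')⟩, (hW _).2 (hV c')⟩ with hT
  have hTcoe : ∀ c', (((T c' : W) : (lp (fun _ : Fin 3 → ℤ => EuclideanSpace ℂ (Fin 3)) 2)) : (Fin 3 → ℤ) →
      (EuclideanSpace ℂ (Fin 3))) = mFourierCoeff (complexify ∘ realTrigPoly S (fun k => Torus.lerayCoeff k (coeffExt
      S c' k))) := fun c' => rfl
  refine ⟨{ toFun := T, map_add' := fun c₁ c₂ => ?_, map_smul' := fun a c' => ?_ }, fun c' => rfl⟩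
  · refine Subtype.ext (lp.ext ?_)
    rw [coeW_add, hTcoe, hTcoe, hTcoe, projForce_add]
    have e : (complexify ∘ (realTrigPoly S (fun k => Torus.lerayCoeff k (coeffExt S c₁ k)) + realTrigPoly S (fun
        k => Torus.lerayCoeff k (coeffExt S c₂ k))) : (UnitAddTorus (Fin 3)) → (EuclideanSpace ℂ (Fin 3))) =
        (complexify ∘ realTrigPoly S (fun k => Torus.lerayCoeff k (coeffExt S c₁ k))) + (complexify ∘ realTrigPoly S
        (fun k => Torus.lerayCoeff k (coeffExt S c₂ k))) := by
      funext y; simp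
    funext k
    rw [e, Pi.add_apply, mFourierCoeff_add (isSmooth_projForce c₁).complexify_comp.integrable
      (isSmooth_projForce c₂).complexify_comp.integrable]
  · refine Subtype.ext (lp.ext ?_)
    rw [RingHom.id_apply, coeW_smul, hTcoe, hTcoe, projForce_smul]
    have e : (complexify ∘ (a • realTrigPoly S (fun k => Torus.lerayCoeff k (coeffExt S c' k))) : (UnitAddTorus (Fin
        3)) → (EuclideanSpace ℂ (Fin 3))) = (a : ℂ) • (complexify ∘ realTrigPoly S (fun k => Torus.lerayCoeff k
        (coeffExt S c' k))) := by
      funext y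
      simp only [Function.comp_apply, Pi.smul_apply, coe_smul_complexify]
    funext k
    rw [e, mFourierCoeff_const_smul, Pi.smul_apply, Complex.coe_smul]

end Force

/-! ## §M Auxiliary estimates for the persistence argument -/

section Auxiliary

/-- `|k|² ‖(cf z) k‖² ≤ ‖z k‖²` in `ℝ≥0∞`. [folklore] -/
theorem freq_mul_enorm_cf_sq_le (z : (Fin 3 → ℤ) → (EuclideanSpace ℂ (Fin 3))) (k : (Fin 3 → ℤ)) :
    ENNReal.ofReal (freqNormSq k) * ‖(((fun mm : Fin 3 → ℤ => (((freqNormSq mm)⁻¹ : ℝ) : ℂ)) • (z : (Fin 3 → ℤ) →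
        EuclideanSpace ℂ (Fin 3)))) k‖ₑ ^ 2 ≤ ‖z k‖ₑ ^ 2 := by
  by_cases hk : k = 0
  · subst hk; rw [cf_zero, enorm_zero]; simp
  · have hf : 0 < freqNormSq k := lt_of_lt_of_le one_pos (one_le_freqNormSq' hk)
    have h : freqNormSq k * ‖(((fun mm : Fin 3 → ℤ => (((freqNormSq mm)⁻¹ : ℝ) : ℂ)) • (z : (Fin 3 → ℤ) →
        EuclideanSpace ℂ (Fin 3)))) k‖ ^ 2 ≤ ‖z k‖ ^ 2 := by
      rw [norm_cf, mul_pow, ← mul_assoc]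
      refine mul_le_of_le_one_left (sq_nonneg _) ?_
      rw [inv_pow, ← div_eq_mul_inv, div_le_one (by positivity)]
      nlinarith [one_le_freqNormSq' hk]
    have h' := ENNReal.ofReal_le_ofReal h
    rw [ENNReal.ofReal_mul hf.le, ENNReal.ofReal_pow (norm_nonneg _), ENNReal.ofReal_pow (norm_nonneg _),
      ofReal_norm, ofReal_norm] at h'
    exact h'

/-- **Parseval control of the squared `H¹` distance by the state-space distance**: for smooth `v`
with `𝓕(complexify ∘ v) = cf z`, `∫‖v‖² + ‖∇v‖₂² ≤ (1 + 4π²) ‖z‖²`. [folklore] -/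
theorem h1_le_of_coeff {v : (UnitAddTorus (Fin 3)) → (EuclideanSpace ℝ (Fin 3))} (hv : IsSmooth v) (z : (lp (fun _ :
    Fin 3 → ℤ => EuclideanSpace ℂ (Fin 3)) 2))
    (hcoef : mFourierCoeff (complexify ∘ v) = ((fun mm : Fin 3 → ℤ => (((freqNormSq mm)⁻¹ : ℝ) : ℂ)) • ((z : (Fin 3 →
        ℤ) → (EuclideanSpace ℂ (Fin 3))) : (Fin 3 → ℤ) → EuclideanSpace ℂ (Fin 3)))) :
    (∫ x, ‖v x‖ ^ 2) + gradNormSq v ≤ (1 + 4 * Real.pi ^ 2) * ‖z‖ ^ 2 := by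
  -- the `L²` part
  have hL2 : (∫ x, ‖v x‖ ^ 2) ≤ ‖z‖ ^ 2 := by
    rw [integral_norm_sq_eq_tsum (hv.memLp 2), hcoef, l2_norm_sq_eq_tsum]
    have hs := (l2_hasSum_norm_sq z).summable
    have hle : ∀ k, ‖(((fun mm : Fin 3 → ℤ => (((freqNormSq mm)⁻¹ : ℝ) : ℂ)) • ((z : (Fin 3 → ℤ) → (EuclideanSpace ℂ
        (Fin 3))) : (Fin 3 → ℤ) → EuclideanSpace ℂ (Fin 3)))) k‖ ^ 2 ≤ ‖(z : (Fin 3 → ℤ) → (EuclideanSpace ℂ (Fin 3)))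
        k‖ ^ 2 := fun k =>
      pow_le_pow_left₀ (norm_nonneg _) (norm_cf_le _ k) 2
    exact Summable.tsum_le_tsum hle (Summable.of_nonneg_of_le (fun k => sq_nonneg _) hle hs) hs
  -- the gradient part
  have hG : gradNormSq v ≤ 4 * Real.pi ^ 2 * ‖z‖ ^ 2 := by
    have h := tsum_freqNormSq_mul_enorm_sq_mFourierCoeff_complexify hv
    rw [hcoef] at h
    have hle : ∑' k, ENNReal.ofReal (freqNormSq k) * ‖(((fun mm : Fin 3 → ℤ => (((freqNormSq mm)⁻¹ : ℝ) : ℂ)) • ((z :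
        (Fin 3 → ℤ) → (EuclideanSpace ℂ (Fin 3))) : (Fin 3 → ℤ) → EuclideanSpace ℂ (Fin 3)))) k‖ₑ ^ 2 ≤ ‖z‖ₑ ^ 2 := by
      rw [l2_enorm_sq_eq_tsum]
      exact ENNReal.tsum_le_tsum fun k => freq_mul_enorm_cf_sq_le _ k
    rw [h, ← ofReal_norm, ← ENNReal.ofReal_pow (norm_nonneg _), ENNReal.ofReal_le_ofReal_iff (sq_nonneg _)] at hle
    have hpi : (0 : ℝ) < 4 * Real.pi ^ 2 := by positivity
    rw [inv_mul_le_iff₀ hpi] at hle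
    exact hle
  nlinarith

/-- The element of `ℓ²` with coordinates `|k|² â(k)` represents `â` through `cf`. [folklore] -/
theorem cf_weight_smul {a : (Fin 3 → ℤ) → (EuclideanSpace ℂ (Fin 3))} (ha0 : a 0 = 0) :
    ((fun mm : Fin 3 → ℤ => (((freqNormSq mm)⁻¹ : ℝ) : ℂ)) • ((fun k : (Fin 3 → ℤ) => ((freqNormSq k : ℝ) : ℂ) • a
        k) : (Fin 3 → ℤ) → EuclideanSpace ℂ (Fin 3))) = a := by
  funext k
  rw [cf_apply]
  by_cases hk : k = 0
  · subst hk; rw [ha0, smul_zero, smul_zero]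
  · have hf : freqNormSq k ≠ 0 := ne_of_gt (lt_of_lt_of_le one_pos (one_le_freqNormSq' hk))
    rw [smul_smul, ← Complex.ofReal_mul, inv_mul_cancel₀ hf, Complex.ofReal_one, one_smul]

/-- Conversion of the scalar: `(4π²ν) x(k) = (ν 4π²|k|²) (cf x)(k)` when `x 0 = 0`. [folklore] -/
theorem smul_eq_weight_smul_cf {ν : ℝ} {x : (Fin 3 → ℤ) → (EuclideanSpace ℂ (Fin 3))} (hx0 : x 0 = 0) (k : (Fin 3 →
    ℤ)) :
    (((4 * Real.pi ^ 2 * ν : ℝ)) : ℂ) • x k = (((ν * (4 * Real.pi ^ 2 * freqNormSq k)) : ℝ) : ℂ) • (((fun mm : Fin 3 →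
        ℤ => (((freqNormSq mm)⁻¹ : ℝ) : ℂ)) • (x : (Fin 3 → ℤ) → EuclideanSpace ℂ (Fin 3)))) k := by
  by_cases hk : k = 0
  · subst hk; rw [hx0, cf_zero, smul_zero, smul_zero]
  · have hf : ((freqNormSq k : ℝ) : ℂ) ≠ 0 := by
      exact_mod_cast ne_of_gt (lt_of_lt_of_le one_pos (one_le_freqNormSq' hk))
    rw [cf_apply, smul_smul, ← Complex.ofReal_mul]
    congr 1
    push_cast
    field_simp

end Auxiliary

end SteadyLattice

end Literature.Analysis.FluidPDE

end
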